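import Literature.MathematicalPhysics.QuantumFieldTheory.Balaban1983to89.T4TrajectoryComparison

/-!
# T4TrajectoryModulus — `T4TrajectoryComparison` IN MODULUS CURRENCY: the RESPONSE-MODULUS FORMAT of the ℝ-continued
carried functions, the AFFINE CONTINUATION LAW, and the dressed pipelines fed at response level (cell `pub-balaban`,
T4-DAG row T4-O3.E-NE1′-PROVE-P1g*, node O3b / H2, prover seat P1, technique «RG-trajectory comparison»; kernel
bookkeeping [arith]/[folklore] + typed seams; NOT summit progress)
v1 (gen 7, row `T4-O3.E-NE1′-PROVE-P1g*`, record `t4/T4-EST-NE1p-P1.md` v1.12).  WHY A NEW LEAF: in content this is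
§15 of `T4TrajectoryComparison` (v1.7, p189020), written after XREAD C-pv18g20-3 (finding M2, MEDIUM, format; reader
pv18-g20, outside this lineage; owner option (a), fix-forward, additive); the gate caps one file at 200 000 bytes and
`T4TrajectoryComparison` v1.7 has 197 296, so the lineage's fifth leaf continues the fourth by IMPORT — one writer,
append-only, nothing of `T4TrajectoryComparison` modified or restated.  CONVENTION: `§n` with a NUMBER below = section n
of `T4TrajectoryComparison`; this file's own sections are §A–§L (§F–§I since v1.1, §J since v1.2, §K since v1.3, §L since
v1.4).
v1.1 (gen 8, row `T4-O3.E-NE1′-PROVE-P1h*`, record v1.13; ADDITIVE on v1 = p189418 93204e2dfdda after XREAD C-pv10-97 —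
reader pv10-g19, outside this lineage, verdict «ok — CONSISTENT AS TYPED» with finding T1 (typing), DOCFIX D1/D2, INFO
I2/I3, all answered here; no landed declaration reworded or retyped): §F the step law on an INTEGRAND CLASS
`ContStepLawOn 𝒢` (T1 option (a): pv10-g19's kernel-checked offer `HOME/b2b-balaban-pv10-g19/xread2/TwinC.lean` §(C3)
2d9a13b0a07159ad taken verbatim WITH CREDIT); §G SCALE-DEPENDENT admissibility `Adm b k′ k` and the binder-from-law on a
class (I3); §H THE CAUCHY SUPPLIER of the law's background-Lipschitz binder — `ℓ = 4a/ϱ` from the CENTRED operation's own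
slice-analyticity in the background (`T4BirthChartTransport.slice_bound` BY NAME) —, the gauge quotient at response
level, the Cauchy currency end to end (`transportsFromVar_of_opSlices`), a non-vacuity toy; the §14 window twin of the
§13 consistency witness (I2, pv10-g19's, credited); header attributions D1/D2 corrected (marked «v1.1»).
v1.2 (gen 8, same row; ADDITIVE on v1.1 = p190330 d33fdbb2f3f7; no landed declaration reworded or retyped): §J THE
LINEAR-OPERATION SUPPLIER of §H's two analytic binders — for a SUBTRACTIVE, NORMALISED one-step operation both the sup
cost `hsup` and the centred slice `hEsl` follow from ONE operator-level format `OpSlice` (every integrand bounded by `m`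
on `D` has the chart slice with sup `a·m`): `opSlice_centred`, `supCost_of_opSlice`, `contStepLawOn_of_linearOpSlice`,
`transportsFromVar_of_linearOpSlices`, a toy.
v1.3 (gen 9, row `T4-O3.E-NE1′-PROVE-P1i*`, record v1.15; ADDITIVE on v1.2 = p190450 30e07ef62d4d, both deltas cross-read ok —
C-pv20-60 (pv20-g17, v1 → v1.1) and C-ref5-179 (ref5-g43, v1.1 → v1.2); no landed declaration reworded or retyped; ONE DOCFIX
marked «v1.3»): §K THE WINDOW GUARD — own finding: §C/§F's action fields `covariant`/`fluctPair` and §H/§J's [cell] binders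
`hcov`/`hpair` range over admissible pairs of EVERY defect although `respMod_continue` uses them only inside the window
`δ ≤ w`; kernel witnesses that the unguarded `hpair` degenerates the lower base set (`base_of_hpair_unguarded`,
`lattice_base_of_hpair_unguarded`); the GUARDED re-cuts `contStepLawOn_of_opSlice_windowed` /
`contStepLawOn_of_linearOpSlice_windowed` on `Windowed (RawAdm …) w` and the pipelines `transportsFromVar_of_opSlices_windowed`
/ `transportsFromVar_of_linearOpSlices_windowed` (same constants); the LATTICE GEOMETRY instance on `ℤ^d` with the additive
background–fluctuation composition — `hcov`/`hpair`/`hdir` DISCHARGED into window NESTING (N1)/(N2) + fluctuation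
DIAMETER (DIAM): `hcov_add`, `hpair_add`, `hdir_lattice`, `transportsFromVar_of_linearOpSlices_lattice`, bond-ball
arithmetic and a non-degenerate toy.
v1.4 (gen 10, row `T4-O3.E-NE1′-PROVE-P1j*`, record v1.16; ADDITIVE on v1.3 = p190809 a92c18c5be07, delta cross-read ok —
C-t4r3-35 (t4-ref3-g25, v1.2 → v1.3: «ok CONSISTENT ∣ FINDING GENUINE ∣ DOCFIX 0 (INFO 2)»; INFO-1 answered in PRINTED CONTEXT
below, marked «v1.4»); no landed declaration reworded or retyped): §L THE CLASS GUARD ON THE LINEAR SUPPLIER — own finding: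
§J's supplier binders `hsub` (subtractivity) and `hop` (`OpSlice`) — and with them §K's `…_linearOpSlice(s)_windowed` /
`…_lattice` — quantify over ALL integrands `g, g′ : Z → F`, although §F's class `𝒢` (typing T1, v1.1) exists precisely so
that `E U` may LITERALLY be a normalised integral; kernel witness `setIntegral_not_subtractive` (the class-free `hsub`
FAILS for the normalised Lebesgue operation on `[0,1]`, junk value `∫ = 0`); the GUARDED format `OpSliceOn 𝒢` and re-cuts
`opSliceOn_centred` / `supCost_of_opSliceOn` / `contStepLawOn_of_linearOpSliceOn_windowed` and the pipelines
`transportsFromVar_of_linearOpSlicesOn_windowed` / `transportsFromVar_of_linearOpSlicesOn_lattice` (same constants; the class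
contains the constants and is closed under differences), consistency at `𝒢 = univ`, and a toy in which an HONEST integral
operation meets every guarded binder.

HONEST FRAMING (cell `pub-balaban`, T4-DAG PAGE 1).  Rung (B)+1 of the cell's ladder on a FINITE four-torus:
existence and uniqueness of the continuum limit of Bałaban's unit-scale averaged loop expectations — CONDITIONAL on
BetaPertH and on (B)/(B^μ) wherever a consumer row uses them (THIS MODULE USES NONE OF THEM: abstract arrays over a landed
`T4TermFormat.Booking`, abstract normed groups, finite products, real arithmetic); NOT infinite volume, NOT the Yang–Mills
mass gap, NOT the Clay problem.  ABSOLUTE RULE honoured: no internally-minted statement is cited as a fact — every analytic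
or gauge-theoretic input below is a HYPOTHESIS SHAPE (a `def … : Prop`, a `structure … : Prop` or an explicit binder),
every theorem is [folklore] elementary normed-group / real arithmetic or [arith] the cell's own arithmetic on its own
displayed shapes, kernel-checked; Bałaban's papers are quoted for CONTEXT and for the SHAPE of their undisputed small-field
bookkeeping only, never for a disputed step; programme-internal analyses are labelled [cell] and are NOT facts.

THE ROW (payload of this seat, verbatim): «DRESSED STABILITY in the observable-attached format — (ℝT)^K on ρ₀·f_μ with
the (2.18)-type representation extended by observable-attached terms, μ-uniform constants. … RG-trajectory comparison:
extend B12's (2.18) inductive representation term by term with the observable insertion, tracking μ-uniformity through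
the printed small-field bounds.»

THE RESPONSE-MODULUS FORMAT of the ℝ-continued carried functions (XREAD C-pv18g20-3, finding M2,
owner option (a)), the AFFINE CONTINUATION LAW, and the dressed pipelines in modulus currency [folklore]

THE FINDING (M2, MEDIUM, format; reader pv18-g20, outside this lineage; CONSISTENT AS TYPED, fix-forward).  §13's `hsl`
(and §14's, verbatim in the window chart) asks the CONTINUED function `Fn b k′ k`, `k > k′`, to be analytic with sup
`(∏_{[k′,k)} α)·gen b k′` on the generation-`k′` BIRTH slice / window of the COMMON radius `r` — a chart sized to
birth-scale roughness.  Every printed supplier the §13 dictionary names lives on the THIN current-scale spaces: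
[Balaban1989LargeFieldII] (1.75) p. 380 is a sup-norm bound with `σ` small only for `A′` INSIDE the scale-`k` window
(p. 379, render `HOME/b2b-balaban-pv18-g20/xread/p379_bottom.png` acfaae8de6e97bb8, read as an image by pv18-g20, NOT
re-rendered by this generation), the analyticity statement (1.65) p. 375 / (R-ext) is on `Ũ^c_k`, and (R-small) is a sup
over `Ũ^c_k`(X-neighbourhood) (record wording of row O3.E-iii-c, not print).  So the located binder (O6)(i-b) “analyticity of the continued function on the fat birth slice”
is MORE than (1.75)+(R-small)+(R-ext) give, and row O3.E-iii-c could not discharge §13's `hsl` by citing them.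

THE RE-CUT (owner option (a); pv18-g20's kernel kit `HOME/b2b-balaban-pv18-g20/xread/XreadContinuedV16.lean`
35011e7ef66160e5 §(S8), re-proved below WITH CREDIT and generalised — the kit is not importable).  The transport engines
need a carried function only through its RESPONSE MODULUS on ADMISSIBLE PAIRS: `RespMod G Adm w M` := every admissible
pair `Adm U₀ U₁ δ` of defect `δ ≤ w` responds by `‖G U₁ − G U₀‖ ≤ M·δ` (§A; `Adm` abstract, so that §5's chart
`ChartAdm` — regular base, relative gauge —, §9/§14's printed window chart `WindowAdm` and §8's crude `ℤ^d` pairs are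
instances, §D).  THE FORMAT (§B): (a) AT BIRTH ONLY (`k = k′`) the generated function has the §5 data, whence the
birth modulus `C₀·gen b k′` from the engine (`T4BirthChartTransport.transport_of_birthChart`: `C₀ = 4/r`;
`T4CombHolderWindow.block_transport_window`: idem, BY NAME); (b) under the history `RanBelow Gate (k+1)` ONE step
`k → k+1` multiplies response moduli by `α k ≥ 0` (`hcont` — the ℝ-CONTINUATION AT RESPONSE LEVEL; no analyticity of a
continued function on any fat domain is asked); (c) sizes attained by responses at admissible pairs of defect
`≤ c_δ·ψ^{k−k′} ≤ w`.  THEN the moduli `C₀·(∏_{[k′,k)} α)·gen b k′` propagate by induction along the steps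
(`moduliAt_of_birth_cont`) and give `TransportsFromVar (C₀·c_δ) (fun i => ψ·α i)` (`transportsFromVar_of_moduliAt`,
`transportsFromVar_of_moduli`) — EXACTLY the shape §10/§11 consume; §13's slice format implies the moduli at every scale
(`moduliAt_of_sliceFormat`), so §13/§14 stay as the stronger-hypothesis corollaries they are (nothing landed is false;
their `hsl` is just not the printable supplier).

THE AFFINE CONTINUATION LAW (§C, new; pv18-g20's CERTIFICATE prose — C-pv18g20-3,
`HOME/b2b-balaban-pv18-g20/XREAD-T4TrajectoryComparison-v1_6-delta.md` 3c31eec2bd3152dd l.84–85; attribution corrected and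
the quotation completed in v1.1, DOCFIX D2 of C-pv10-97 — «(variation of the operation in the CURRENT-scale background,
thin-domain analyticity of B16 type) × (response of F to scale-i fluctuation-window moves) — responses of F only» made a
kernel theorem).  For a continuation
of the shape `(cont G) U = E U (z ↦ G (act z U))` — a background-dependent NORMALISED operation `E U` applied to `G`
composed with the fluctuations `z ∈ D` over the background `U` — the response modulus propagates as
`M ↦ (a + ℓ·ω)·M` from FOUR primitive binders bundled in `ContStepLaw` (`ContStepLaw.respMod_continue`): the sup cost `a`
of `E U₀` on DIFFERENCES; the background-Lipschitz constant `ℓ` of `U ↦ E U g` against the OSCILLATION of `g` over `D`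
(normalisation built in: constants do not move); admissibility of a pair surviving composition of both members with the
same fluctuation; and pairs over one background differing by two fluctuations of `D` being admissible with defect `ω ≤ w`.
DICTIONARY (cell reading, NOT asserted; row O3.E-iii-c's to supply or replace): `E` ↔ `F ↦ (T′_k(X)1)⁻¹T′_k(X)F` of
(1.75) p. 380, «normalized» p. 391; `a` ↔ `e^{3 sup|σ|}` (linearity + (1.75), a THIN-domain statement — differences of
two functions of the integration variables at ONE background); `ℓ` ↔ the dependence of the normalised operation on the
CURRENT-scale background (B16-type analyticity of the densities on `Ũ^c_k`, (1.65) p. 375 / (R-ext), + Cauchy — LOCATED,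
NOT printed in this form); `act`/covariance ↔ relative gauge is a statement about the pair, unchanged by a common
fluctuation [cell]; `ω` ↔ the defect, in the generation-`k′` chart, of a pair differing by scale-`k` fluctuations inside
the small-field window ((I4′)-type, `∝ ψ^{k−k′}` [cell]).  UNITS: `ℓ` is per unit of generation-chart defect and may grow
in `k − k′` while `ω` decays; ONLY the product enters, through the domination binder `a k + ℓ·ω ≤ α k`
(`cont_of_contStepLaw`, which delivers `hcont` of §B verbatim).  So input (O6)(i) of row O3.E-iii-c in modulus
currency is THREE current-scale numbers per met step, `(a_k, ℓ_k, ω_k)`, and `= (1, 0, ·)` at spectator steps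
(`contStepLaw_spectator`: evaluation at the rest fluctuation, `α = 1`, checked) — consistent with §10's dictionary
`α i = a(i+1) = 1` there.

§D–§E: the format END TO END on `ℤ^d` (`transportsFromVar_of_modulus_crude`, `latticeTrajectory_budget_modulus_loadGenerated`
= modulus feed ∘ `TransportsFromVar.mono_const` ∘ §11 `sizeBound_cubeBudget_of_loadGenerated_small`) and in the printed
window chart (`transportsFromVar_of_modulus_window`); consistency witnesses (§13 ⇒ this file: `moduliAt_of_sliceFormat` and the
checked re-derivation of `transportsFromVar_of_response`'s conclusion through §B; spectator law ⇒ `α = 1`; a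
background-free two-point normalised average has `a = 1`, `ℓ = 0`).  Every input a binder; NOTHING is asserted for
Bałaban's operations or the cell's terms; no cite tag (nothing here is a citable fact); [folklore] throughout.

§F–§H (v1.1).  §F: `ContStepLawOn 𝒢` = `ContStepLaw` with `supCost`/`bgLip` asked for integrands in a class
`𝒢 ⊆ (Z → F)` only (a LITERAL normalised-integral `E U` returns Lean's junk value `∫ = 0` on non-measurable integrands
and could not satisfy `supCost` on all of `Z → F` — XREAD C-pv10-97 T1, the reader's analysis); `ContStepLaw =
ContStepLawOn univ` (`contStepLawOn_of_law`, `law_of_contStepLawOn_univ`); the affine law then carries ONE more binder,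
class membership of the fluctuation functions `z ↦ G (act z U)` (`ContStepLawOn.respMod_continue`).  §G: §B's propagation
and §C's binder-from-law with the admissible pairs `Adm b k′ k` depending on the CURRENT scale — the step-`k` law typed
FROM `Adm b k′ k` TO `Adm b k′ (k+1)` (`moduliAt_of_birth_cont_dep`, `transportsFromVar_of_moduliAt_dep`,
`transportsFromVar_of_moduli_dep`, `cont_of_contStepLawOn_dep`; v1 = the constant case, by name) — so nothing is asked of
the step-`k` operation outside the scale-`(k+1)` pairs.  §H: on the RAW chart pairs `RawAdm move N 𝒦` (regular base,
chart ENDPOINT; no gauge quotient) the binder `bgLip` FOLLOWS, with `ℓ = 4a/ϱ`, from a `BirthSlice`-shaped analyticity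
of the CENTRED operation `U ↦ E U g − c` along the chart with radius `ϱ` and sup `a·m` whenever `‖g − c‖ ≤ m` on `D`
(`bgLip_of_opSlice` = `slice_bound` at `c := g z₀`, `z₀ ∈ D`); with the sup cost at the REAL regular bases and §C's two
[cell] action binders this is the whole law (`contStepLawOn_of_opSlice`), the per-met-step factor being `a·(1 + 4ω/ϱ)`
(`respMod_continue_of_opSlice`, `stepFactor_eq`) with `ω`, `ϱ` in the units of ONE chart norm — the ratio is chart-free
(`ell_mul_omega_rescale`: the precise form of the units remark above); the gauge quotient is taken once, at response
level (`respMod_chart_of_raw`; `gaugeInvariant_cont` derives the invariance of a continued function from a covariant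
RELABELLING of the fluctuations, `E U′ g = E U (g ∘ τ)`); `transportsFromVar_of_opSlices` runs the pipeline of §E with
`hcont` DERIVED (birth slices of the generated functions; per met step the operation's slices, sup cost, class
membership, chart geometry, domination `a k·(1 + 4·ω/ϱ) ≤ α k`; sizes attained modulo gauge).  DICTIONARY for §H (cell
reading, NOT asserted; row O3.E-iii-c's to supply or replace): `ϱ` ↔ the radius, in the units of the chart norm, of the
window of COMPLEX backgrounds on which the step's densities are analytic ((1.65) p. 375 / (R-ext); [Balaban1987RG1] (1.13)
p. 262 TYPE); `a·m` ↔ (1.75) p. 380 applied ON that complex window to `F = g − c` after «normalized» p. 391.  So input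
(O6)(i) of row O3.E-iii-c in CAUCHY CURRENCY is, per met step, `(a_k, ϱ_k, ω_k)` with `a_k·(1 + 4ω_k/ϱ_k) ≤ α k` plus the
chart geometry (`hcov`, `hpair`) and class membership — the background-Lipschitz ESTIMATE is no longer an input; whether
`4ω_k/ϱ_k` (fluctuation-pair defect over background-analyticity radius, both at the current scale) is small enough for
§10's step condition is (I4′)'s question, owned elsewhere.  Non-vacuity of the analytic binder with GENUINE background
dependence: the closing `example` of §H (a background-weighted two-point normalised operation; exact `ℓ = 1`, Cauchy
gives `4a/ϱ`).

§J (v1.2) — THE LINEAR-OPERATION SUPPLIER.  §H still carried TWO analytic binders per met step: the sup cost `hsup` at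
the real regular bases and the centred slice `hEsl`.  For an operation that is SUBTRACTIVE (`E U (g − g′) = E U g − E U g′`
— the shape of an integral against a density; [cell]) and NORMALISED (`E U (const c) = c` — «the T′_k-operations are
normalized» p. 391, the certified quotation of `T4PreservedUnderR`'s header; cell dictionary) both follow from the single
OPERATOR SLICE `OpSlice E D move N 𝒦 w ϱ a` := every integrand `h` with `‖h‖ ≤ m` on `D` has
`BirthSlice (fun U => E U h) move N 𝒦 w ϱ (a·m)` [printed TYPE, NOT asserted: (1.65) p. 375 / (R-ext) analyticity in the
complex background, (1.75) p. 380 ON that window — an operator bound `a` w.r.t. the sup-over-`D` seminorm, uniform over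
the window]: `opSlice_centred` (`E U g − c = E U (g − const c)`), `supCost_of_opSlice` (the slice at `t = 0`,
`T4BirthChartTransport.norm_base_le` BY NAME, given ONE admissible direction `0 < N d ≤ w`), hence
`contStepLawOn_of_linearOpSlice` and the pipeline `transportsFromVar_of_linearOpSlices` (= §H's with `hsup`/`hEsl`
DERIVED); `opSlice_const_nonneg`: `1 ≤ a` as soon as `F` has a nonzero vector (normalisation; cf. the kit's remark that
`a_k > 1` generically, pv18-g20's INFO I6 of C-pv18g20-3).  So input (O6)(i) in OPERATOR CURRENCY is, per met step: subtractive + normalised `E k`, its operator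
slice `(a_k, ϱ_k)` at the scale-`(k+1)` regular bases, one admissible direction, the chart geometry (`hcov`, `hpair`, `ω_k`),
class membership, and `a_k·(1 + 4ω_k/ϱ_k) ≤ α k`.  Non-vacuity: the toy `example` of §J.

§K (v1.3) — THE WINDOW GUARD AND THE LATTICE GEOMETRY.  THE FINDING (own inspection; in-technique; the same defect class as
the `PreBelowEnv` mis-cut of `T4TrajectoryComparison` v1.6, here caught before any consumer): the action fields
`ContStepLaw.covariant`/`fluctPair` (§C), `ContStepLawOn.covariant`/`fluctPair` (§F) and the [cell] binders `hcov`/`hpair` of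
§H/§J are demanded for admissible pairs `(U₀, U₁, δ)` of EVERY defect `δ`, whereas `respMod_continue` invokes them only under
`δ ≤ w`.  For an abstract `Adm` this is harmless (the toys of §C/§H/§J use reflexive or universal admissibilities), but for
the RAW CHART PAIRS `RawAdm move N 𝒦` it is not: `base_of_hpair_unguarded` — one upper base `U₀ ∈ 𝒦′` and two distinct
fluctuations put `act z′ (move U₀ d 1)` into the LOWER base set for every direction `d` of positive norm, however large;
on `ℤ^d` with the additive composition (`lattice_base_of_hpair_unguarded`) EVERY bounded perturbation of `U₀ + z′` is then
in `𝒦`, so the next step's operator slice `hop` would be owed at ALL bounded complex backgrounds with one bound `a` — not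
the printed format ((1.65) p. 375 / (R-ext): analyticity on the window `Ũ^c_k`).  The landed §H/§J theorems are correct
but, fed with window-type data, only vacuously instantiable below the top scale.  THE REPAIR (additive; nothing landed is
modified): `Windowed Adm w U₀ U₁ δ := Adm U₀ U₁ δ ∧ δ ≤ w` — `respMod_windowed_iff`: NO modulus changes —,
`contStepLawOn_of_opSlice_windowed` / `contStepLawOn_of_linearOpSlice_windowed` (the law ON `Windowed (RawAdm move N 𝒦) w`
from `hsup`/`hEsl` resp. `OpSlice` exactly as in §H/§J, with `hcov`/`hpair` asked ONLY for `δ ≤ w`), and the pipelines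
`transportsFromVar_of_opSlices_windowed` / `transportsFromVar_of_linearOpSlices_windowed` = §H's / §J's VERBATIM except
for the guard (births restricted by `RespMod.of_imp`, the attaining pair windowed by `hdefw`; SAME conclusion
`TransportsFromVar (4c_δ/r) (fun i => ψ·α i) Gate`); a consistency `example` recovers §H's unguarded shape as the special
case.  THE LATTICE GEOMETRY (the «chart geometry» residue of (O6)(i), DISCHARGED in the crude lattice model of
`T4BlockTransport`: backgrounds AND fluctuations = `R`-valued bond fields `Fld d R`, ONE frame, affine chart `latMove`/`latN`,
ADDITIVE composition `act z U = U + z` — a DICTIONARY for «background composed with fluctuation», NOT a claim about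
`U_k(V)·exp(iηA′)`): `hcov_add` — `hcov` (even unguarded) from NESTING (N1) `𝒦′ + D ⊆ 𝒦` (`add_latMove`: translation
commutes with the chart); `hpair_add` — the GUARDED `hpair` from NESTING WITH MARGIN (N2) `(𝒦′ + {p | latN p ≤ w}) + D ⊆ 𝒦`
and the bond-wise DIAMETER (DIAM) `‖z − z′‖ ≤ ω` on `D`, `0 < ω` (direction `diffDir z z′ ω`, defect exactly `ω`);
`hdir_lattice` — one admissible direction (declared bounds); END TO END `transportsFromVar_of_linearOpSlices_lattice`: §J's
pipeline on `ℤ^d` whose remaining binders are ANALYTIC or NUMERIC only (births, recursion/class, `hsub`/`hnorm`, the operator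
slices `hop`, the nestings (N1)/(N2), the diameters `ω k ≤ w`, the domination, invariance, defects, attainment).  PRINTED TYPE
of (N1)/(N2)/(DIAM), NOT asserted (quotations in PRINTED CONTEXT below): the inductive ENLARGEMENT of the analyticity domains
scale by scale, [Balaban1989LargeFieldI] p. 190, and the small-fluctuation characteristic functions, ibid. p. 187; the
NUMBERS (margins, `ω_k`) are row O3.E-iii-c's.  Non-vacuity WITHOUT degeneration: `bondBall` (bond-wise sup balls),
`bondBall_add_mem` / `bondBall_latMove_add_mem` / `bondBall_diam` and the closing toy on `Fld 4 ℂ` (windows of radii 1 ⊂ 3,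
fluctuations of radius ½, `w = ω = 1`: (N1), (N2), (DIAM) hold, the lower window is PROPER, two distinct fluctuations).
So input (O6)(i) after v1.3, per met step: subtractive + normalised `E k` with operator slice `(a_k, ϱ_k)` at the
scale-`(k+1)` window, the nestings (N1)/(N2) of the scale-`k` window over the scale-`(k+1)` one (margin `w` + fluctuation
size), the fluctuation diameter `ω_k ≤ w`, class membership, and `a_k·(1 + 4ω_k/ϱ_k) ≤ α k`.

§L (v1.4) — THE CLASS GUARD ON THE LINEAR SUPPLIER.  THE FINDING (own inspection; in-technique; caught before any consumer):
§F's `ContStepLawOn 𝒢` (v1.1, typing T1, pv10-g19) relativises the step law to an integrand class `𝒢` «so that a LITERAL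
instantiation of `E U` by a normalised integral operation is not obstructed by the junk value `∫ = 0` on non-measurable
integrands», and §H's analytic binders `hsup`/`hEsl` are accordingly asked for `g, g′ ∈ 𝒢 k` only — but §J's SUPPLIER of
those binders (v1.2) re-introduced CLASS-FREE hypotheses: `hsub : ∀ U g g′, E U (g − g′) = E U g − E U g′` and
`hop : OpSlice …` (every `h : Z → F` bounded on `D`), and §K's `contStepLawOn_of_linearOpSlice_windowed`,
`transportsFromVar_of_linearOpSlices_windowed` / `…_lattice` inherit them (`opSlice_centred` / `supCost_of_opSlice` even
DISCARD the membership they are handed).  For an operation that is literally an integral over the fluctuation variables the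
class-free `hsub` is FALSE: `setIntegral_not_subtractive` — on `([0,1], Lebesgue)` (a probability space: constants
integrable, the operation normalised) `g = 1`, `g′ = x⁻¹` give `∫(g − g′) = 0 ≠ 1 = ∫g − ∫g′` by the junk value.  So a
consumer modelling `E k U` by the fluctuation integral could discharge §J/§K's `hsub` only through a total linear
extension of the integral (Hahn–Banach-type detours) — not the intended reading; the landed §J/§K theorems are correct but,
for such `E`, not instantiable as typed.  THE REPAIR (additive; nothing landed is modified): `OpSliceOn 𝒢 E D move N 𝒦 w ϱ a`
(the operator slice for `h ∈ 𝒢` only; `OpSlice.on`, `opSliceOn_univ_iff`: §J's format is the case `𝒢 = univ`;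
`OpSliceOn.anti`), the class asked to contain the constants (`h𝒢c`) and to be closed under differences (`h𝒢s`) — true of
the integrable, the bounded measurable, the continuous functions —, subtractivity ON THE CLASS; then `opSliceOn_centred`
(`hEsl`), `supCost_of_opSliceOn` (`hsup`), `one_le_of_opSliceOn`, `contStepLawOn_of_linearOpSliceOn_windowed` (the law on
`Windowed (RawAdm move N 𝒦) w`, SAME constants `(a, 4a/ϱ, ω)`; §K's class-free law recovered at `univ` by
`ContStepLawOn.anti`, an `example`), and the pipelines `transportsFromVar_of_linearOpSlicesOn_windowed` /
`transportsFromVar_of_linearOpSlicesOn_lattice` = §K's VERBATIM except for the class guard on `hsub`/`hop` and the two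
closure binders (SAME conclusion `TransportsFromVar (4c_δ/r) (fun i => ψ·α i) Gate`).  Non-vacuity WITH AN HONEST INTEGRAL:
the closing `example` — the normalised Lebesgue operation on `[0,1]` with `𝒢` = the functions integrable on `[0,1]` meets
every guarded binder (`a = 1`) while the class-free `hsub` fails for it.  (INFO, not a defect: the membership binder `h𝒢`
and the recursion `hFn` remain asked at every background `U`; for a total, measurable, locally bounded density these hold
without a window, unlike `hsub`/`hop`.)  So input (O6)(i) after v1.4, per met step: a class `𝒢 k` ∋ constants, closed under
differences, containing the pulled-back densities; `E k` normalised, subtractive ON `𝒢 k`, with operator slice `(a_k, ϱ_k)`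
ON `𝒢 k` at the scale-`(k+1)` window; the nestings (N1)/(N2); the diameter `ω_k ≤ w`; `a_k·(1 + 4ω_k/ϱ_k) ≤ α k`.

WHAT IS PROVED ABOUT BAŁABAN'S / THE CELL'S OBJECTS: NOTHING.  The estimate NE1′ for the D-terms is OPEN; this module is
the kernel statement «response-level inputs ⇒ `TransportsFromVar` ⇒ (with §11) dressed stability of the observable-attached
class at every scale, constants free of j, k, K» with EVERY input an explicit binder, owned elsewhere (T4-DAG §6; record
`t4/T4-EST-NE1p-P1.md` §4): (I1)/(I2′) `BirthSlice` / `GaugeInvariant` of the GENERATED functions AT BIRTH ONLY (O-β3-b;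
printed TYPE [Balaban1987RG1] (1.13) p. 262, format (1.19) p. 263 — certified in `T4TrajectoryComparison`'s header);
(I3) `BirthGen` (row O3.E-i′); (I4′) the defect rate `ψ` and the fluctuation-pair defect `ω` (`T4BlockTransport` §7/§11
TYPE; [cell]); input (O6)(i) of row O3.E-iii-c NOW IN MODULUS CURRENCY: per met step the three current-scale numbers
`(a_k, ℓ_k, ω_k)` of `ContStepLaw` with `a_k + ℓ_k·ω_k ≤ α k` — or directly the continuation binder `hcont` —, `(1, 0, ·)`
at spectator steps (v1.1 §H, CAUCHY CURRENCY: `(a_k, ϱ_k, ω_k)` + chart geometry + class membership, `ℓ_k = 4a_k/ϱ_k`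
DERIVED; v1.2 §J, OPERATOR CURRENCY: subtractive + normalised `E k` with operator slice `(a_k, ϱ_k)`, `hsup`/`hEsl`
DERIVED; v1.3 §K: the action binders WINDOW-GUARDED, and on `ℤ^d` with the additive composition DISCHARGED into the window
nestings (N1)/(N2) and the fluctuation diameter (DIAM); v1.4 §L: the supplier binders `hsub`/`hop` CLASS-GUARDED — §F's
typing T1 carried into the supplier); (ii) `PreBelowEnvSucc`, (iii) `AbsorbLaw` + (c1), the dressed steps and the smallness as in §10–§12;
(O-G2) regeneration; the gates' `H`.  (B)/(B^μ) ONLY through a consumer's weights, BetaPertH only through the rows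
producing the running couplings — none used here.

PRINTED CONTEXT (SHAPE ONLY; [cert X] = quotation certified by an earlier XREAD'd record of this cell, page = journal page,
render read as an image by the certifying seat; NOT re-rendered by this generation).  [Balaban1989LargeFieldII] = T. Bałaban,
*Large field renormalization. II. Localization, exponentiation, and bounds for the 𝐑 operation*, Comm. Math. Phys. **122**
(1989) 355–392 — a manuscript UNDER ADJUDICATION by the cell, quoted for the SHAPE of its bookkeeping only: p. 380 (1.75)
«|(T′_k(X,(U,J))1)^{−1}T′_k(X,(U,J))F| ≤ e^{3 sup|σ|} sup|F|. (1.75)» and, same page, `σ` = «the small term of the first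
order in A′, J» [cert `T4PreservedUnderR` header (b02 lineage), C-b02g7-1; render R p026 re-read as an image by pv18-g20,
C-pv18g20-1]; p. 391 «using the fact that the T′_k-operations are normalized, i.e., if such an operation is applied to a
function which does not depend on the integration variables connected with the operation, then it is equal to 1.» [cert
`T4PreservedUnderR` header (b02 lineage; XREADs pv12-g5, pv18-g4, pv12-g6), quoted in `T4TrajectoryComparison`'s header since
v1.3]; p. 379 «We consider the analytically extended
expressions. In the definition (1.71) only the quadratic form in B and the term V(X˜) depend on (U,J). We expand them up
to the first order in A′, J, the first order terms are already small.» [cert XREAD C-pv18g20-3 (1c), render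
`HOME/b2b-balaban-pv18-g20/xread/p379_bottom.png` acfaae8de6e97bb8 read as an image by pv18-g20] — the smallness of `σ`,
hence (1.73)–(1.75), is derived for the extension variable `A′` INSIDE the scale-`k` window: the printed suppliers are
THIN-domain, current-scale statements (pv18-g20's reading, finding M2; this generation adds no print claim).  That the
cell's observable-attached terms are continued with operations obeying the binders below is row O3.E-iii-c's EST question,
NOT claimed here.  (v1.3) [Balaban1989LargeFieldI] = T. Bałaban, *Large field renormalization. I. The basic step of the 𝐑
operation*, Comm. Math. Phys. **122** (1989) 175–202 — same status (under adjudication; SHAPE only) [read by THIS generation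
from the HELD OCR text `paper:balaban1989-cmp122-large-field-i` (pages p0016 = journal p. 190, p0013 = p. 187), NOT an
image render; OCR-garbled formulas are not quoted; («v1.4», XREAD C-t4r3-35 INFO-1) the two inline symbols `B[·]_k^{(n)}` /
`χ[·]_k^{(n)}` in the p. 190 span below are SIC-MARKED reconstructions of OCR-garbled glyphs («Bjf}», «χ{k\») — the prose
is verbatim, the two symbols are NOT verified against a render]: p. 190 «Let us start with the analyticity properties. The aim of this
whole preliminary step is to gain a larger domain of analyticity for the effective action» … «therefore the old action A_k
has effectively a larger analyticity domain with respect to the new field. For the new term B[·]_k^{(n)} of the action we have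
to enlarge the analyticity domain by proper inductive assumptions, in agreement with the restrictions introduced by the
characteristic function χ[·]_k^{(n)}» (the TYPE of the nestings (N1)/(N2): the lower-scale function's window absorbs the new
field's window with a margin); p. 187 «the only characteristic functions are the functions (1.9), (1.27) restricting the
fluctuation field on the domains» … and «This field is small, because» (1.54) (the TYPE of (DIAM): the fluctuation
variables of one step range over a small set).  Whether the cell's windows and fluctuation sets satisfy (N1)/(N2)/(DIAM)
with usable margins is row O3.E-iii-c's question, NOT claimed here.

Depends on (by name): `T4TrajectoryComparison` (this lineage, v1.7: `Trajectory`, `Trajectory.gen_nonneg`, `Trajectory.lin`,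
`Trajectory.TransportsFromVar`, `Trajectory.TransportsFromVar.mono_const`, `stepProd`, `stepProd_self/_succ/_mul/_const/_nonneg`,
§11's `Trajectory.sizeBound_cubeBudget_of_loadGenerated_small`, `Trajectory.BirthsFromOld`, `Trajectory.RegeneratesFromVar`,
`prodRate`, `RanBelow`, `RanBelow.mono` — the last two listed under `T4GatedBooking` in v1, corrected v1.1 = DOCFIX D1 of
C-pv10-97), `T4GatedBooking` (pv18: `CubeBudgetAt`, `GateOfSizes`), `T4TermFormat.Booking`
(pv27: `SizeBound`, `CubeBudget`, `PositionalCount`), `T4BirthChartTransport` (this lineage: `GaugeInvariant`, `BirthSlice`,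
`RelGauge`, `transport_of_birthChart`; v1.1: `slice_bound`,
`norm_base_le`), `T4BlockTransport` (this lineage: `Fld`, `val`, `latMove`, `latN`, `latMove_zero`,
`BlockRel`, `relGauge_crude`, `Site`; v1.3: `NDir`, `latMove_one_apply`, `norm_dir_le`), `T4RelativeComb` / `T4RelativeLadder` (pv24 lineage: `Cfg`, `plaq`, `PlaqSup`,
`UnitaryLike`), `T4CombHolderWindow` (pv24-g11: `Win`, `Win.Pos`, `winN`, `winN_nonneg`, `WindowData`,
`WindowData.sup_nonneg`, `wMove`, `wN`, `blockDev`, `block_transport_window`).  Statement and proof shapes of §B/§D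
(`RespMod`, `respMod_of_birthSlice`, `transportsFromVar_of_modulus`, `moduliAt_of_sliceFormat`, the induction `key` of
`moduliAt_of_birth_cont`) after pv18-g20's XREAD kit (S8) (`HOME/b2b-balaban-pv18-g20/xread/XreadContinuedV16.lean`
35011e7ef66160e5, CREDITED; not importable, re-proved and generalised over an abstract admissibility); statements and proofs
of §F's `ContStepLawOn`, `contStepLawOn_of_law`, `law_of_contStepLawOn_univ`, `ContStepLawOn.respMod_continue` and of the §14
window twin `moduliAt_of_windowSliceFormat` (+ `example`) after pv10-g19's XREAD twins (`HOME/b2b-balaban-pv10-g19/xread2/TwinC.lean`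
2d9a13b0a07159ad §(C3), §(C2c), CREDITED; scratch, not importable).  All cited BY NAME;
no file of another seat is modified; ONE import (`T4TrajectoryComparison`, which carries the others).
-/

namespace Literature.MathematicalPhysics.QuantumFieldTheory.Balaban1983to89.T4TrajectoryModulus

open Finset
open Literature.MathematicalPhysics.QuantumFieldTheory.Balaban1983to89.T4TermFormat
open Literature.MathematicalPhysics.QuantumFieldTheory.Balaban1983to89.T4TermFormat.Booking
open Literature.MathematicalPhysics.QuantumFieldTheory.Balaban1983to89.T4GatedBooking
open Literature.MathematicalPhysics.QuantumFieldTheory.Balaban1983to89.T4PreservedUnderT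
open Literature.MathematicalPhysics.QuantumFieldTheory.Balaban1983to89.T4TrajectoryComparison

/-! ### §A Response moduli on admissible pairs -/

section Modulus

variable {𝒰 F : Type*} [NormedAddCommGroup F]

/-- HYPOTHESIS SHAPE — RESPONSE MODULUS `M` of `G` on the admissible pairs `Adm` within the window `w`: every admissible
pair `(U₀, U₁)` of defect `δ ≤ w` responds by `‖G U₁ − G U₀‖ ≤ M·δ`.  `Adm U₀ U₁ δ` is ABSTRACT (“`(U₀, U₁)` is an
admissible pair with defect bound `δ`”): §D instantiates it with the birth chart (`ChartAdm`), the printed window chart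
(`WindowAdm`) and, through `T4BlockTransport.relGauge_crude`, §8's crude pairs.  (pv18-g20 kit (S8) `RespMod`, there
over the chart; generalised.) [folklore] -/
def RespMod (G : 𝒰 → F) (Adm : 𝒰 → 𝒰 → ℝ → Prop) (w M : ℝ) : Prop :=
  ∀ (U₀ U₁ : 𝒰) (δ : ℝ), Adm U₀ U₁ δ → δ ≤ w → ‖G U₁ - G U₀‖ ≤ M * δ

/-- Monotonicity of the modulus in `M` (admissible defects non-negative). [arith] [folklore] -/
theorem RespMod.mono {G : 𝒰 → F} {Adm : 𝒰 → 𝒰 → ℝ → Prop} {w M M' : ℝ} (h : RespMod G Adm w M)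
    (hAdm : ∀ U₀ U₁ δ, Adm U₀ U₁ δ → 0 ≤ δ) (hle : M ≤ M') : RespMod G Adm w M' :=
  fun U₀ U₁ δ hadm hδ => (h U₀ U₁ δ hadm hδ).trans (mul_le_mul_of_nonneg_right hle (hAdm U₀ U₁ δ hadm))

/-- Exchange of the constant along an equality. [arith] [folklore] -/
theorem RespMod.congr_const {G : 𝒰 → F} {Adm : 𝒰 → 𝒰 → ℝ → Prop} {w M M' : ℝ} (h : RespMod G Adm w M)
    (e : M = M') : RespMod G Adm w M' :=
  e ▸ h

/-- Fewer admissible pairs, same modulus. [arith] [folklore] -/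
theorem RespMod.of_imp {G : 𝒰 → F} {Adm Adm' : 𝒰 → 𝒰 → ℝ → Prop} {w M : ℝ} (h : RespMod G Adm w M)
    (himp : ∀ U₀ U₁ δ, Adm' U₀ U₁ δ → Adm U₀ U₁ δ) : RespMod G Adm' w M :=
  fun U₀ U₁ δ hadm hδ => h U₀ U₁ δ (himp U₀ U₁ δ hadm) hδ

/-- A smaller window, same modulus. [arith] [folklore] -/
theorem RespMod.mono_window {G : 𝒰 → F} {Adm : 𝒰 → 𝒰 → ℝ → Prop} {w w' M : ℝ} (h : RespMod G Adm w M)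
    (hw : w' ≤ w) : RespMod G Adm w' M :=
  fun U₀ U₁ δ hadm hδ => h U₀ U₁ δ hadm (hδ.trans hw)

/-- Pointwise-equal functions share their moduli. [arith] [folklore] -/
theorem RespMod.congr_fun {G G' : 𝒰 → F} {Adm : 𝒰 → 𝒰 → ℝ → Prop} {w M : ℝ} (h : RespMod G Adm w M)
    (hGG' : ∀ U, G' U = G U) : RespMod G' Adm w M :=
  fun U₀ U₁ δ hadm hδ => by rw [hGG' U₁, hGG' U₀]; exact h U₀ U₁ δ hadm hδ

/-! ### §B Propagation: birth moduli + modulus-multiplicative continuation under the history ⇒ `TransportsFromVar` -/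

variable {B : Booking} {T : Trajectory B}

/-- **MODULI AT EVERY SCALE ⇒ `TransportsFromVar`.**  If, for `j ≤ k′ ≤ k ≤ K` and under the history `RanBelow Gate k`,
the carried function `Fn b k′ k` has response modulus `C₀·(∏_{[k′,k)} α)·gen b k′` on the generation's admissible pairs
(`C₀, α ≥ 0`), and the booked size `lin b k′ k` is attained up to every `ε > 0` by the response at an admissible pair of
defect `defect b k′ k ≤ w`, `≤ c_δ·ψ^{k−k′}`, THEN `TransportsFromVar (C₀·c_δ) (fun i => ψ·α i) Gate`.  No engine, no
chart: pure bookkeeping (`stepProd_mul`, `stepProd_const`). [folklore] -/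
theorem transportsFromVar_of_moduliAt {Gate : ℕ → Prop} {Fn : B.Birth → ℕ → ℕ → 𝒰 → F}
    {Adm : B.Birth → ℕ → 𝒰 → 𝒰 → ℝ → Prop} {defect : B.Birth → ℕ → ℕ → ℝ} {C₀ cδ ψ w : ℝ} {α : ℕ → ℝ}
    (hC₀ : 0 ≤ C₀) (hα : ∀ i, 0 ≤ α i)
    (hmod : ∀ (b : B.Birth) (k' k : ℕ), B.birthScale b ≤ k' → k' ≤ k → k ≤ B.K → RanBelow Gate k →
      RespMod (Fn b k' k) (Adm b k') w (C₀ * stepProd α k' k * T.gen b k'))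
    (hdefw : ∀ b k' k, defect b k' k ≤ w)
    (hrate : ∀ (b : B.Birth) (k' k : ℕ), B.birthScale b ≤ k' → k' ≤ k → k ≤ B.K →
      defect b k' k ≤ cδ * ψ ^ (k - k'))
    (hlin : ∀ (b : B.Birth) (k' k : ℕ), B.birthScale b ≤ k' → k' ≤ k → k ≤ B.K → RanBelow Gate k → ∀ ε > 0,
      ∃ U₀ U₁ : 𝒰, Adm b k' U₀ U₁ (defect b k' k) ∧ T.lin b k' k ≤ ‖Fn b k' k U₁ - Fn b k' k U₀‖ + ε) :
    T.TransportsFromVar (C₀ * cδ) (fun i => ψ * α i) Gate := by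
  intro b k' k hbk' hk'k hk hran
  refine le_of_forall_pos_le_add fun ε hε => ?_
  obtain ⟨U₀, U₁, hadm, hle⟩ := hlin b k' k hbk' hk'k hk hran ε hε
  have hresp := hmod b k' k hbk' hk'k hk hran U₀ U₁ _ hadm (hdefw b k' k)
  have hP : 0 ≤ stepProd α k' k := stepProd_nonneg hα k' k
  have hg0 : 0 ≤ T.gen b k' := T.gen_nonneg b k'
  have hprod : stepProd (fun i => ψ * α i) k' k = ψ ^ (k - k') * stepProd α k' k := by
    rw [stepProd_mul (fun _ => ψ) α, stepProd_const]
  have hmono : C₀ * stepProd α k' k * T.gen b k' * defect b k' k ≤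
      C₀ * cδ * stepProd (fun i => ψ * α i) k' k * T.gen b k' :=
    calc C₀ * stepProd α k' k * T.gen b k' * defect b k' k
        ≤ C₀ * stepProd α k' k * T.gen b k' * (cδ * ψ ^ (k - k')) :=
          mul_le_mul_of_nonneg_left (hrate b k' k hbk' hk'k hk) (by positivity)
      _ = C₀ * cδ * stepProd (fun i => ψ * α i) k' k * T.gen b k' := by rw [hprod]; ring
  linarith

/-- **BIRTH MODULI + MODULUS-MULTIPLICATIVE CONTINUATION ⇒ MODULI AT EVERY SCALE** (the induction along the steps;
pv18-g20 kit (S8), the `key` step of `transportsFromVar_of_modulus`, generalised to abstract admissibility and birth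
constant `C₀`).  AT BIRTH (`k = k′ ≤ K`, under `RanBelow Gate k′`) the generated function has modulus `C₀·gen b k′`;
ONE STEP `k → k+1` (`k′ ≤ k`, `k+1 ≤ K`), under the history `RanBelow Gate (k+1)`, multiplies ANY response modulus
`M ≥ 0` of `Fn b k′ k` into the modulus `α k·M` of `Fn b k′ (k+1)` (`hcont`: the ℝ-CONTINUATION AT RESPONSE LEVEL —
dictionary of the section header, NOT asserted; `α k = 1` at spectator steps, `contStepLaw_spectator`).  THEN
`Fn b k′ k` has modulus `C₀·(∏_{[k′,k)} α)·gen b k′` under `RanBelow Gate k`. [folklore] -/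
theorem moduliAt_of_birth_cont {Gate : ℕ → Prop} {Fn : B.Birth → ℕ → ℕ → 𝒰 → F}
    {Adm : B.Birth → ℕ → 𝒰 → 𝒰 → ℝ → Prop} {C₀ w : ℝ} {α : ℕ → ℝ} (hC₀ : 0 ≤ C₀) (hα : ∀ i, 0 ≤ α i)
    (hbirth : ∀ (b : B.Birth) (k' : ℕ), B.birthScale b ≤ k' → k' ≤ B.K → RanBelow Gate k' →
      RespMod (Fn b k' k') (Adm b k') w (C₀ * T.gen b k'))
    (hcont : ∀ (b : B.Birth) (k' k : ℕ), B.birthScale b ≤ k' → k' ≤ k → k + 1 ≤ B.K → RanBelow Gate (k + 1) →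
      ∀ M : ℝ, 0 ≤ M → RespMod (Fn b k' k) (Adm b k') w M → RespMod (Fn b k' (k + 1)) (Adm b k') w (α k * M)) :
    ∀ (b : B.Birth) (k' k : ℕ), B.birthScale b ≤ k' → k' ≤ k → k ≤ B.K → RanBelow Gate k →
      RespMod (Fn b k' k) (Adm b k') w (C₀ * stepProd α k' k * T.gen b k') := by
  have key : ∀ (b : B.Birth) (k' : ℕ), B.birthScale b ≤ k' → ∀ n : ℕ, k' + n ≤ B.K → RanBelow Gate (k' + n) →
      RespMod (Fn b k' (k' + n)) (Adm b k') w (C₀ * stepProd α k' (k' + n) * T.gen b k') := by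
    intro b k' hbk' n
    induction n with
    | zero =>
      intro hk hran
      rw [Nat.add_zero] at hk hran ⊢
      exact (hbirth b k' hbk' hk hran).congr_const (by rw [stepProd_self, mul_one])
    | succ n ih =>
      intro hk hran
      have hk1 : k' + n + 1 ≤ B.K := by omega
      have hranS : RanBelow Gate (k' + n + 1) := hran
      have hM : 0 ≤ C₀ * stepProd α k' (k' + n) * T.gen b k' :=
        mul_nonneg (mul_nonneg hC₀ (stepProd_nonneg hα _ _)) (T.gen_nonneg b k')
      have h := hcont b k' (k' + n) hbk' (Nat.le_add_right _ _) hk1 hranS _ hM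
        (ih (by omega) (hranS.mono (by omega)))
      have heq : α (k' + n) * (C₀ * stepProd α k' (k' + n) * T.gen b k') =
          C₀ * stepProd α k' (k' + n + 1) * T.gen b k' := by
        rw [stepProd_succ α (Nat.le_add_right k' n)]; ring
      exact h.congr_const heq
  intro b k' k hbk' hk'k hk hran
  obtain ⟨n, rfl⟩ := Nat.exists_eq_add_of_le hk'k
  exact key b k' hbk' n hk hran

/-- **THE RESPONSE-MODULUS FORMAT ⇒ `TransportsFromVar`** (`moduliAt_of_birth_cont` ∘ `transportsFromVar_of_moduliAt`):
birth moduli `C₀·gen`, modulus-multiplicative continuation `α` under the history, sizes attained at admissible pairs of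
defect `≤ c_δψ^{k−k′} ≤ w` ⇒ `TransportsFromVar (C₀·c_δ) (fun i => ψ·α i) Gate`. [folklore] -/
theorem transportsFromVar_of_moduli {Gate : ℕ → Prop} {Fn : B.Birth → ℕ → ℕ → 𝒰 → F}
    {Adm : B.Birth → ℕ → 𝒰 → 𝒰 → ℝ → Prop} {defect : B.Birth → ℕ → ℕ → ℝ} {C₀ cδ ψ w : ℝ} {α : ℕ → ℝ}
    (hC₀ : 0 ≤ C₀) (hα : ∀ i, 0 ≤ α i)
    (hbirth : ∀ (b : B.Birth) (k' : ℕ), B.birthScale b ≤ k' → k' ≤ B.K → RanBelow Gate k' →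
      RespMod (Fn b k' k') (Adm b k') w (C₀ * T.gen b k'))
    (hcont : ∀ (b : B.Birth) (k' k : ℕ), B.birthScale b ≤ k' → k' ≤ k → k + 1 ≤ B.K → RanBelow Gate (k + 1) →
      ∀ M : ℝ, 0 ≤ M → RespMod (Fn b k' k) (Adm b k') w M → RespMod (Fn b k' (k + 1)) (Adm b k') w (α k * M))
    (hdefw : ∀ b k' k, defect b k' k ≤ w)
    (hrate : ∀ (b : B.Birth) (k' k : ℕ), B.birthScale b ≤ k' → k' ≤ k → k ≤ B.K →
      defect b k' k ≤ cδ * ψ ^ (k - k'))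
    (hlin : ∀ (b : B.Birth) (k' k : ℕ), B.birthScale b ≤ k' → k' ≤ k → k ≤ B.K → RanBelow Gate k → ∀ ε > 0,
      ∃ U₀ U₁ : 𝒰, Adm b k' U₀ U₁ (defect b k' k) ∧ T.lin b k' k ≤ ‖Fn b k' k U₁ - Fn b k' k U₀‖ + ε) :
    T.TransportsFromVar (C₀ * cδ) (fun i => ψ * α i) Gate :=
  transportsFromVar_of_moduliAt hC₀ hα (moduliAt_of_birth_cont hC₀ hα hbirth hcont) hdefw hrate hlin

/-! ### §C The affine continuation law: one continuation step at response level -/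

/-- HYPOTHESIS SHAPE — THE LAW OF ONE CONTINUATION STEP `(cont G) U = E U (z ↦ G (act z U))` AT RESPONSE LEVEL.
`E U : (Z → F) → F` is the background-`U` NORMALISED operation on functions of the fluctuations `z`, `act z U` the
configuration “background `U` composed with the fluctuation `z`”, `D` the fluctuation domain (the small-field window of
the step), `Adm` the admissible pairs at which the continued function is tested, `Adm′` those at which `G` is known.
FOUR BINDERS: `supCost` — at an admissible base, `E U₀` costs at most `a` on DIFFERENCES (`‖E U₀ g − E U₀ g′‖ ≤ a·m` if
`‖g − g′‖ ≤ m` on `D`; dictionary: linearity + (1.75) p. 380, `a = e^{3 sup|σ|}`, a THIN-domain statement);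
`bgLip` — the operation moves by at most `ℓ·δ·(oscillation of g over D)` between the two backgrounds of an admissible
pair of defect `δ ≤ w` (normalisation built in: a constant `g` does not move; dictionary: analyticity of the densities in
the CURRENT-scale background on `Ũ^c_k` + Cauchy — LOCATED, row O3.E-iii-c, NOT printed in this form); `covariant` —
an admissible pair stays admissible (for `G`) with the same defect after composing BOTH members with the same fluctuation
of `D` [cell]; `fluctPair` — over the second background, two distinct fluctuations of `D` give an `Adm′`-pair of defect
`ω`, `0 ≤ ω ≤ w` [cell: (I4′)-type, `∝ ψ^{k−k′}` in the generation chart].  NOTHING here is asserted for Bałaban's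
`T′`-operations. [folklore] -/
structure ContStepLaw {Z : Type*} (E : 𝒰 → (Z → F) → F) (act : Z → 𝒰 → 𝒰) (D : Set Z)
    (Adm Adm' : 𝒰 → 𝒰 → ℝ → Prop) (w a ℓ ω : ℝ) : Prop where
  /-- sup cost of `E U₀` on differences, at admissible bases -/
  supCost : ∀ (U₀ U₁ : 𝒰) (δ : ℝ), Adm U₀ U₁ δ → δ ≤ w → ∀ (g g' : Z → F) (m : ℝ),
    (∀ z ∈ D, ‖g z - g' z‖ ≤ m) → ‖E U₀ g - E U₀ g'‖ ≤ a * m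
  /-- background Lipschitz against the oscillation over `D` -/
  bgLip : ∀ (U₀ U₁ : 𝒰) (δ : ℝ), Adm U₀ U₁ δ → δ ≤ w → ∀ (g : Z → F) (m : ℝ),
    (∀ z ∈ D, ∀ z' ∈ D, ‖g z - g z'‖ ≤ m) → ‖E U₁ g - E U₀ g‖ ≤ ℓ * δ * m
  /-- admissibility survives a common fluctuation -/
  covariant : ∀ (U₀ U₁ : 𝒰) (δ : ℝ), Adm U₀ U₁ δ → ∀ z ∈ D, Adm' (act z U₀) (act z U₁) δ
  /-- two fluctuations over one background: an admissible pair of defect `ω` -/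
  fluctPair : ∀ (U₀ U₁ : 𝒰) (δ : ℝ), Adm U₀ U₁ δ → ∀ z ∈ D, ∀ z' ∈ D, z ≠ z' → Adm' (act z' U₁) (act z U₁) ω
  /-- `0 ≤ ω` -/
  ω_nonneg : 0 ≤ ω
  /-- `ω ≤ w` -/
  ω_le : ω ≤ w

/-- **THE AFFINE CONTINUATION LAW.**  Under `ContStepLaw E act D Adm Adm′ w a ℓ ω`, a function `G` of response modulus
`M ≥ 0` on `Adm′` is continued into `U ↦ E U (z ↦ G (act z U))` of response modulus `(a + ℓ·ω)·M` on `Adm`: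
`E U₁ g₁ − E U₀ g₀ = (E U₁ g₁ − E U₀ g₁) + (E U₀ g₁ − E U₀ g₀)`, the first summand `≤ ℓ·δ·(M·ω)` (`bgLip` against the
oscillation of `g₁ = G ∘ act · U₁`, itself `≤ M·ω` by `fluctPair`), the second `≤ a·(M·δ)` (`supCost` on the difference
`g₁ − g₀`, pointwise `≤ M·δ` by `covariant`).  Two lines of normed-group algebra; the content is in the four binders.
[folklore] -/
theorem ContStepLaw.respMod_continue {Z : Type*} {E : 𝒰 → (Z → F) → F} {act : Z → 𝒰 → 𝒰} {D : Set Z}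
    {Adm Adm' : 𝒰 → 𝒰 → ℝ → Prop} {w a ℓ ω M : ℝ} (hlaw : ContStepLaw E act D Adm Adm' w a ℓ ω)
    {G : 𝒰 → F} (hM : 0 ≤ M) (hG : RespMod G Adm' w M) :
    RespMod (fun U => E U (fun z => G (act z U))) Adm w ((a + ℓ * ω) * M) := by
  intro U₀ U₁ δ hadm hδ
  have h2 : ‖E U₀ (fun z => G (act z U₁)) - E U₀ (fun z => G (act z U₀))‖ ≤ a * (M * δ) :=
    hlaw.supCost U₀ U₁ δ hadm hδ _ _ (M * δ) fun z hz => hG _ _ δ (hlaw.covariant U₀ U₁ δ hadm z hz) hδ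
  have h1 : ‖E U₁ (fun z => G (act z U₁)) - E U₀ (fun z => G (act z U₁))‖ ≤ ℓ * δ * (M * ω) := by
    refine hlaw.bgLip U₀ U₁ δ hadm hδ _ (M * ω) fun z hz z' hz' => ?_
    by_cases hzz : z = z'
    · subst hzz
      rw [sub_self, norm_zero]
      exact mul_nonneg hM hlaw.ω_nonneg
    · exact hG _ _ ω (hlaw.fluctPair U₀ U₁ δ hadm z hz z' hz' hzz) hlaw.ω_le
  calc ‖E U₁ (fun z => G (act z U₁)) - E U₀ (fun z => G (act z U₀))‖
      ≤ ‖E U₁ (fun z => G (act z U₁)) - E U₀ (fun z => G (act z U₁))‖ +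
          ‖E U₀ (fun z => G (act z U₁)) - E U₀ (fun z => G (act z U₀))‖ := norm_sub_le_norm_sub_add_norm_sub _ _ _
    _ ≤ ℓ * δ * (M * ω) + a * (M * δ) := add_le_add h1 h2
    _ = (a + ℓ * ω) * M * δ := by ring

/-- **THE CONTINUATION BINDER `hcont` OF §B FROM STEP LAWS.**  If, under the history `RanBelow Gate (k+1)`, the carried
function of generation `(b, k′)` at scale `k+1` IS the step-`k` continuation of the one at scale `k`
(`Fn b k′ (k+1) U = E k U (z ↦ Fn b k′ k (act k z U))`, pointwise) and the step obeys
`ContStepLaw (E k) (act k) (D k) (Adm b k′) (Adm b k′) w (a k) (ℓ b k′ k) (ω b k′ k)` with the DOMINATION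
`a k + ℓ b k′ k·ω b k′ k ≤ α k` (only the product `ℓ·ω` enters — the units remark of the section header), then ONE step
multiplies response moduli by `α k`: exactly `hcont`.  So input (O6)(i) in modulus currency = `(a_k, ℓ_k, ω_k)` per met
step, `(1, 0, ·)` at spectator steps. [folklore] -/
theorem cont_of_contStepLaw {Z : Type*} {Gate : ℕ → Prop} {Fn : B.Birth → ℕ → ℕ → 𝒰 → F}
    {Adm : B.Birth → ℕ → 𝒰 → 𝒰 → ℝ → Prop} {E : ℕ → 𝒰 → (Z → F) → F} {act : ℕ → Z → 𝒰 → 𝒰} {D : ℕ → Set Z}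
    {a α : ℕ → ℝ} {ℓ ω : B.Birth → ℕ → ℕ → ℝ} {w : ℝ}
    (hAdm : ∀ b k' U₀ U₁ δ, Adm b k' U₀ U₁ δ → 0 ≤ δ)
    (hFn : ∀ (b : B.Birth) (k' k : ℕ), B.birthScale b ≤ k' → k' ≤ k → k + 1 ≤ B.K → RanBelow Gate (k + 1) →
      ∀ U, Fn b k' (k + 1) U = E k U (fun z => Fn b k' k (act k z U)))
    (hlaw : ∀ (b : B.Birth) (k' k : ℕ), B.birthScale b ≤ k' → k' ≤ k → k + 1 ≤ B.K → RanBelow Gate (k + 1) →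
      ContStepLaw (E k) (act k) (D k) (Adm b k') (Adm b k') w (a k) (ℓ b k' k) (ω b k' k))
    (hdom : ∀ (b : B.Birth) (k' k : ℕ), B.birthScale b ≤ k' → k' ≤ k → k + 1 ≤ B.K →
      a k + ℓ b k' k * ω b k' k ≤ α k) :
    ∀ (b : B.Birth) (k' k : ℕ), B.birthScale b ≤ k' → k' ≤ k → k + 1 ≤ B.K → RanBelow Gate (k + 1) →
      ∀ M : ℝ, 0 ≤ M → RespMod (Fn b k' k) (Adm b k') w M → RespMod (Fn b k' (k + 1)) (Adm b k') w (α k * M) := by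
  intro b k' k hbk' hk'k hk hran M hM hG
  have h := ((hlaw b k' k hbk' hk'k hk hran).respMod_continue hM hG).congr_fun (hFn b k' k hbk' hk'k hk hran)
  exact h.mono (hAdm b k') (mul_le_mul_of_nonneg_right (hdom b k' k hbk' hk'k hk) hM)

/-- CONSISTENCY — THE SPECTATOR STEP.  Evaluation at a rest fluctuation `z₀` (`act z₀ = id`; «if such an operation is
applied to a function which does not depend on the integration variables connected with the operation, then it is
equal to 1.» p. 391, header-certified quotation, SHAPE only) obeys
the law with `a = 1`, `ℓ = 0` over `D = {z₀}` for any `0 ≤ ω ≤ w`, and continues `G` into itself: `α = 1 + 0·ω = 1`,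
§10's dictionary value at spectator steps. [folklore] -/
theorem contStepLaw_spectator {Z : Type*} {act : Z → 𝒰 → 𝒰} (z₀ : Z) (hact : ∀ U, act z₀ U = U)
    (Adm : 𝒰 → 𝒰 → ℝ → Prop) {w ω : ℝ} (hω0 : 0 ≤ ω) (hωw : ω ≤ w) :
    ContStepLaw (fun (_ : 𝒰) (g : Z → F) => g z₀) act {z₀} Adm Adm w 1 0 ω where
  supCost := fun _ _ _ _ _ g g' m hm => by rw [one_mul]; exact hm z₀ rfl
  bgLip := fun _ _ _ _ _ g m _ => by rw [sub_self, norm_zero, zero_mul, zero_mul]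
  covariant := fun U₀ U₁ δ hadm z hz => by
    rw [Set.mem_singleton_iff] at hz; subst hz; rw [hact, hact]; exact hadm
  fluctPair := fun _ _ _ _ z hz z' hz' hzz => by
    rw [Set.mem_singleton_iff] at hz hz'; exact absurd (hz.trans hz'.symm) hzz
  ω_nonneg := hω0
  ω_le := hωw

/-- … and the spectator continuation multiplies moduli by exactly `1`. [folklore] -/
example {Z : Type*} {act : Z → 𝒰 → 𝒰} (z₀ : Z) (hact : ∀ U, act z₀ U = U) (Adm : 𝒰 → 𝒰 → ℝ → Prop)
    {w ω M : ℝ} (hω0 : 0 ≤ ω) (hωw : ω ≤ w) {G : 𝒰 → F} (hM : 0 ≤ M) (hG : RespMod G Adm w M) :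
    RespMod G Adm w (1 * M) := by
  have h := (contStepLaw_spectator (F := F) z₀ hact Adm hω0 hωw).respMod_continue hM hG
  rw [zero_mul, add_zero] at h
  exact h.congr_fun fun U => by simp only [hact]

end Modulus

section ModulusAverage

variable {𝒰 F : Type*} [NormedAddCommGroup F] [NormedSpace ℝ F]

/-- CONSISTENCY — A BACKGROUND-FREE TWO-POINT NORMALISED AVERAGE `E U g = ½(g z₁ + g z₂)` has sup cost `a = 1` on
differences and background constant `ℓ = 0`; with any admissibility data making the two action binders hold it obeys
the law, and then multiplies moduli by `1` (the normalised-expectation flavour of `supCost`, nothing more). [folklore] -/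
theorem contStepLaw_average {Z : Type*} (z₁ z₂ : Z) {act : Z → 𝒰 → 𝒰} {D : Set Z} (hD₁ : z₁ ∈ D) (hD₂ : z₂ ∈ D)
    {Adm Adm' : 𝒰 → 𝒰 → ℝ → Prop} {w ω : ℝ} (hω0 : 0 ≤ ω) (hωw : ω ≤ w)
    (hcov : ∀ (U₀ U₁ : 𝒰) (δ : ℝ), Adm U₀ U₁ δ → ∀ z ∈ D, Adm' (act z U₀) (act z U₁) δ)
    (hfl : ∀ (U₀ U₁ : 𝒰) (δ : ℝ), Adm U₀ U₁ δ → ∀ z ∈ D, ∀ z' ∈ D, z ≠ z' → Adm' (act z' U₁) (act z U₁) ω) :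
    ContStepLaw (fun (_ : 𝒰) (g : Z → F) => (2 : ℝ)⁻¹ • (g z₁ + g z₂)) act D Adm Adm' w 1 0 ω where
  supCost := fun _ _ _ _ _ g g' m hm => by
    rw [← smul_sub, norm_smul, one_mul, show g z₁ + g z₂ - (g' z₁ + g' z₂) = (g z₁ - g' z₁) + (g z₂ - g' z₂) by abel,
      Real.norm_eq_abs, abs_of_pos (by norm_num : (0 : ℝ) < 2⁻¹)]
    have h := (norm_add_le (g z₁ - g' z₁) (g z₂ - g' z₂)).trans (add_le_add (hm z₁ hD₁) (hm z₂ hD₂))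
    linarith
  bgLip := fun _ _ _ _ _ g m _ => by rw [sub_self, norm_zero, zero_mul, zero_mul]
  covariant := hcov
  fluctPair := hfl
  ω_nonneg := hω0
  ω_le := hωw

end ModulusAverage

/-! ### §D The engines in modulus form: the birth chart, the printed window chart -/

section ChartModulus

open T4BirthChartTransport (GaugeInvariant BirthSlice RelGauge transport_of_birthChart)

variable {B : Booking} {T : Trajectory B}
variable {𝒰 Dir F : Type*} [NormedAddCommGroup F] [NormedSpace ℂ F] [CompleteSpace F]
  {move : 𝒰 → Dir → ℂ → 𝒰} {N : Dir → ℝ} {w r : ℝ}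

/-- The CHART admissibility of §5/§13: regular base `U₀ ∈ 𝒦`, `U₁` in relative gauge `rel` of defect `δ` along the
chart `(move, N)` (`T4BirthChartTransport.RelGauge`). [folklore] -/
def ChartAdm (rel : 𝒰 → 𝒰 → Prop) (move : 𝒰 → Dir → ℂ → 𝒰) (N : Dir → ℝ) (𝒦 : Set 𝒰) :
    𝒰 → 𝒰 → ℝ → Prop :=
  fun U₀ U₁ δ => U₀ ∈ 𝒦 ∧ RelGauge rel move N U₀ U₁ δ

omit [NormedSpace ℂ F] [CompleteSpace F] in
/-- Chart defects are positive. [arith] [folklore] -/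
theorem chartAdm_nonneg {rel : 𝒰 → 𝒰 → Prop} {𝒦 : Set 𝒰} {U₀ U₁ : 𝒰} {δ : ℝ}
    (h : ChartAdm rel move N 𝒦 U₀ U₁ δ) : 0 ≤ δ := by
  obtain ⟨_, d, hd, hdδ, _⟩ := h
  exact hd.le.trans hdδ

omit [NormedSpace ℂ F] [CompleteSpace F] in
/-- The chart instance of `RespMod` is pv18-g20 kit (S8)'s `RespMod G rel move N 𝒦 w M` verbatim («every configuration in
relative gauge of defect `δ ≤ w` with a regular base responds by at most `M·δ`»). [arith] [folklore] -/
theorem respMod_chartAdm_iff {G : 𝒰 → F} {rel : 𝒰 → 𝒰 → Prop} {𝒦 : Set 𝒰} {M : ℝ} :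
    RespMod G (ChartAdm rel move N 𝒦) w M ↔
      ∀ U₀ ∈ 𝒦, ∀ (U₁ : 𝒰) (δ : ℝ), RelGauge rel move N U₀ U₁ δ → δ ≤ w → ‖G U₁ - G U₀‖ ≤ M * δ :=
  ⟨fun h U₀ hU₀ U₁ δ hrel hδ => h U₀ U₁ δ ⟨hU₀, hrel⟩ hδ, fun h U₀ U₁ δ hadm hδ => h U₀ hadm.1 U₁ δ hadm.2 hδ⟩

/-- §5's ENGINE IN MODULUS FORM: a gauge-invariant function with a birth slice of radius `r > 0` and sup `A ≥ 0` has
response modulus `4A/r` on the chart pairs (`T4BirthChartTransport.transport_of_birthChart`, BY NAME; pv18-g20 kit (S8)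
`modulus_of_birthSlice`). [folklore] -/
theorem respMod_of_birthSlice {G : 𝒰 → F} {rel : 𝒰 → 𝒰 → Prop} {𝒦 : Set 𝒰} {A : ℝ}
    (hinv : GaugeInvariant rel G) (hsl : BirthSlice G move N 𝒦 w r A) (hmove : ∀ U d, move U d 0 = U)
    (hr : 0 < r) (hA : 0 ≤ A) : RespMod G (ChartAdm rel move N 𝒦) w (4 * A / r) :=
  fun _ _ _ hadm hδ => transport_of_birthChart hinv hsl hmove hr hA hadm.1 hadm.2 hδ

/-- **RESPONSE LEVEL ⇒ `TransportsFromVar` ON THE BIRTH CHART** (pv18-g20 kit (S8) `transportsFromVar_of_modulus`, its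
statement verbatim up to the name of the modulus shape; here a corollary of §B with `C₀ = 4/r`).  Per generation: the
GENERATED function `Fn b k′ k′` has the §5 birth data (gauge invariance; under `RanBelow Gate k′` a birth slice of radius
`r`, window `w`, sup `gen b k′`); each later `Fn b k′ (k+1)` has, under `RanBelow Gate (k+1)`, modulus `≤ α k ×` any
modulus of `Fn b k′ k` on the chart pairs; sizes attained by chart responses at defect `defect b k′ k ≤ w`,
`≤ c_δψ^{k−k′}`.  Output: §13's `TransportsFromVar (4c_δ/r) (fun i => ψ·α i) Gate`. [folklore] -/
theorem transportsFromVar_of_modulus {Gate : ℕ → Prop} {Fn : B.Birth → ℕ → ℕ → 𝒰 → F}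
    {rel : B.Birth → ℕ → 𝒰 → 𝒰 → Prop} {𝒦 : B.Birth → ℕ → Set 𝒰} {defect : B.Birth → ℕ → ℕ → ℝ} {cδ ψ : ℝ}
    {α : ℕ → ℝ} (hα : ∀ i, 0 ≤ α i)
    (hinv : ∀ b k', GaugeInvariant (rel b k') (Fn b k' k'))
    (hsl : ∀ (b : B.Birth) (k' : ℕ), B.birthScale b ≤ k' → k' ≤ B.K → RanBelow Gate k' →
      BirthSlice (Fn b k' k') move N (𝒦 b k') w r (T.gen b k'))
    (hmove : ∀ U d, move U d 0 = U) (hr : 0 < r)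
    (hcont : ∀ (b : B.Birth) (k' k : ℕ), B.birthScale b ≤ k' → k' ≤ k → k + 1 ≤ B.K → RanBelow Gate (k + 1) →
      ∀ M : ℝ, 0 ≤ M → RespMod (Fn b k' k) (ChartAdm (rel b k') move N (𝒦 b k')) w M →
        RespMod (Fn b k' (k + 1)) (ChartAdm (rel b k') move N (𝒦 b k')) w (α k * M))
    (hdefw : ∀ b k' k, defect b k' k ≤ w)
    (hrate : ∀ (b : B.Birth) (k' k : ℕ), B.birthScale b ≤ k' → k' ≤ k → k ≤ B.K →
      defect b k' k ≤ cδ * ψ ^ (k - k'))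
    (hlin : ∀ (b : B.Birth) (k' k : ℕ), B.birthScale b ≤ k' → k' ≤ k → k ≤ B.K → RanBelow Gate k → ∀ ε > 0,
      ∃ U₀ ∈ 𝒦 b k', ∃ U₁ : 𝒰, RelGauge (rel b k') move N U₀ U₁ (defect b k' k) ∧
        T.lin b k' k ≤ ‖Fn b k' k U₁ - Fn b k' k U₀‖ + ε) :
    T.TransportsFromVar (4 * cδ / r) (fun i => ψ * α i) Gate := by
  have h := transportsFromVar_of_moduli (T := T) (C₀ := 4 / r) (Adm := fun b k' => ChartAdm (rel b k') move N (𝒦 b k'))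
    (by positivity) hα
    (fun b k' hbk' hk hran =>
      (respMod_of_birthSlice (hinv b k') (hsl b k' hbk' hk hran) hmove hr (T.gen_nonneg b k')).congr_const (by ring))
    hcont hdefw hrate
    (fun b k' k hbk' hk'k hk hran ε hε => by
      obtain ⟨U₀, hU₀, U₁, hrel, hle⟩ := hlin b k' k hbk' hk'k hk hran ε hε
      exact ⟨U₀, U₁, ⟨hU₀, hrel⟩, hle⟩)
  have e : 4 / r * cδ = 4 * cδ / r := by ring
  rw [e] at h
  exact h

/-- CONSISTENCY — §13's SLICE FORMAT IMPLIES THE MODULI AT EVERY SCALE: slice analyticity of every carried function with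
sup `(∏α)·gen` gives the chart moduli `(4/r)·(∏α)·gen` directly, with no `hcont` (pv18-g20 kit (S8)
`moduli_of_sliceFormat`); so §13 is the stronger-hypothesis corollary of §B/§D (next `example`). [folklore] -/
theorem moduliAt_of_sliceFormat {Gate : ℕ → Prop} {Fn : B.Birth → ℕ → ℕ → 𝒰 → F}
    {rel : B.Birth → ℕ → 𝒰 → 𝒰 → Prop} {𝒦 : B.Birth → ℕ → Set 𝒰} {α : ℕ → ℝ} (hα : ∀ i, 0 ≤ α i)
    (hinv : ∀ b k' k, GaugeInvariant (rel b k') (Fn b k' k))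
    (hsl : ∀ (b : B.Birth) (k' k : ℕ), B.birthScale b ≤ k' → k' ≤ k → k ≤ B.K → RanBelow Gate k →
      BirthSlice (Fn b k' k) move N (𝒦 b k') w r (stepProd α k' k * T.gen b k'))
    (hmove : ∀ U d, move U d 0 = U) (hr : 0 < r) :
    ∀ (b : B.Birth) (k' k : ℕ), B.birthScale b ≤ k' → k' ≤ k → k ≤ B.K → RanBelow Gate k →
      RespMod (Fn b k' k) (ChartAdm (rel b k') move N (𝒦 b k')) w (4 / r * stepProd α k' k * T.gen b k') :=
  fun b k' k hbk' hk'k hk hran =>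
    (respMod_of_birthSlice (hinv b k' k) (hsl b k' k hbk' hk'k hk hran) hmove hr
      (mul_nonneg (stepProd_nonneg hα _ _) (T.gen_nonneg b k'))).congr_const (by ring)

/-- CONSISTENCY — §13's `transportsFromVar_of_response` RE-DERIVED THROUGH §B/§D from its own hypotheses
(`moduliAt_of_sliceFormat` ∘ `transportsFromVar_of_moduliAt`). [folklore] -/
example {Gate : ℕ → Prop} {Fn : B.Birth → ℕ → ℕ → 𝒰 → F}
    {rel : B.Birth → ℕ → 𝒰 → 𝒰 → Prop} {𝒦 : B.Birth → ℕ → Set 𝒰} {defect : B.Birth → ℕ → ℕ → ℝ} {cδ ψ : ℝ}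
    {α : ℕ → ℝ} (hα : ∀ i, 0 ≤ α i)
    (hinv : ∀ b k' k, GaugeInvariant (rel b k') (Fn b k' k))
    (hsl : ∀ (b : B.Birth) (k' k : ℕ), B.birthScale b ≤ k' → k' ≤ k → k ≤ B.K → RanBelow Gate k →
      BirthSlice (Fn b k' k) move N (𝒦 b k') w r (stepProd α k' k * T.gen b k'))
    (hmove : ∀ U d, move U d 0 = U) (hr : 0 < r) (hdefw : ∀ b k' k, defect b k' k ≤ w)
    (hrate : ∀ (b : B.Birth) (k' k : ℕ), B.birthScale b ≤ k' → k' ≤ k → k ≤ B.K →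
      defect b k' k ≤ cδ * ψ ^ (k - k'))
    (hlin : ∀ (b : B.Birth) (k' k : ℕ), B.birthScale b ≤ k' → k' ≤ k → k ≤ B.K → RanBelow Gate k → ∀ ε > 0,
      ∃ U₀ ∈ 𝒦 b k', ∃ U₁ : 𝒰, RelGauge (rel b k') move N U₀ U₁ (defect b k' k) ∧
        T.lin b k' k ≤ ‖Fn b k' k U₁ - Fn b k' k U₀‖ + ε) :
    T.TransportsFromVar (4 * cδ / r) (fun i => ψ * α i) Gate := by
  have h := transportsFromVar_of_moduliAt (T := T) (by positivity : (0 : ℝ) ≤ 4 / r) hα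
    (moduliAt_of_sliceFormat hα hinv hsl hmove hr) hdefw hrate
    (fun b k' k hbk' hk'k hk hran ε hε => by
      obtain ⟨U₀, hU₀, U₁, hrel, hle⟩ := hlin b k' k hbk' hk'k hk hran ε hε
      exact ⟨U₀, U₁, ⟨hU₀, hrel⟩, hle⟩)
  have e : 4 / r * cδ = 4 * cδ / r := by ring
  rw [e] at h
  exact h

end ChartModulus

section WindowModulus

open T4BirthChartTransport (GaugeInvariant BirthSlice)
open T4RelativeLadder (UnitaryLike)
open T4RelativeComb (Cfg)
open T4BlockTransport (Fld val BlockRel)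
open T4CombHolderWindow (Win winN winN_nonneg WindowData wMove wN blockDev block_transport_window)

variable {B : Booking} {T : Trajectory B}
variable {R : Type*} [NormedRing R] [NormedAlgebra ℂ R] {d : ℕ}
  {F : Type*} [NormedAddCommGroup F] [NormedSpace ℂ F] [CompleteSpace F]

/-- The PRINTED-WINDOW admissibility of §9/§14 (pv24-g11's `T4CombHolderWindow`): the pair of fields is
`(val U₀, val U₁)` for unit-valued configurations with base `val U₀ ∈ 𝒦`, a unitary-like block gauge `g` and window data
`b_w` of the zero-extended block deviation `blockDev L z g U₀ U₁` with `N_κ(b_w) ≤ δ`. [folklore] -/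
def WindowAdm (L : ℕ) (z : T4BlockTransport.Site d) (β : ℝ) (κ : Win) (𝒦 : Set (Fld d R)) :
    Fld d R → Fld d R → ℝ → Prop :=
  fun V₀ V₁ δ => ∃ U₀ U₁ : Cfg d R, ∃ g : T4BlockTransport.Site d → Rˣ, ∃ bw : Win,
    V₀ = val U₀ ∧ V₁ = val U₁ ∧ val U₀ ∈ 𝒦 ∧ (∀ x, UnitaryLike (g x)) ∧
      WindowData L z β (blockDev L z g U₀ U₁) bw ∧ winN κ bw ≤ δ

omit [NormedAlgebra ℂ R] [NormedSpace ℂ F] [CompleteSpace F] in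
/-- Window defects are non-negative (positive weights). [arith] [folklore] -/
theorem windowAdm_nonneg {L : ℕ} {z : T4BlockTransport.Site d} {β : ℝ} {κ : Win} {𝒦 : Set (Fld d R)}
    (hκ : κ.Pos) {V₀ V₁ : Fld d R} {δ : ℝ} (h : WindowAdm L z β κ 𝒦 V₀ V₁ δ) : 0 ≤ δ := by
  obtain ⟨_, _, _, bw, _, _, _, _, hW, hbw⟩ := h
  exact (winN_nonneg hκ hW.sup_nonneg).trans hbw

/-- §9's ENGINE IN MODULUS FORM: a `BlockRel`-invariant function with a birth slice along window directions (radius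
`r > 0`, sup `A ≥ 0`) has response modulus `4A/r` on the window pairs (`T4CombHolderWindow.block_transport_window`, BY
NAME). [folklore] -/
theorem respMod_of_windowSlice {G : Fld d R → F} {L : ℕ} {z : T4BlockTransport.Site d} {β : ℝ} {κ : Win}
    {𝒦 : Set (Fld d R)} {w r A : ℝ} (hinv : GaugeInvariant (BlockRel L z) G)
    (hsl : BirthSlice G (wMove L z β) (wN L z β κ) 𝒦 w r A) (hκ : κ.Pos) (hr : 0 < r) (hA : 0 ≤ A) :
    RespMod G (WindowAdm L z β κ 𝒦) w (4 * A / r) := by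
  rintro V₀ V₁ δ ⟨U₀, U₁, g, bw, rfl, rfl, hU₀, hg, hW, hbw⟩ hδ
  calc ‖G (val U₁) - G (val U₀)‖ ≤ 4 * A / r * winN κ bw :=
        block_transport_window hinv hsl hκ hr hA hU₀ hg hW (hbw.trans hδ)
    _ ≤ 4 * A / r * δ := mul_le_mul_of_nonneg_left hbw (by positivity)

/-- **RESPONSE LEVEL ⇒ `TransportsFromVar` IN THE PRINTED WINDOW CHART** (§14's `transportsFromVar_of_window` re-cut:
window birth slices of the GENERATED functions only, continuation modulus-multiplicative on the window pairs under the
history; M2's scope remark of C-pv03-80 answered).  `0 ≤ ψ ≤ 1`, `0 ≤ c_δ ≤ w`; sizes attained as in §14.  Output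
`TransportsFromVar (4c_δ/r) (fun i => ψ·α i) Gate`. [folklore] -/
theorem transportsFromVar_of_modulus_window {Gate : ℕ → Prop} {Fn : B.Birth → ℕ → ℕ → Fld d R → F}
    {Lg : B.Birth → ℕ → ℕ} {zg : B.Birth → ℕ → T4BlockTransport.Site d} {𝒦 : B.Birth → ℕ → Set (Fld d R)}
    {β : ℝ} {κ : Win} {w r cδ ψ : ℝ} {α : ℕ → ℝ} (hα : ∀ i, 0 ≤ α i)
    (hinv : ∀ b k', GaugeInvariant (BlockRel (Lg b k') (zg b k')) (Fn b k' k'))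
    (hsl : ∀ (b : B.Birth) (k' : ℕ), B.birthScale b ≤ k' → k' ≤ B.K → RanBelow Gate k' →
      BirthSlice (Fn b k' k') (wMove (Lg b k') (zg b k') β) (wN (Lg b k') (zg b k') β κ) (𝒦 b k') w r (T.gen b k'))
    (hκ : κ.Pos) (hr : 0 < r) (hψ : 0 ≤ ψ) (hψ1 : ψ ≤ 1) (hcδ : 0 ≤ cδ) (hw : cδ ≤ w)
    (hcont : ∀ (b : B.Birth) (k' k : ℕ), B.birthScale b ≤ k' → k' ≤ k → k + 1 ≤ B.K → RanBelow Gate (k + 1) →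
      ∀ M : ℝ, 0 ≤ M → RespMod (Fn b k' k) (WindowAdm (Lg b k') (zg b k') β κ (𝒦 b k')) w M →
        RespMod (Fn b k' (k + 1)) (WindowAdm (Lg b k') (zg b k') β κ (𝒦 b k')) w (α k * M))
    (hlin : ∀ (b : B.Birth) (k' k : ℕ), B.birthScale b ≤ k' → k' ≤ k → k ≤ B.K → RanBelow Gate k → ∀ ε > 0,
      ∃ U₀ U₁ : Cfg d R, ∃ g : T4BlockTransport.Site d → Rˣ, ∃ bw : Win,
        val U₀ ∈ 𝒦 b k' ∧ (∀ x, UnitaryLike (g x)) ∧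
        WindowData (Lg b k') (zg b k') β (blockDev (Lg b k') (zg b k') g U₀ U₁) bw ∧
        winN κ bw ≤ cδ * ψ ^ (k - k') ∧
        T.lin b k' k ≤ ‖Fn b k' k (val U₁) - Fn b k' k (val U₀)‖ + ε) :
    T.TransportsFromVar (4 * cδ / r) (fun i => ψ * α i) Gate := by
  have h := transportsFromVar_of_moduli (T := T) (C₀ := 4 / r)
    (Adm := fun b k' => WindowAdm (Lg b k') (zg b k') β κ (𝒦 b k')) (defect := fun b k' k => cδ * ψ ^ (k - k'))
    (by positivity) hα
    (fun b k' hbk' hk hran =>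
      (respMod_of_windowSlice (hinv b k') (hsl b k' hbk' hk hran) hκ hr (T.gen_nonneg b k')).congr_const (by ring))
    hcont
    (fun b k' k => (mul_le_of_le_one_right hcδ (pow_le_one₀ hψ hψ1)).trans hw)
    (fun b k' k _ _ _ => le_rfl)
    (fun b k' k hbk' hk'k hk hran ε hε => by
      obtain ⟨U₀, U₁, g, bw, hU₀𝒦, hg, hW, hbw, hle⟩ := hlin b k' k hbk' hk'k hk hran ε hε
      exact ⟨val U₀, val U₁, ⟨U₀, U₁, g, bw, rfl, rfl, hU₀𝒦, hg, hW, hbw⟩, hle⟩)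
  have e : 4 / r * cδ = 4 * cδ / r := by ring
  rw [e] at h
  exact h

end WindowModulus

/-! ### §E On `ℤ^d`, end to end, in modulus currency -/

section LatticeModulus

open T4BirthChartTransport (GaugeInvariant BirthSlice RelGauge)
open T4RelativeLadder (UnitaryLike)
open T4RelativeComb (Cfg plaq PlaqSup)
open T4BlockTransport (Fld val latMove latN latMove_zero BlockRel relGauge_crude)

variable {B : Booking} {T : Trajectory B}
variable {R : Type*} [NormedRing R] [NormOneClass R] [NormedAlgebra ℂ R] {d : ℕ}
  {F : Type*} [NormedAddCommGroup F] [NormedSpace ℂ F] [CompleteSpace F]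

/-- **ON `ℤ^d`, RESPONSE LEVEL, CRUDE COMB WITNESS ⇒ `TransportsFromVar`** (§13's `transportsFromVar_of_crude` re-cut).
Per generation `(b, k′)`: the GENERATED block functional `Fn b k′ k′` is `BlockRel (Lg b k′) (zg b k′)`-invariant with,
under `RanBelow Gate k′`, a birth slice on the affine chart (radius `r`, window `w`, sup `gen b k′`); one step under the
history multiplies moduli on the chart pairs `ChartAdm (BlockRel …) latMove latN (𝒦 b k′)` by `α k ≥ 0`; the ladder
constant `C_* ≥ (d−1)(Lg b k′ − 1)`, `C_* > 0`, `C_*(a₁+a₀) ≤ w`, `0 < ψ ≤ 1`, `a₁ + a₀ > 0`; sizes attained by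
responses to unitary-like pairs, base in `𝒦 b k′`, with based-plaquette deviations `≤ a₁ψ^{k−k′}`, `≤ a₀ψ^{k−k′}` on the
generation's block (`relGauge_crude` makes them chart pairs of defect `C_*(a₁+a₀)ψ^{k−k′}`).  THEN
`TransportsFromVar (4·(C_*(a₁+a₀))/r) (fun i => ψ·α i) Gate`. [folklore] -/
theorem transportsFromVar_of_modulus_crude {Gate : ℕ → Prop} {Fn : B.Birth → ℕ → ℕ → Fld d R → F}
    {Lg : B.Birth → ℕ → ℕ} {zg : B.Birth → ℕ → T4BlockTransport.Site d} {𝒦 : B.Birth → ℕ → Set (Fld d R)}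
    {w r a₀ a₁ ψ Cst : ℝ} {α : ℕ → ℝ} (hα : ∀ i, 0 ≤ α i)
    (hinv : ∀ b k', GaugeInvariant (BlockRel (Lg b k') (zg b k')) (Fn b k' k'))
    (hsl : ∀ (b : B.Birth) (k' : ℕ), B.birthScale b ≤ k' → k' ≤ B.K → RanBelow Gate k' →
      BirthSlice (Fn b k' k') latMove latN (𝒦 b k') w r (T.gen b k'))
    (hr : 0 < r) (hψ : 0 < ψ) (hψ1 : ψ ≤ 1) (ha : 0 < a₁ + a₀) (hCst : 0 < Cst)
    (hC : ∀ b k', ((d : ℝ) - 1) * ((Lg b k' : ℝ) - 1) ≤ Cst) (hw : Cst * (a₁ + a₀) ≤ w)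
    (hcont : ∀ (b : B.Birth) (k' k : ℕ), B.birthScale b ≤ k' → k' ≤ k → k + 1 ≤ B.K → RanBelow Gate (k + 1) →
      ∀ M : ℝ, 0 ≤ M → RespMod (Fn b k' k) (ChartAdm (BlockRel (Lg b k') (zg b k')) latMove latN (𝒦 b k')) w M →
        RespMod (Fn b k' (k + 1)) (ChartAdm (BlockRel (Lg b k') (zg b k')) latMove latN (𝒦 b k')) w (α k * M))
    (hlin : ∀ (b : B.Birth) (k' k : ℕ), B.birthScale b ≤ k' → k' ≤ k → k ≤ B.K → RanBelow Gate k → ∀ ε > 0,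
      ∃ U₀ U₁ : Cfg d R, val U₀ ∈ 𝒦 b k' ∧ (∀ x ν, UnitaryLike (U₀ x ν)) ∧ (∀ x ν, UnitaryLike (U₁ x ν)) ∧
        PlaqSup (Lg b k') (zg b k') (fun y ρ ν => ‖(plaq U₁ y ρ ν : R) - 1‖) (a₁ * ψ ^ (k - k')) ∧
        PlaqSup (Lg b k') (zg b k') (fun y ρ ν => ‖(plaq U₀ y ρ ν : R) - 1‖) (a₀ * ψ ^ (k - k')) ∧
        T.lin b k' k ≤ ‖Fn b k' k (val U₁) - Fn b k' k (val U₀)‖ + ε) :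
    T.TransportsFromVar (4 * (Cst * (a₁ + a₀)) / r) (fun i => ψ * α i) Gate := by
  refine transportsFromVar_of_modulus (rel := fun b k' => BlockRel (Lg b k') (zg b k')) (move := latMove)
    (N := latN) (defect := fun b k' k => Cst * (a₁ + a₀) * ψ ^ (k - k')) hα hinv hsl latMove_zero hr hcont ?_ ?_ ?_
  · intro b k' k
    have hpow : ψ ^ (k - k') ≤ 1 := pow_le_one₀ hψ.le hψ1
    calc Cst * (a₁ + a₀) * ψ ^ (k - k') ≤ Cst * (a₁ + a₀) * 1 := mul_le_mul_of_nonneg_left hpow (by positivity)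
      _ ≤ w := by rw [mul_one]; exact hw
  · intro b k' k _ _ _
    exact le_rfl
  · intro b k' k hbk' hk'k hk hran ε hε
    obtain ⟨U₀, U₁, hU₀𝒦, hU₀, hU₁, hq₁, hq₀, hle⟩ := hlin b k' k hbk' hk'k hk hran ε hε
    refine ⟨val U₀, hU₀𝒦, val U₁, ?_, hle⟩
    have hsum : a₁ * ψ ^ (k - k') + a₀ * ψ ^ (k - k') = (a₁ + a₀) * ψ ^ (k - k') := by ring
    have hq : 0 ≤ a₁ * ψ ^ (k - k') + a₀ * ψ ^ (k - k') := by rw [hsum]; positivity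
    refine relGauge_crude hU₀ hU₁ hq₁ hq₀ hq ?_ (by positivity)
    calc ((d : ℝ) - 1) * ((Lg b k' : ℝ) - 1) * (a₁ * ψ ^ (k - k') + a₀ * ψ ^ (k - k'))
        ≤ Cst * (a₁ * ψ ^ (k - k') + a₀ * ψ ^ (k - k')) := mul_le_mul_of_nonneg_right (hC b k') hq
      _ = Cst * (a₁ + a₀) * ψ ^ (k - k') := by rw [hsum, mul_assoc]

/-- Under §8's window relation the transport constant may be taken `C := 4w/r`, free of the ladder constant (pv18-g20
kit (S6) `window_caps_transport_constant`, INFO I7 — why the modulus pipeline needs no new window inequality and why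
`L̄`, `c_B` and the smallness below can be taken free of `C_*`). [arith] [folklore] -/
theorem transportConst_le_window {Cst a₀ a₁ w r : ℝ} (hr : 0 < r) (hw : Cst * (a₁ + a₀) ≤ w) :
    4 * (Cst * (a₁ + a₀)) / r ≤ 4 * w / r :=
  div_le_div_of_nonneg_right (mul_le_mul_of_nonneg_left hw (by norm_num)) hr.le

/-- **ON `ℤ^d`, END TO END, DRESSED, IN MODULUS CURRENCY** (`transportsFromVar_of_modulus_crude` ∘
`TransportsFromVar.mono_const` ∘ §11's `Trajectory.sizeBound_cubeBudget_of_loadGenerated_small`; §13's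
`latticeTrajectory_budget_loadGenerated` is the same pipeline fed in the slice format).  INPUTS, every one a binder,
NOTHING asserted for the cell's terms: the response-level data of `transportsFromVar_of_modulus_crude` under the history
of the §11 gate `CubeBudgetAt B wt c_B k ∧ (CubeBudgetAt B 1 (L̄·τ^{K−k}) k ∧ H k)` — birth slices of the GENERATED
functions only, the continuation binder `hcont` (moduli × `α k` per step; `cont_of_contStepLaw` derives it from the
step laws `(a_k, ℓ_k, ω_k)`), crude attaining pairs, any `C ≥ 4·C_*(a₁+a₀)/r` (e.g. `C := 4w/r`,
`transportConst_le_window`); the census, weights and §11 data exactly as in §13 (regeneration `c ≥ 0`, `Â ≥ 0`,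
`0 ≤ τ < 1`, `0 ≤ r′ < 1`, `κ ≥ 0`, background `e₀ ≥ 0` with `Σ_{i<K} e₀ ≤ E₀`, dressed steps
`Λ·(ψα i + C·c i)·τ ≤ exp(e₀ i + κ·L̄τ^{K−i})·r′`, `L̄ = 2e^{E₀}N₀(CÂ)(1−r′)⁻¹`, smallness
`2κ·e^{E₀}N₀(CÂ)(1−r′)⁻¹ ≤ (1−τ)·log 2`, `c_B ≥ 2e^{E₀}N₀(CÂ)w̄(1−r′)⁻¹`, births / regeneration / `H` in the §10/§11
shapes).  OUTPUT: the size class `prodRate K (CÂ) (ψα + C·c) τ`, the weighted per-cube budget `c_B`, the unit-weight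
load profile and `H` at every scale — `K`-uniform constants; no CONDITION on `L` beyond the undressed strict product
inside `hstep` and §8's window relation `hww`. [folklore] -/
theorem latticeTrajectory_budget_modulus_loadGenerated {Fn : B.Birth → ℕ → ℕ → Fld d R → F}
    {Lg : B.Birth → ℕ → ℕ} {zg : B.Birth → ℕ → T4BlockTransport.Site d} {𝒦 : B.Birth → ℕ → Set (Fld d R)}
    {w r a₀ a₁ ψ Cst : ℝ} {α : ℕ → ℝ} {N : ℕ → ℕ → ℝ} {wt : ℕ → ℝ}
    {N₀ Λ wbar C Ahat τ r' κ Lbar E₀ cB : ℝ} {c e₀ : ℕ → ℝ} {H : ℕ → Prop}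
    (hα : ∀ i, 0 ≤ α i)
    (hinv : ∀ b k', GaugeInvariant (BlockRel (Lg b k') (zg b k')) (Fn b k' k'))
    (hsl : ∀ (b : B.Birth) (k' : ℕ), B.birthScale b ≤ k' → k' ≤ B.K →
      RanBelow (fun i => CubeBudgetAt B wt cB i ∧ (CubeBudgetAt B (fun _ => 1) (Lbar * τ ^ (B.K - i)) i ∧ H i)) k' →
      BirthSlice (Fn b k' k') latMove latN (𝒦 b k') w r (T.gen b k'))
    (hr : 0 < r) (hψ : 0 < ψ) (hψ1 : ψ ≤ 1) (ha : 0 < a₁ + a₀) (hCst : 0 < Cst)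
    (hCL : ∀ b k', ((d : ℝ) - 1) * ((Lg b k' : ℝ) - 1) ≤ Cst) (hww : Cst * (a₁ + a₀) ≤ w)
    (hCle : 4 * (Cst * (a₁ + a₀)) / r ≤ C)
    (hcont : ∀ (b : B.Birth) (k' k : ℕ), B.birthScale b ≤ k' → k' ≤ k → k + 1 ≤ B.K →
      RanBelow (fun i => CubeBudgetAt B wt cB i ∧ (CubeBudgetAt B (fun _ => 1) (Lbar * τ ^ (B.K - i)) i ∧ H i))
        (k + 1) →
      ∀ M : ℝ, 0 ≤ M → RespMod (Fn b k' k) (ChartAdm (BlockRel (Lg b k') (zg b k')) latMove latN (𝒦 b k')) w M →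
        RespMod (Fn b k' (k + 1)) (ChartAdm (BlockRel (Lg b k') (zg b k')) latMove latN (𝒦 b k')) w (α k * M))
    (hlin : ∀ (b : B.Birth) (k' k : ℕ), B.birthScale b ≤ k' → k' ≤ k → k ≤ B.K →
      RanBelow (fun i => CubeBudgetAt B wt cB i ∧ (CubeBudgetAt B (fun _ => 1) (Lbar * τ ^ (B.K - i)) i ∧ H i)) k →
      ∀ ε > 0, ∃ U₀ U₁ : Cfg d R, val U₀ ∈ 𝒦 b k' ∧ (∀ x ν, UnitaryLike (U₀ x ν)) ∧ (∀ x ν, UnitaryLike (U₁ x ν)) ∧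
        PlaqSup (Lg b k') (zg b k') (fun y ρ ν => ‖(plaq U₁ y ρ ν : R) - 1‖) (a₁ * ψ ^ (k - k')) ∧
        PlaqSup (Lg b k') (zg b k') (fun y ρ ν => ‖(plaq U₀ y ρ ν : R) - 1‖) (a₀ * ψ ^ (k - k')) ∧
        T.lin b k' k ≤ ‖Fn b k' k (val U₁) - Fn b k' k (val U₀)‖ + ε)
    (hw : ∀ j, j ≤ B.K → 0 ≤ wt j) (hwb : ∀ j, j ≤ B.K → wt j ≤ wbar) (hN : B.PositionalCount N)
    (hNle : ∀ j k, j ≤ k → k ≤ B.K → N j k ≤ N₀ * Λ ^ (k - j)) (hN₀ : 0 ≤ N₀) (hΛ : 0 ≤ Λ)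
    (hc : ∀ k, 0 ≤ c k) (hAhat : 0 ≤ Ahat) (hτ0 : 0 ≤ τ) (hτ1 : τ < 1) (hr0 : 0 ≤ r') (hr1 : r' < 1)
    (hκ : 0 ≤ κ) (he₀ : ∀ i, 0 ≤ e₀ i) (hE₀ : ∑ i ∈ range B.K, e₀ i ≤ E₀)
    (hLdef : Lbar = 2 * (Real.exp E₀ * (N₀ * (C * Ahat)) * (1 - r')⁻¹))
    (hsmall : 2 * κ * (Real.exp E₀ * (N₀ * (C * Ahat)) * (1 - r')⁻¹) ≤ (1 - τ) * Real.log 2)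
    (hcB : 2 * (Real.exp E₀ * (N₀ * (C * Ahat)) * wbar * (1 - r')⁻¹) ≤ cB)
    (hstep : ∀ i, i < B.K →
      Λ * (ψ * α i + C * c i) * τ ≤ Real.exp (e₀ i + κ * (Lbar * τ ^ (B.K - i))) * r')
    (h0 : T.BirthsFromOld C (fun i => ψ * α i) (prodRate B.K (C * Ahat) (fun i => ψ * α i + C * c i) τ)
      (fun k => CubeBudgetAt B wt cB k ∧ (CubeBudgetAt B (fun _ => 1) (Lbar * τ ^ (B.K - k)) k ∧ H k)))
    (hreg : T.RegeneratesFromVar c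
      (fun k => CubeBudgetAt B wt cB k ∧ (CubeBudgetAt B (fun _ => 1) (Lbar * τ ^ (B.K - k)) k ∧ H k)))
    (hH : GateOfSizes B (prodRate B.K (C * Ahat) (fun i => ψ * α i + C * c i) τ) H) :
    B.SizeBound (prodRate B.K (C * Ahat) (fun i => ψ * α i + C * c i) τ) ∧ B.CubeBudget wt cB ∧
      (∀ k, k ≤ B.K → CubeBudgetAt B (fun _ => 1) (Lbar * τ ^ (B.K - k)) k) ∧ ∀ k, k ≤ B.K → H k := by
  have hρ : ∀ i, 0 ≤ ψ * α i := fun i => mul_nonneg hψ.le (hα i)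
  have hC : 0 ≤ C := le_trans (by positivity) hCle
  have htr := (transportsFromVar_of_modulus_crude
    (Gate := fun i => CubeBudgetAt B wt cB i ∧ (CubeBudgetAt B (fun _ => 1) (Lbar * τ ^ (B.K - i)) i ∧ H i))
    hα hinv hsl hr hψ hψ1 ha hCst hCL hww hcont hlin).mono_const hρ hCle
  exact Trajectory.sizeBound_cubeBudget_of_loadGenerated_small hw hwb hN hNle hN₀ hΛ hC hρ hc hAhat hτ0 hτ1 hr0
    hr1 hκ he₀ hE₀ hLdef hsmall hcB hstep h0 htr hreg hH

end LatticeModulus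

/-! ### §F The law on an integrand class (XREAD C-pv10-97, finding T1, option (a)) -/

section IntegrandClass

variable {𝒰 F : Type*} [NormedAddCommGroup F]

/-- HYPOTHESIS SHAPE — THE STEP LAW ON AN INTEGRAND CLASS `𝒢 ⊆ (Z → F)` (v1.1; XREAD C-pv10-97 finding T1, reader
pv10-g19's kernel-checked OFFER `HOME/b2b-balaban-pv10-g19/xread2/TwinC.lean` §(C3) 2d9a13b0a07159ad, taken VERBATIM with
credit): §C's `ContStepLaw` with `supCost` and `bgLip` asked only for integrands `g, g' ∈ 𝒢` (bounded measurable /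
continuous / analytic on the window, …), so that a LITERAL instantiation of `E U` by a normalised integral operation is
not obstructed by the junk value `∫ = 0` on non-measurable integrands (cell typing-checklist (ii)).  BESIDE `ContStepLaw`,
never in place: `ContStepLaw = ContStepLawOn univ` (`contStepLawOn_of_law`, `law_of_contStepLawOn_univ`).  NOTHING here
is asserted for Bałaban's `T′`-operations. [folklore] -/
structure ContStepLawOn {Z : Type*} (𝒢 : Set (Z → F)) (E : 𝒰 → (Z → F) → F) (act : Z → 𝒰 → 𝒰) (D : Set Z)
    (Adm Adm' : 𝒰 → 𝒰 → ℝ → Prop) (w a ℓ ω : ℝ) : Prop where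
  /-- sup cost of `E U₀` on differences of class integrands, at admissible bases -/
  supCost : ∀ (U₀ U₁ : 𝒰) (δ : ℝ), Adm U₀ U₁ δ → δ ≤ w → ∀ g ∈ 𝒢, ∀ g' ∈ 𝒢, ∀ (m : ℝ),
    (∀ z ∈ D, ‖g z - g' z‖ ≤ m) → ‖E U₀ g - E U₀ g'‖ ≤ a * m
  /-- background Lipschitz against the oscillation over `D`, for class integrands -/
  bgLip : ∀ (U₀ U₁ : 𝒰) (δ : ℝ), Adm U₀ U₁ δ → δ ≤ w → ∀ g ∈ 𝒢, ∀ (m : ℝ),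
    (∀ z ∈ D, ∀ z' ∈ D, ‖g z - g z'‖ ≤ m) → ‖E U₁ g - E U₀ g‖ ≤ ℓ * δ * m
  /-- admissibility survives a common fluctuation -/
  covariant : ∀ (U₀ U₁ : 𝒰) (δ : ℝ), Adm U₀ U₁ δ → ∀ z ∈ D, Adm' (act z U₀) (act z U₁) δ
  /-- two fluctuations over one background: an admissible pair of defect `ω` -/
  fluctPair : ∀ (U₀ U₁ : 𝒰) (δ : ℝ), Adm U₀ U₁ δ → ∀ z ∈ D, ∀ z' ∈ D, z ≠ z' →
    Adm' (act z' U₁) (act z U₁) ω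
  /-- `0 ≤ ω` -/
  ω_nonneg : 0 ≤ ω
  /-- `ω ≤ w` -/
  ω_le : ω ≤ w

/-- §C's law implies the relativised law for EVERY class (conservative re-cut; TwinC §(C3)). [folklore] -/
theorem contStepLawOn_of_law {Z : Type*} {E : 𝒰 → (Z → F) → F} {act : Z → 𝒰 → 𝒰} {D : Set Z}
    {Adm Adm' : 𝒰 → 𝒰 → ℝ → Prop} {w a ℓ ω : ℝ} (h : ContStepLaw E act D Adm Adm' w a ℓ ω)
    (𝒢 : Set (Z → F)) : ContStepLawOn 𝒢 E act D Adm Adm' w a ℓ ω where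
  supCost := fun U₀ U₁ δ hadm hδ g _ g' _ m hm => h.supCost U₀ U₁ δ hadm hδ g g' m hm
  bgLip := fun U₀ U₁ δ hadm hδ g _ m hm => h.bgLip U₀ U₁ δ hadm hδ g m hm
  covariant := h.covariant
  fluctPair := h.fluctPair
  ω_nonneg := h.ω_nonneg
  ω_le := h.ω_le

/-- … and at `𝒢 = univ` the relativised law is §C's (TwinC §(C3)). [folklore] -/
theorem law_of_contStepLawOn_univ {Z : Type*} {E : 𝒰 → (Z → F) → F} {act : Z → 𝒰 → 𝒰} {D : Set Z}
    {Adm Adm' : 𝒰 → 𝒰 → ℝ → Prop} {w a ℓ ω : ℝ} (h : ContStepLawOn Set.univ E act D Adm Adm' w a ℓ ω) :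
    ContStepLaw E act D Adm Adm' w a ℓ ω where
  supCost := fun U₀ U₁ δ hadm hδ g g' m hm =>
    h.supCost U₀ U₁ δ hadm hδ g (Set.mem_univ _) g' (Set.mem_univ _) m hm
  bgLip := fun U₀ U₁ δ hadm hδ g m hm => h.bgLip U₀ U₁ δ hadm hδ g (Set.mem_univ _) m hm
  covariant := h.covariant
  fluctPair := h.fluctPair
  ω_nonneg := h.ω_nonneg
  ω_le := h.ω_le

/-- A smaller class obeys the law of a larger one. [folklore] -/
theorem ContStepLawOn.anti {Z : Type*} {𝒢 𝒢' : Set (Z → F)} {E : 𝒰 → (Z → F) → F} {act : Z → 𝒰 → 𝒰} {D : Set Z}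
    {Adm Adm' : 𝒰 → 𝒰 → ℝ → Prop} {w a ℓ ω : ℝ} (h : ContStepLawOn 𝒢 E act D Adm Adm' w a ℓ ω) (h𝒢 : 𝒢' ⊆ 𝒢) :
    ContStepLawOn 𝒢' E act D Adm Adm' w a ℓ ω where
  supCost := fun U₀ U₁ δ hadm hδ g hg g' hg' m hm => h.supCost U₀ U₁ δ hadm hδ g (h𝒢 hg) g' (h𝒢 hg') m hm
  bgLip := fun U₀ U₁ δ hadm hδ g hg m hm => h.bgLip U₀ U₁ δ hadm hδ g (h𝒢 hg) m hm
  covariant := h.covariant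
  fluctPair := h.fluctPair
  ω_nonneg := h.ω_nonneg
  ω_le := h.ω_le

/-- **THE AFFINE CONTINUATION LAW, RELATIVISED** (TwinC §(C3), verbatim with credit): same conclusion `(a + ℓ·ω)·M`;
ONE extra binder — the integrands actually fed to `E`, `z ↦ G (act z U)`, lie in `𝒢`.  Proof = §C's
`ContStepLaw.respMod_continue` plus the two membership arguments (the `z = z'` guard kept). [folklore] -/
theorem ContStepLawOn.respMod_continue {Z : Type*} {𝒢 : Set (Z → F)} {E : 𝒰 → (Z → F) → F} {act : Z → 𝒰 → 𝒰}
    {D : Set Z} {Adm Adm' : 𝒰 → 𝒰 → ℝ → Prop} {w a ℓ ω M : ℝ} (hlaw : ContStepLawOn 𝒢 E act D Adm Adm' w a ℓ ω)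
    {G : 𝒰 → F} (hG𝒢 : ∀ U, (fun z => G (act z U)) ∈ 𝒢) (hM : 0 ≤ M) (hG : RespMod G Adm' w M) :
    RespMod (fun U => E U (fun z => G (act z U))) Adm w ((a + ℓ * ω) * M) := by
  intro U₀ U₁ δ hadm hδ
  have h2 : ‖E U₀ (fun z => G (act z U₁)) - E U₀ (fun z => G (act z U₀))‖ ≤ a * (M * δ) :=
    hlaw.supCost U₀ U₁ δ hadm hδ _ (hG𝒢 U₁) _ (hG𝒢 U₀) (M * δ)
      fun z hz => hG _ _ δ (hlaw.covariant U₀ U₁ δ hadm z hz) hδ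
  have h1 : ‖E U₁ (fun z => G (act z U₁)) - E U₀ (fun z => G (act z U₁))‖ ≤ ℓ * δ * (M * ω) := by
    refine hlaw.bgLip U₀ U₁ δ hadm hδ _ (hG𝒢 U₁) (M * ω) fun z hz z' hz' => ?_
    by_cases hzz : z = z'
    · subst hzz
      rw [sub_self, norm_zero]
      exact mul_nonneg hM hlaw.ω_nonneg
    · exact hG _ _ ω (hlaw.fluctPair U₀ U₁ δ hadm z hz z' hz' hzz) hlaw.ω_le
  calc ‖E U₁ (fun z => G (act z U₁)) - E U₀ (fun z => G (act z U₀))‖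
      ≤ ‖E U₁ (fun z => G (act z U₁)) - E U₀ (fun z => G (act z U₁))‖ +
          ‖E U₀ (fun z => G (act z U₁)) - E U₀ (fun z => G (act z U₀))‖ :=
        norm_sub_le_norm_sub_add_norm_sub _ _ _
    _ ≤ ℓ * δ * (M * ω) + a * (M * δ) := add_le_add h1 h2
    _ = (a + ℓ * ω) * M * δ := by ring

/-! ### §G Scale-dependent admissibility (XREAD C-pv10-97, INFO I3, made a theorem) -/

variable {B : Booking} {T : Trajectory B}

/-- **MODULI AT EVERY SCALE ⇒ `TransportsFromVar`, SCALE-DEPENDENT ADMISSIBILITY**: §B's `transportsFromVar_of_moduliAt`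
with the admissible pairs `Adm b k′ k` of the carried function `Fn b k′ k` allowed to depend on the CURRENT scale `k`
(thin base sets / direction windows shrinking with `k`; §B is the constant case `Adm b k′ k := Adm b k′`).  Same proof:
§B's bookkeeping never used the constancy. [folklore] -/
theorem transportsFromVar_of_moduliAt_dep {Gate : ℕ → Prop} {Fn : B.Birth → ℕ → ℕ → 𝒰 → F}
    {Adm : B.Birth → ℕ → ℕ → 𝒰 → 𝒰 → ℝ → Prop} {defect : B.Birth → ℕ → ℕ → ℝ} {C₀ cδ ψ w : ℝ} {α : ℕ → ℝ}
    (hC₀ : 0 ≤ C₀) (hα : ∀ i, 0 ≤ α i)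
    (hmod : ∀ (b : B.Birth) (k' k : ℕ), B.birthScale b ≤ k' → k' ≤ k → k ≤ B.K → RanBelow Gate k →
      RespMod (Fn b k' k) (Adm b k' k) w (C₀ * stepProd α k' k * T.gen b k'))
    (hdefw : ∀ b k' k, defect b k' k ≤ w)
    (hrate : ∀ (b : B.Birth) (k' k : ℕ), B.birthScale b ≤ k' → k' ≤ k → k ≤ B.K →
      defect b k' k ≤ cδ * ψ ^ (k - k'))
    (hlin : ∀ (b : B.Birth) (k' k : ℕ), B.birthScale b ≤ k' → k' ≤ k → k ≤ B.K → RanBelow Gate k → ∀ ε > 0,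
      ∃ U₀ U₁ : 𝒰, Adm b k' k U₀ U₁ (defect b k' k) ∧ T.lin b k' k ≤ ‖Fn b k' k U₁ - Fn b k' k U₀‖ + ε) :
    T.TransportsFromVar (C₀ * cδ) (fun i => ψ * α i) Gate := by
  intro b k' k hbk' hk'k hk hran
  refine le_of_forall_pos_le_add fun ε hε => ?_
  obtain ⟨U₀, U₁, hadm, hle⟩ := hlin b k' k hbk' hk'k hk hran ε hε
  have hresp := hmod b k' k hbk' hk'k hk hran U₀ U₁ _ hadm (hdefw b k' k)
  have hP : 0 ≤ stepProd α k' k := stepProd_nonneg hα k' k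
  have hg0 : 0 ≤ T.gen b k' := T.gen_nonneg b k'
  have hprod : stepProd (fun i => ψ * α i) k' k = ψ ^ (k - k') * stepProd α k' k := by
    rw [stepProd_mul (fun _ => ψ) α, stepProd_const]
  have hmono : C₀ * stepProd α k' k * T.gen b k' * defect b k' k ≤
      C₀ * cδ * stepProd (fun i => ψ * α i) k' k * T.gen b k' :=
    calc C₀ * stepProd α k' k * T.gen b k' * defect b k' k
        ≤ C₀ * stepProd α k' k * T.gen b k' * (cδ * ψ ^ (k - k')) :=
          mul_le_mul_of_nonneg_left (hrate b k' k hbk' hk'k hk) (by positivity)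
      _ = C₀ * cδ * stepProd (fun i => ψ * α i) k' k * T.gen b k' := by rw [hprod]; ring
  linarith

/-- **BIRTH MODULI + MODULUS-MULTIPLICATIVE CONTINUATION ⇒ MODULI AT EVERY SCALE, SCALE-DEPENDENT ADMISSIBILITY**: the
birth modulus `C₀·gen b k′` is tested on `Adm b k′ k′`; ONE step `k → k+1` under the history turns ANY modulus `M ≥ 0`
of `Fn b k′ k` on `Adm b k′ k` into the modulus `α k·M` of `Fn b k′ (k+1)` on `Adm b k′ (k+1)` (the scale-`k`
operation need only be defined, and its bounds asked, at scale-`(k+1)`-admissible pairs — the thin-domain point of XREAD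
C-pv18g20-3 M2 at the level of the admissible pairs).  Same induction as §B's `moduliAt_of_birth_cont`. [folklore] -/
theorem moduliAt_of_birth_cont_dep {Gate : ℕ → Prop} {Fn : B.Birth → ℕ → ℕ → 𝒰 → F}
    {Adm : B.Birth → ℕ → ℕ → 𝒰 → 𝒰 → ℝ → Prop} {C₀ w : ℝ} {α : ℕ → ℝ} (hC₀ : 0 ≤ C₀) (hα : ∀ i, 0 ≤ α i)
    (hbirth : ∀ (b : B.Birth) (k' : ℕ), B.birthScale b ≤ k' → k' ≤ B.K → RanBelow Gate k' →
      RespMod (Fn b k' k') (Adm b k' k') w (C₀ * T.gen b k'))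
    (hcont : ∀ (b : B.Birth) (k' k : ℕ), B.birthScale b ≤ k' → k' ≤ k → k + 1 ≤ B.K → RanBelow Gate (k + 1) →
      ∀ M : ℝ, 0 ≤ M → RespMod (Fn b k' k) (Adm b k' k) w M →
        RespMod (Fn b k' (k + 1)) (Adm b k' (k + 1)) w (α k * M)) :
    ∀ (b : B.Birth) (k' k : ℕ), B.birthScale b ≤ k' → k' ≤ k → k ≤ B.K → RanBelow Gate k →
      RespMod (Fn b k' k) (Adm b k' k) w (C₀ * stepProd α k' k * T.gen b k') := by
  have key : ∀ (b : B.Birth) (k' : ℕ), B.birthScale b ≤ k' → ∀ n : ℕ, k' + n ≤ B.K → RanBelow Gate (k' + n) →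
      RespMod (Fn b k' (k' + n)) (Adm b k' (k' + n)) w (C₀ * stepProd α k' (k' + n) * T.gen b k') := by
    intro b k' hbk' n
    induction n with
    | zero =>
      intro hk hran
      rw [Nat.add_zero] at hk hran ⊢
      exact (hbirth b k' hbk' hk hran).congr_const (by rw [stepProd_self, mul_one])
    | succ n ih =>
      intro hk hran
      have hk1 : k' + n + 1 ≤ B.K := by omega
      have hranS : RanBelow Gate (k' + n + 1) := hran
      have hM : 0 ≤ C₀ * stepProd α k' (k' + n) * T.gen b k' :=
        mul_nonneg (mul_nonneg hC₀ (stepProd_nonneg hα _ _)) (T.gen_nonneg b k')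
      have h := hcont b k' (k' + n) hbk' (Nat.le_add_right _ _) hk1 hranS _ hM
        (ih (by omega) (hranS.mono (by omega)))
      have heq : α (k' + n) * (C₀ * stepProd α k' (k' + n) * T.gen b k') =
          C₀ * stepProd α k' (k' + n + 1) * T.gen b k' := by
        rw [stepProd_succ α (Nat.le_add_right k' n)]; ring
      exact h.congr_const heq
  intro b k' k hbk' hk'k hk hran
  obtain ⟨n, rfl⟩ := Nat.exists_eq_add_of_le hk'k
  exact key b k' hbk' n hk hran

/-- **THE RESPONSE-MODULUS FORMAT ⇒ `TransportsFromVar`, SCALE-DEPENDENT ADMISSIBILITY**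
(`moduliAt_of_birth_cont_dep` ∘ `transportsFromVar_of_moduliAt_dep`). [folklore] -/
theorem transportsFromVar_of_moduli_dep {Gate : ℕ → Prop} {Fn : B.Birth → ℕ → ℕ → 𝒰 → F}
    {Adm : B.Birth → ℕ → ℕ → 𝒰 → 𝒰 → ℝ → Prop} {defect : B.Birth → ℕ → ℕ → ℝ} {C₀ cδ ψ w : ℝ} {α : ℕ → ℝ}
    (hC₀ : 0 ≤ C₀) (hα : ∀ i, 0 ≤ α i)
    (hbirth : ∀ (b : B.Birth) (k' : ℕ), B.birthScale b ≤ k' → k' ≤ B.K → RanBelow Gate k' →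
      RespMod (Fn b k' k') (Adm b k' k') w (C₀ * T.gen b k'))
    (hcont : ∀ (b : B.Birth) (k' k : ℕ), B.birthScale b ≤ k' → k' ≤ k → k + 1 ≤ B.K → RanBelow Gate (k + 1) →
      ∀ M : ℝ, 0 ≤ M → RespMod (Fn b k' k) (Adm b k' k) w M →
        RespMod (Fn b k' (k + 1)) (Adm b k' (k + 1)) w (α k * M))
    (hdefw : ∀ b k' k, defect b k' k ≤ w)
    (hrate : ∀ (b : B.Birth) (k' k : ℕ), B.birthScale b ≤ k' → k' ≤ k → k ≤ B.K →
      defect b k' k ≤ cδ * ψ ^ (k - k'))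
    (hlin : ∀ (b : B.Birth) (k' k : ℕ), B.birthScale b ≤ k' → k' ≤ k → k ≤ B.K → RanBelow Gate k → ∀ ε > 0,
      ∃ U₀ U₁ : 𝒰, Adm b k' k U₀ U₁ (defect b k' k) ∧ T.lin b k' k ≤ ‖Fn b k' k U₁ - Fn b k' k U₀‖ + ε) :
    T.TransportsFromVar (C₀ * cδ) (fun i => ψ * α i) Gate :=
  transportsFromVar_of_moduliAt_dep hC₀ hα (moduliAt_of_birth_cont_dep hC₀ hα hbirth hcont) hdefw hrate hlin

/-- CONSISTENCY — §B is the constant case `Adm b k′ k := Adm b k′` of §G, by name. [folklore] -/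
example {Gate : ℕ → Prop} {Fn : B.Birth → ℕ → ℕ → 𝒰 → F}
    {Adm : B.Birth → ℕ → 𝒰 → 𝒰 → ℝ → Prop} {C₀ w : ℝ} {α : ℕ → ℝ} (hC₀ : 0 ≤ C₀) (hα : ∀ i, 0 ≤ α i)
    (hbirth : ∀ (b : B.Birth) (k' : ℕ), B.birthScale b ≤ k' → k' ≤ B.K → RanBelow Gate k' →
      RespMod (Fn b k' k') (Adm b k') w (C₀ * T.gen b k'))
    (hcont : ∀ (b : B.Birth) (k' k : ℕ), B.birthScale b ≤ k' → k' ≤ k → k + 1 ≤ B.K → RanBelow Gate (k + 1) →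
      ∀ M : ℝ, 0 ≤ M → RespMod (Fn b k' k) (Adm b k') w M → RespMod (Fn b k' (k + 1)) (Adm b k') w (α k * M)) :
    ∀ (b : B.Birth) (k' k : ℕ), B.birthScale b ≤ k' → k' ≤ k → k ≤ B.K → RanBelow Gate k →
      RespMod (Fn b k' k) (Adm b k') w (C₀ * stepProd α k' k * T.gen b k') :=
  moduliAt_of_birth_cont_dep (Adm := fun b k' _ => Adm b k') hC₀ hα hbirth hcont

/-- **THE CONTINUATION BINDER FROM STEP LAWS ON A CLASS, SCALE-DEPENDENT ADMISSIBILITY** (§C's `cont_of_contStepLaw`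
re-derived): under the history `RanBelow Gate (k+1)`, the carried function at scale `k+1` IS the step-`k` continuation
of the one at scale `k` (`hFn`), the fluctuation functions actually fed to `E k`, `z ↦ Fn b k′ k (act k z U)`, lie in
the step's integrand class `𝒢 k` (`h𝒢` — v1.1's one extra binder, C-pv10-97 T1), the step obeys
`ContStepLawOn (𝒢 k) (E k) (act k) (D k) (Adm b k′ (k+1)) (Adm b k′ k) w (a k) (ℓ b k′ k) (ω b k′ k)` — continued
function tested on the scale-`(k+1)` pairs, `G` known on the scale-`k` pairs — and `a k + ℓ b k′ k·ω b k′ k ≤ α k`.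
THEN one step multiplies moduli by `α k`, from `Adm b k′ k` to `Adm b k′ (k+1)`: §G's `hcont`. [folklore] -/
theorem cont_of_contStepLawOn_dep {Z : Type*} {Gate : ℕ → Prop} {Fn : B.Birth → ℕ → ℕ → 𝒰 → F}
    {Adm : B.Birth → ℕ → ℕ → 𝒰 → 𝒰 → ℝ → Prop} {𝒢 : ℕ → Set (Z → F)} {E : ℕ → 𝒰 → (Z → F) → F}
    {act : ℕ → Z → 𝒰 → 𝒰} {D : ℕ → Set Z} {a α : ℕ → ℝ} {ℓ ω : B.Birth → ℕ → ℕ → ℝ} {w : ℝ}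
    (hAdm : ∀ b k' k U₀ U₁ δ, Adm b k' k U₀ U₁ δ → 0 ≤ δ)
    (hFn : ∀ (b : B.Birth) (k' k : ℕ), B.birthScale b ≤ k' → k' ≤ k → k + 1 ≤ B.K → RanBelow Gate (k + 1) →
      ∀ U, Fn b k' (k + 1) U = E k U (fun z => Fn b k' k (act k z U)))
    (h𝒢 : ∀ (b : B.Birth) (k' k : ℕ), B.birthScale b ≤ k' → k' ≤ k → k + 1 ≤ B.K → RanBelow Gate (k + 1) →
      ∀ U, (fun z => Fn b k' k (act k z U)) ∈ 𝒢 k)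
    (hlaw : ∀ (b : B.Birth) (k' k : ℕ), B.birthScale b ≤ k' → k' ≤ k → k + 1 ≤ B.K → RanBelow Gate (k + 1) →
      ContStepLawOn (𝒢 k) (E k) (act k) (D k) (Adm b k' (k + 1)) (Adm b k' k) w (a k) (ℓ b k' k) (ω b k' k))
    (hdom : ∀ (b : B.Birth) (k' k : ℕ), B.birthScale b ≤ k' → k' ≤ k → k + 1 ≤ B.K →
      a k + ℓ b k' k * ω b k' k ≤ α k) :
    ∀ (b : B.Birth) (k' k : ℕ), B.birthScale b ≤ k' → k' ≤ k → k + 1 ≤ B.K → RanBelow Gate (k + 1) →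
      ∀ M : ℝ, 0 ≤ M → RespMod (Fn b k' k) (Adm b k' k) w M →
        RespMod (Fn b k' (k + 1)) (Adm b k' (k + 1)) w (α k * M) := by
  intro b k' k hbk' hk'k hk hran M hM hG
  have h := ((hlaw b k' k hbk' hk'k hk hran).respMod_continue (h𝒢 b k' k hbk' hk'k hk hran) hM hG).congr_fun
    (hFn b k' k hbk' hk'k hk hran)
  exact h.mono (hAdm b k' (k + 1)) (mul_le_mul_of_nonneg_right (hdom b k' k hbk' hk'k hk) hM)

/-- CONSISTENCY — §C's `cont_of_contStepLaw` is the case `𝒢 k := univ`, `Adm b k′ k := Adm b k′` of §G, by name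
(`contStepLawOn_of_law`). [folklore] -/
example {Z : Type*} {Gate : ℕ → Prop} {Fn : B.Birth → ℕ → ℕ → 𝒰 → F}
    {Adm : B.Birth → ℕ → 𝒰 → 𝒰 → ℝ → Prop} {E : ℕ → 𝒰 → (Z → F) → F} {act : ℕ → Z → 𝒰 → 𝒰} {D : ℕ → Set Z}
    {a α : ℕ → ℝ} {ℓ ω : B.Birth → ℕ → ℕ → ℝ} {w : ℝ}
    (hAdm : ∀ b k' U₀ U₁ δ, Adm b k' U₀ U₁ δ → 0 ≤ δ)
    (hFn : ∀ (b : B.Birth) (k' k : ℕ), B.birthScale b ≤ k' → k' ≤ k → k + 1 ≤ B.K → RanBelow Gate (k + 1) →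
      ∀ U, Fn b k' (k + 1) U = E k U (fun z => Fn b k' k (act k z U)))
    (hlaw : ∀ (b : B.Birth) (k' k : ℕ), B.birthScale b ≤ k' → k' ≤ k → k + 1 ≤ B.K → RanBelow Gate (k + 1) →
      ContStepLaw (E k) (act k) (D k) (Adm b k') (Adm b k') w (a k) (ℓ b k' k) (ω b k' k))
    (hdom : ∀ (b : B.Birth) (k' k : ℕ), B.birthScale b ≤ k' → k' ≤ k → k + 1 ≤ B.K →
      a k + ℓ b k' k * ω b k' k ≤ α k) :
    ∀ (b : B.Birth) (k' k : ℕ), B.birthScale b ≤ k' → k' ≤ k → k + 1 ≤ B.K → RanBelow Gate (k + 1) →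
      ∀ M : ℝ, 0 ≤ M → RespMod (Fn b k' k) (Adm b k') w M → RespMod (Fn b k' (k + 1)) (Adm b k') w (α k * M) :=
  cont_of_contStepLawOn_dep (Adm := fun b k' _ => Adm b k') (𝒢 := fun _ => Set.univ) (D := D)
    (fun b k' _ => hAdm b k') hFn (fun _ _ _ _ _ _ _ _ => Set.mem_univ _)
    (fun b k' k hbk' hk'k hk hran => contStepLawOn_of_law (hlaw b k' k hbk' hk'k hk hran) _) hdom

end IntegrandClass

/-! ### §H The Cauchy supplier of `bgLip`: raw chart pairs, the centred operation's slice, the gauge quotient -/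

section CauchySupplier

open T4BirthChartTransport (GaugeInvariant BirthSlice RelGauge slice_bound transport_of_birthChart)

variable {B : Booking} {T : Trajectory B}
variable {𝒰 Dir F : Type*} [NormedAddCommGroup F] [NormedSpace ℂ F] [CompleteSpace F]
  {move : 𝒰 → Dir → ℂ → 𝒰} {N : Dir → ℝ} {w r : ℝ}

/-- The RAW chart pairs: regular base `U₀ ∈ 𝒦` and the chart ENDPOINT `U₁ = move U₀ d 1` itself along some direction of
norm `0 < N d ≤ δ` (no gauge quotient; `ChartAdm` = raw pairs modulo `rel`, `respMod_chart_of_raw`). [folklore] -/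
def RawAdm (move : 𝒰 → Dir → ℂ → 𝒰) (N : Dir → ℝ) (𝒦 : Set 𝒰) : 𝒰 → 𝒰 → ℝ → Prop :=
  fun U₀ U₁ δ => U₀ ∈ 𝒦 ∧ ∃ d : Dir, 0 < N d ∧ N d ≤ δ ∧ U₁ = move U₀ d 1

omit [NormedSpace ℂ F] [CompleteSpace F] in
/-- Raw defects are positive. [arith] [folklore] -/
theorem rawAdm_nonneg {𝒦 : Set 𝒰} {U₀ U₁ : 𝒰} {δ : ℝ} (h : RawAdm move N 𝒦 U₀ U₁ δ) : 0 ≤ δ := by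
  obtain ⟨_, d, hd, hdδ, _⟩ := h
  exact hd.le.trans hdδ

omit [NormedSpace ℂ F] [CompleteSpace F] in
/-- A raw pair is a chart pair for any reflexive gauge relation (so chart moduli restrict to raw moduli,
`RespMod.of_imp`). [folklore] -/
theorem chartAdm_of_rawAdm {rel : 𝒰 → 𝒰 → Prop} (hrefl : ∀ U, rel U U) {𝒦 : Set 𝒰} {U₀ U₁ : 𝒰} {δ : ℝ}
    (h : RawAdm move N 𝒦 U₀ U₁ δ) : ChartAdm rel move N 𝒦 U₀ U₁ δ := by
  obtain ⟨hU₀, d, hd, hdδ, rfl⟩ := h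
  exact ⟨hU₀, d, hd, hdδ, hrefl _⟩

omit [NormedSpace ℂ F] [CompleteSpace F] in
/-- **THE GAUGE QUOTIENT AT RESPONSE LEVEL.**  A `rel`-INVARIANT function's modulus on the RAW chart pairs is its
modulus on the chart pairs modulo `rel` (`ChartAdm`): `U₁ rel (move U₀ d 1)` ⇒ `G U₁ = G (move U₀ d 1)`.  (This is the
`rw [hinv …]` line of `T4BirthChartTransport.transport_of_birthChart`, separated from its Cauchy line `slice_bound`.)
[folklore] -/
theorem respMod_chart_of_raw {G : 𝒰 → F} {rel : 𝒰 → 𝒰 → Prop} {𝒦 : Set 𝒰} {M : ℝ} (hinv : GaugeInvariant rel G)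
    (h : RespMod G (RawAdm move N 𝒦) w M) : RespMod G (ChartAdm rel move N 𝒦) w M := by
  rintro U₀ U₁ δ ⟨hU₀, d, hd, hdδ, hrel⟩ hδ
  rw [hinv _ _ hrel]
  exact h U₀ (move U₀ d 1) δ ⟨hU₀, d, hd, hdδ, rfl⟩ hδ

/-- §5's engine on the RAW pairs needs NO gauge invariance: a birth slice of radius `r > 0` and sup `A ≥ 0` gives the
raw modulus `4A/r` (`T4BirthChartTransport.slice_bound`, BY NAME). [folklore] -/
theorem respMod_raw_of_birthSlice {G : 𝒰 → F} {𝒦 : Set 𝒰} {A : ℝ} (hsl : BirthSlice G move N 𝒦 w r A)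
    (hmove : ∀ U d, move U d 0 = U) (hr : 0 < r) (hA : 0 ≤ A) : RespMod G (RawAdm move N 𝒦) w (4 * A / r) := by
  rintro U₀ U₁ δ ⟨hU₀, d, hd, hdδ, rfl⟩ hδ
  calc ‖G (move U₀ d 1) - G U₀‖ ≤ 4 * A / r * N d := slice_bound hsl hmove hr hU₀ hd (hdδ.trans hδ)
    _ ≤ 4 * A / r * δ := mul_le_mul_of_nonneg_left hdδ (by positivity)

/-- **THE CAUCHY SUPPLIER OF `bgLip`** (v1.1, in-technique; the background-LIPSCHITZ CONSTANT of the step operation that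
b02-g19's (R-ext)/(R-cost) readings locate but do not size — «that estimate is yours/NE1′'s», journal l.54692).  IF for
every class integrand `g ∈ 𝒢` and every constant `c` with `‖g − c‖ ≤ m` on the fluctuation domain `D` the CENTRED
operation `U ↦ E U g − c` has a `BirthSlice` along the chart `(move, N)` at the regular bases `𝒦` — window `w`, radius
`ϱ > 0`, sup `a·m` (dictionary, NOT asserted: for a normalised linear operation `E U g − c = E U (g − c)` («normalized»,
p. 391), its modulus is `≤ e^{3 sup|σ|}·sup|g − c|` by (1.75) p. 380 on the COMPLEX window, and it is analytic in the
complex background along the chart inside the CURRENT-scale window — (1.65) p. 375 / [Balaban1987RG1] (1.13), (1.19) TYPE;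
`ϱ` = that window's radius in the units of `N`) — THEN between the two members of a raw chart pair of defect `δ ≤ w` the
operation moves by at most `(4a/ϱ)·δ·(oscillation of g over D)`: `bgLip` with **`ℓ = 4a/ϱ`**, by `slice_bound` BY NAME
applied to the centred operation with `c := g z₀`, `z₀ ∈ D`.  So the product entering §C's domination is
`ℓ·ω = 4a·(ω/ϱ)`: (fluctuation-pair defect) / (background-analyticity radius) in the units of ONE chart norm — a
chart-free ratio (`ell_mul_omega_rescale`). [folklore] -/
theorem bgLip_of_opSlice {Z : Type*} {𝒢 : Set (Z → F)} {E : 𝒰 → (Z → F) → F} {D : Set Z} {𝒦 : Set 𝒰} {ϱ a : ℝ}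
    (hD : D.Nonempty) (hϱ : 0 < ϱ) (hmove : ∀ U d, move U d 0 = U)
    (hEsl : ∀ g ∈ 𝒢, ∀ (c : F) (m : ℝ), (∀ z ∈ D, ‖g z - c‖ ≤ m) →
      BirthSlice (fun U => E U g - c) move N 𝒦 w ϱ (a * m)) :
    ∀ (U₀ U₁ : 𝒰) (δ : ℝ), RawAdm move N 𝒦 U₀ U₁ δ → δ ≤ w → ∀ g ∈ 𝒢, ∀ (m : ℝ),
      (∀ z ∈ D, ∀ z' ∈ D, ‖g z - g z'‖ ≤ m) → ‖E U₁ g - E U₀ g‖ ≤ 4 * a / ϱ * δ * m := by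
  rintro U₀ U₁ δ ⟨hU₀, d, hd, hdδ, rfl⟩ hδ g hg m hm
  obtain ⟨z₀, hz₀⟩ := hD
  have hsl := hEsl g hg (g z₀) m fun z hz => hm z hz z₀ hz₀
  have ham : 0 ≤ a * m := by
    have h0 := T4BirthChartTransport.norm_base_le hsl hmove hϱ.le hU₀ hd (hdδ.trans hδ)
    exact (norm_nonneg _).trans h0
  have h : ‖(E (move U₀ d 1) g - g z₀) - (E U₀ g - g z₀)‖ ≤ 4 * (a * m) / ϱ * N d :=
    slice_bound (Fn := fun U => E U g - g z₀) hsl hmove hϱ hU₀ hd (hdδ.trans hδ)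
  rw [sub_sub_sub_cancel_right] at h
  have h4 : 0 ≤ 4 * (a * m) / ϱ := div_nonneg (mul_nonneg (by norm_num) ham) hϱ.le
  calc ‖E (move U₀ d 1) g - E U₀ g‖ ≤ 4 * (a * m) / ϱ * N d := h
    _ ≤ 4 * (a * m) / ϱ * δ := mul_le_mul_of_nonneg_left hdδ h4
    _ = 4 * a / ϱ * δ * m := by ring

/-- **THE STEP LAW FROM THE OPERATION'S SLICES** (v1.1).  On the raw chart pairs at the regular bases `𝒦` the law
`ContStepLawOn 𝒢 E act D (RawAdm move N 𝒦) Adm′ w a (4a/ϱ) ω` holds as soon as: `hsup` — the sup cost `a` on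
differences of class integrands at the REAL regular bases [(1.75) p. 380 shape + linearity; thin domain]; `hEsl` — the
centred operation's slices (`bgLip_of_opSlice`); `hcov`/`hpair` — the two [cell] action binders of §C for these pairs;
`0 ≤ ω ≤ w`.  The unprinted residue of §C's four binders is thereby the chart GEOMETRY (`hcov`, `hpair`, and `ϱ`, `ω` as
numbers), not an analytic estimate. [folklore] -/
theorem contStepLawOn_of_opSlice {Z : Type*} {𝒢 : Set (Z → F)} {E : 𝒰 → (Z → F) → F} {act : Z → 𝒰 → 𝒰}
    {D : Set Z} {𝒦 : Set 𝒰} {Adm' : 𝒰 → 𝒰 → ℝ → Prop} {ϱ a ω : ℝ}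
    (hD : D.Nonempty) (hϱ : 0 < ϱ) (hmove : ∀ U d, move U d 0 = U)
    (hsup : ∀ U₀ ∈ 𝒦, ∀ g ∈ 𝒢, ∀ g' ∈ 𝒢, ∀ (m : ℝ), (∀ z ∈ D, ‖g z - g' z‖ ≤ m) → ‖E U₀ g - E U₀ g'‖ ≤ a * m)
    (hEsl : ∀ g ∈ 𝒢, ∀ (c : F) (m : ℝ), (∀ z ∈ D, ‖g z - c‖ ≤ m) →
      BirthSlice (fun U => E U g - c) move N 𝒦 w ϱ (a * m))
    (hcov : ∀ (U₀ U₁ : 𝒰) (δ : ℝ), RawAdm move N 𝒦 U₀ U₁ δ → ∀ z ∈ D, Adm' (act z U₀) (act z U₁) δ)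
    (hpair : ∀ (U₀ U₁ : 𝒰) (δ : ℝ), RawAdm move N 𝒦 U₀ U₁ δ → ∀ z ∈ D, ∀ z' ∈ D, z ≠ z' →
      Adm' (act z' U₁) (act z U₁) ω)
    (hω0 : 0 ≤ ω) (hωw : ω ≤ w) :
    ContStepLawOn 𝒢 E act D (RawAdm move N 𝒦) Adm' w a (4 * a / ϱ) ω where
  supCost := fun U₀ _ _ hadm _ g hg g' hg' m hm => hsup U₀ hadm.1 g hg g' hg' m hm
  bgLip := bgLip_of_opSlice hD hϱ hmove hEsl
  covariant := hcov
  fluctPair := hpair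
  ω_nonneg := hω0
  ω_le := hωw

omit [NormedSpace ℂ F] [CompleteSpace F] in
/-- The per-met-step factor of the Cauchy supplier: `a + (4a/ϱ)·ω = a·(1 + 4ω/ϱ)`. [arith] [folklore] -/
theorem stepFactor_eq (ϱ a ω : ℝ) : a + 4 * a / ϱ * ω = a * (1 + 4 * ω / ϱ) := by
  ring

omit [NormedSpace ℂ F] [CompleteSpace F] in
/-- UNITS — the product `ℓ·ω` is chart-free: rescaling the chart norm by `λ ≠ 0` (defects `δ ↦ λδ`, hence the radius
`ϱ ↦ λϱ` and the fluctuation-pair defect `ω ↦ λω`) leaves `(4a/ϱ)·ω` unchanged; e.g. with `λ = ψ^{k−k′}` the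
generation-chart numbers `(ψ^{k−k′}ϱ, ψ^{k−k′}ω)` and the current-chart numbers `(ϱ, ω)` give the same factor
`a·(1 + 4ω/ϱ)` (§C header «only the product ℓ·ω enters»). [arith] [folklore] -/
theorem ell_mul_omega_rescale {ϱ a ω lam : ℝ} (hlam : lam ≠ 0) :
    4 * a / (lam * ϱ) * (lam * ω) = 4 * a / ϱ * ω :=
  calc 4 * a / (lam * ϱ) * (lam * ω) = lam * (4 * a * ω) / (lam * ϱ) := by ring
    _ = 4 * a * ω / ϱ := mul_div_mul_left _ _ hlam
    _ = 4 * a / ϱ * ω := by ring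

/-- **ONE CONTINUATION STEP FROM THE OPERATION'S SLICES**: a function `G` of modulus `M ≥ 0` on `Adm′` whose fluctuation
functions `z ↦ G (act z U)` are class integrands is continued into `U ↦ E U (z ↦ G (act z U))` of modulus
`a·(1 + 4ω/ϱ)·M` on the raw chart pairs (`contStepLawOn_of_opSlice` ∘ `ContStepLawOn.respMod_continue`). [folklore] -/
theorem respMod_continue_of_opSlice {Z : Type*} {𝒢 : Set (Z → F)} {E : 𝒰 → (Z → F) → F} {act : Z → 𝒰 → 𝒰}
    {D : Set Z} {𝒦 : Set 𝒰} {Adm' : 𝒰 → 𝒰 → ℝ → Prop} {ϱ a ω M : ℝ}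
    (hD : D.Nonempty) (hϱ : 0 < ϱ) (hmove : ∀ U d, move U d 0 = U)
    (hsup : ∀ U₀ ∈ 𝒦, ∀ g ∈ 𝒢, ∀ g' ∈ 𝒢, ∀ (m : ℝ), (∀ z ∈ D, ‖g z - g' z‖ ≤ m) → ‖E U₀ g - E U₀ g'‖ ≤ a * m)
    (hEsl : ∀ g ∈ 𝒢, ∀ (c : F) (m : ℝ), (∀ z ∈ D, ‖g z - c‖ ≤ m) →
      BirthSlice (fun U => E U g - c) move N 𝒦 w ϱ (a * m))
    (hcov : ∀ (U₀ U₁ : 𝒰) (δ : ℝ), RawAdm move N 𝒦 U₀ U₁ δ → ∀ z ∈ D, Adm' (act z U₀) (act z U₁) δ)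
    (hpair : ∀ (U₀ U₁ : 𝒰) (δ : ℝ), RawAdm move N 𝒦 U₀ U₁ δ → ∀ z ∈ D, ∀ z' ∈ D, z ≠ z' →
      Adm' (act z' U₁) (act z U₁) ω)
    (hω0 : 0 ≤ ω) (hωw : ω ≤ w) {G : 𝒰 → F} (hG𝒢 : ∀ U, (fun z => G (act z U)) ∈ 𝒢) (hM : 0 ≤ M)
    (hG : RespMod G Adm' w M) :
    RespMod (fun U => E U (fun z => G (act z U))) (RawAdm move N 𝒦) w (a * (1 + 4 * ω / ϱ) * M) :=
  ((contStepLawOn_of_opSlice hD hϱ hmove hsup hEsl hcov hpair hω0 hωw).respMod_continue hG𝒢 hM hG).congr_const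
    (by rw [stepFactor_eq])

omit [NormedAddCommGroup F] [NormedSpace ℂ F] [CompleteSpace F] in
/-- **GAUGE INVARIANCE OF THE CONTINUED FUNCTION FROM COVARIANCE** [cell binder made a two-line theorem]: if for
`rel`-related backgrounds `U, U′` the operation at `U′` is the operation at `U` composed with a RELABELLING `τ` of the
fluctuations (`E U′ g = E U (g ∘ τ)`; dictionary: the change of variables `z = τ z′` in the fluctuation integral under the
gauge transformation) under which composing is `rel′`-covariant (`act z U rel′ act (τ z) U′`), then the continuation of a
`rel′`-invariant `G` is `rel`-invariant — the `hinv` needed by `respMod_chart_of_raw` at the next scale. [folklore] -/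
theorem gaugeInvariant_cont {Z : Type*} {E : 𝒰 → (Z → F) → F} {act : Z → 𝒰 → 𝒰} {rel rel' : 𝒰 → 𝒰 → Prop}
    {G : 𝒰 → F}
    (hcov : ∀ U U', rel U U' → ∃ τ : Z → Z, (∀ g : Z → F, E U' g = E U (g ∘ τ)) ∧ ∀ z, rel' (act z U) (act (τ z) U'))
    (hG : GaugeInvariant rel' G) : GaugeInvariant rel (fun U => E U (fun z => G (act z U))) := by
  intro U U' hUU'
  obtain ⟨τ, hE, hact⟩ := hcov U U' hUU'
  show E U (fun z => G (act z U)) = E U' (fun z => G (act z U'))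
  rw [hE]
  congr 1
  funext z
  exact hG _ _ (hact z)

/-- **THE CAUCHY CURRENCY, END TO END ⇒ `TransportsFromVar`** (v1.1; §E's inputs with `hcont` DERIVED).  Per generation
`(b, k′)` and scale `k`: chart norms `Nk b k′ k` and regular base sets `𝒦 b k′ k` (scale-dependent — thin), gauge
relations `rel b k′ k`; the carried functions are `rel b k′ k`-invariant (`hinv`, [cell] O-β3-b / `gaugeInvariant_cont`).
AT BIRTH (under `RanBelow Gate k′`): a birth slice of the generated function, radius `r`, sup `gen b k′` [§5 format].
PER MET STEP `k → k+1` (under `RanBelow Gate (k+1)`): the continuation identity `hFn`; class membership `h𝒢`; the sup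
cost `a k` on differences at the regular real bases of scale `k+1` [(1.75) shape]; the centred operation's slices along
the chart in the norm `Nk b k′ (k+1)` with radius `ϱ b k′ k > 0` and sup `a k·m` [(1.65)/(1.75)-TYPE]; the [cell] action
binders from the scale-`(k+1)` raw pairs to the scale-`k` raw pairs with fluctuation-pair defect `0 ≤ ω b k′ k ≤ w`; the
DOMINATION `a k·(1 + 4·ω b k′ k/ϱ b k′ k) ≤ α k`.  SIZES: attained up to `ε` by responses to scale-`k` chart pairs
MODULO GAUGE of defect `defect b k′ k ≤ w`, `≤ c_δψ^{k−k′}`.  THEN `TransportsFromVar (4c_δ/r) (fun i => ψ·α i) Gate`.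
Inside: raw moduli propagate by `moduliAt_of_birth_cont_dep` from `respMod_raw_of_birthSlice` through
`cont_of_contStepLawOn_dep ∘ contStepLawOn_of_opSlice`; the gauge quotient enters once, at the attaining pair
(`respMod_chart_of_raw`).  Every analytic / geometric input a binder; nothing of B12/B13/B16 asserted. [folklore] -/
theorem transportsFromVar_of_opSlices {Z : Type*} {Gate : ℕ → Prop} {Fn : B.Birth → ℕ → ℕ → 𝒰 → F}
    {rel : B.Birth → ℕ → ℕ → 𝒰 → 𝒰 → Prop} {Nk : B.Birth → ℕ → ℕ → Dir → ℝ} {𝒦 : B.Birth → ℕ → ℕ → Set 𝒰}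
    {𝒢 : ℕ → Set (Z → F)} {E : ℕ → 𝒰 → (Z → F) → F} {act : ℕ → Z → 𝒰 → 𝒰} {D : ℕ → Set Z}
    {defect : B.Birth → ℕ → ℕ → ℝ} {cδ ψ : ℝ} {a α : ℕ → ℝ} {ϱ ω : B.Birth → ℕ → ℕ → ℝ}
    (hα : ∀ i, 0 ≤ α i) (hr : 0 < r) (hmove : ∀ U d, move U d 0 = U)
    (hsl : ∀ (b : B.Birth) (k' : ℕ), B.birthScale b ≤ k' → k' ≤ B.K → RanBelow Gate k' →
      BirthSlice (Fn b k' k') move (Nk b k' k') (𝒦 b k' k') w r (T.gen b k'))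
    (hFn : ∀ (b : B.Birth) (k' k : ℕ), B.birthScale b ≤ k' → k' ≤ k → k + 1 ≤ B.K → RanBelow Gate (k + 1) →
      ∀ U, Fn b k' (k + 1) U = E k U (fun z => Fn b k' k (act k z U)))
    (h𝒢 : ∀ (b : B.Birth) (k' k : ℕ), B.birthScale b ≤ k' → k' ≤ k → k + 1 ≤ B.K → RanBelow Gate (k + 1) →
      ∀ U, (fun z => Fn b k' k (act k z U)) ∈ 𝒢 k)
    (hD : ∀ k, (D k).Nonempty) (hϱ : ∀ b k' k, 0 < ϱ b k' k)
    (hsup : ∀ (b : B.Birth) (k' k : ℕ), B.birthScale b ≤ k' → k' ≤ k → k + 1 ≤ B.K → RanBelow Gate (k + 1) →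
      ∀ U₀ ∈ 𝒦 b k' (k + 1), ∀ g ∈ 𝒢 k, ∀ g' ∈ 𝒢 k, ∀ (m : ℝ), (∀ z ∈ D k, ‖g z - g' z‖ ≤ m) →
        ‖E k U₀ g - E k U₀ g'‖ ≤ a k * m)
    (hEsl : ∀ (b : B.Birth) (k' k : ℕ), B.birthScale b ≤ k' → k' ≤ k → k + 1 ≤ B.K → RanBelow Gate (k + 1) →
      ∀ g ∈ 𝒢 k, ∀ (c : F) (m : ℝ), (∀ z ∈ D k, ‖g z - c‖ ≤ m) →
        BirthSlice (fun U => E k U g - c) move (Nk b k' (k + 1)) (𝒦 b k' (k + 1)) w (ϱ b k' k) (a k * m))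
    (hcov : ∀ (b : B.Birth) (k' k : ℕ), B.birthScale b ≤ k' → k' ≤ k → k + 1 ≤ B.K → RanBelow Gate (k + 1) →
      ∀ (U₀ U₁ : 𝒰) (δ : ℝ), RawAdm move (Nk b k' (k + 1)) (𝒦 b k' (k + 1)) U₀ U₁ δ → ∀ z ∈ D k,
        RawAdm move (Nk b k' k) (𝒦 b k' k) (act k z U₀) (act k z U₁) δ)
    (hpair : ∀ (b : B.Birth) (k' k : ℕ), B.birthScale b ≤ k' → k' ≤ k → k + 1 ≤ B.K → RanBelow Gate (k + 1) →
      ∀ (U₀ U₁ : 𝒰) (δ : ℝ), RawAdm move (Nk b k' (k + 1)) (𝒦 b k' (k + 1)) U₀ U₁ δ → ∀ z ∈ D k, ∀ z' ∈ D k,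
        z ≠ z' → RawAdm move (Nk b k' k) (𝒦 b k' k) (act k z' U₁) (act k z U₁) (ω b k' k))
    (hω : ∀ b k' k, 0 ≤ ω b k' k ∧ ω b k' k ≤ w)
    (hdom : ∀ (b : B.Birth) (k' k : ℕ), B.birthScale b ≤ k' → k' ≤ k → k + 1 ≤ B.K →
      a k * (1 + 4 * ω b k' k / ϱ b k' k) ≤ α k)
    (hinv : ∀ b k' k, GaugeInvariant (rel b k' k) (Fn b k' k))
    (hdefw : ∀ b k' k, defect b k' k ≤ w)
    (hrate : ∀ (b : B.Birth) (k' k : ℕ), B.birthScale b ≤ k' → k' ≤ k → k ≤ B.K →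
      defect b k' k ≤ cδ * ψ ^ (k - k'))
    (hlin : ∀ (b : B.Birth) (k' k : ℕ), B.birthScale b ≤ k' → k' ≤ k → k ≤ B.K → RanBelow Gate k → ∀ ε > 0,
      ∃ U₀ ∈ 𝒦 b k' k, ∃ U₁ : 𝒰, RelGauge (rel b k' k) move (Nk b k' k) U₀ U₁ (defect b k' k) ∧
        T.lin b k' k ≤ ‖Fn b k' k U₁ - Fn b k' k U₀‖ + ε) :
    T.TransportsFromVar (4 * cδ / r) (fun i => ψ * α i) Gate := by
  have h := transportsFromVar_of_moduli_dep (T := T) (C₀ := 4 / r)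
    (Adm := fun b k' k => RawAdm move (Nk b k' k) (𝒦 b k' k)) (by positivity) hα
    (fun b k' hbk' hk hran =>
      (respMod_raw_of_birthSlice (hsl b k' hbk' hk hran) hmove hr (T.gen_nonneg b k')).congr_const (by ring))
    (cont_of_contStepLawOn_dep (Adm := fun b k' k => RawAdm move (Nk b k' k) (𝒦 b k' k)) (𝒢 := 𝒢) (D := D)
      (ℓ := fun b k' k => 4 * a k / ϱ b k' k) (ω := ω)
      (fun b k' k U₀ U₁ δ hadm => rawAdm_nonneg hadm) hFn h𝒢
      (fun b k' k hbk' hk'k hk hran => contStepLawOn_of_opSlice (hD k) (hϱ b k' k) hmove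
        (hsup b k' k hbk' hk'k hk hran) (hEsl b k' k hbk' hk'k hk hran) (hcov b k' k hbk' hk'k hk hran)
        (hpair b k' k hbk' hk'k hk hran) (hω b k' k).1 (hω b k' k).2)
      (fun b k' k hbk' hk'k hk => by
        show a k + 4 * a k / ϱ b k' k * ω b k' k ≤ α k
        rw [stepFactor_eq]
        exact hdom b k' k hbk' hk'k hk))
    hdefw hrate
    (fun b k' k hbk' hk'k hk hran ε hε => by
      obtain ⟨U₀, hU₀, U₁, ⟨dd, hd, hdδ, hrel⟩, hle⟩ := hlin b k' k hbk' hk'k hk hran ε hε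
      refine ⟨U₀, move U₀ dd 1, ⟨hU₀, dd, hd, hdδ, rfl⟩, ?_⟩
      rwa [hinv b k' k _ _ hrel] at hle)
  have e : 4 / r * cδ = 4 * cδ / r := by ring
  rw [e] at h
  exact h

end CauchySupplier

/-! #### §H, non-vacuity of the analytic binder `hEsl` (toy) -/

section OpSliceToy

open Set Metric
open T4BirthChartTransport (BirthSlice)

variable {F : Type*} [NormedAddCommGroup F] [NormedSpace ℂ F] [CompleteSpace F]

/-- NON-VACUITY of the Cauchy supplier's analytic binder `hEsl` — a toy with GENUINE background dependence: backgrounds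
`U ∈ ℂ`, the affine chart `move U d t = U + t·d`, `N d = ‖d‖`, regular bases `‖U‖ ≤ R₀`, and the normalised linear
two-point operation `E U g = g z₀ + U • (g z₁ − g z₀)` (`E U const = const`).  For `‖g − c‖ ≤ m` on `D ∋ z₀, z₁` the
centred operation `U ↦ E U g − c` has a slice of ANY radius `ϱ` inside ANY window `w` with sup `(1 + 2(R₀ + w + ϱ))·m`
— so `bgLip_of_opSlice` applies with `ℓ = 4(1 + 2(R₀ + w + ϱ))/ϱ`, `ϱ > 0` free (the exact constant here is `ℓ = 1`:
Cauchy is not sharp, only uniform; nothing of Bałaban's operations is modelled). [folklore] -/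
example {Z : Type*} (z₀ z₁ : Z) {D : Set Z} (h₀ : z₀ ∈ D) (h₁ : z₁ ∈ D) {R₀ w ϱ : ℝ} :
    ∀ (g : Z → F) (c : F) (m : ℝ), (∀ z ∈ D, ‖g z - c‖ ≤ m) →
      BirthSlice (fun U : ℂ => (g z₀ + U • (g z₁ - g z₀)) - c) (fun U d t => U + t * d) (fun d : ℂ => ‖d‖)
        (closedBall (0 : ℂ) R₀) w ϱ ((1 + 2 * (R₀ + w + ϱ)) * m) := by
  intro g c m hm U hU d hd hdw
  have hm0 : 0 ≤ m := (norm_nonneg _).trans (hm z₀ h₀)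
  have hU' : ‖U‖ ≤ R₀ := mem_closedBall_zero_iff.mp hU
  refine ⟨closedBall (0 : ℂ) (1 + ϱ / ‖d‖), ?_, ?_, ?_⟩
  · exact (by fun_prop : Differentiable ℂ fun t : ℂ => (g z₀ + (U + t * d) • (g z₁ - g z₀)) - c).differentiableOn
  · intro t ht
    have ht' : ‖t‖ ≤ 1 + ϱ / ‖d‖ := mem_closedBall_zero_iff.mp ht
    have htd : ‖t * d‖ ≤ ‖d‖ + ϱ := by
      rw [norm_mul]
      calc ‖t‖ * ‖d‖ ≤ (1 + ϱ / ‖d‖) * ‖d‖ := mul_le_mul_of_nonneg_right ht' (norm_nonneg _)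
        _ = ‖d‖ + ϱ := by field_simp
    have hUt : ‖U + t * d‖ ≤ R₀ + w + ϱ :=
      (norm_add_le _ _).trans (by linarith)
    have hosc : ‖g z₁ - g z₀‖ ≤ 2 * m := by
      calc ‖g z₁ - g z₀‖ = ‖(g z₁ - c) - (g z₀ - c)‖ := by rw [sub_sub_sub_cancel_right]
        _ ≤ ‖g z₁ - c‖ + ‖g z₀ - c‖ := norm_sub_le _ _
        _ ≤ 2 * m := by linarith [hm z₁ h₁, hm z₀ h₀]
    calc ‖g z₀ + (U + t * d) • (g z₁ - g z₀) - c‖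
        = ‖(g z₀ - c) + (U + t * d) • (g z₁ - g z₀)‖ := by congr 1; abel
      _ ≤ ‖g z₀ - c‖ + ‖(U + t * d) • (g z₁ - g z₀)‖ := norm_add_le _ _
      _ ≤ m + (R₀ + w + ϱ) * (2 * m) := by
          rw [norm_smul]
          exact add_le_add (hm z₀ h₀) (mul_le_mul hUt hosc (norm_nonneg _) (by linarith [norm_nonneg (U + t * d)]))
      _ = (1 + 2 * (R₀ + w + ϱ)) * m := by ring
  · intro s hs t ht
    rw [mem_closedBall, dist_eq_norm] at ht
    rw [mem_closedBall_zero_iff]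
    have hs1 : ‖(s : ℂ)‖ ≤ 1 := by
      rw [Complex.norm_real, Real.norm_eq_abs, abs_of_nonneg hs.1]; exact hs.2
    calc ‖t‖ = ‖(t - s) + s‖ := by rw [sub_add_cancel]
      _ ≤ ‖t - (s : ℂ)‖ + ‖(s : ℂ)‖ := norm_add_le _ _
      _ ≤ 1 + ϱ / ‖d‖ := by linarith

end OpSliceToy

/-! ### §I Consistency — §14 recovered through §B (XREAD C-pv10-97, INFO I2; pv10-g19's window twin, credited) -/

section WindowRecovery

open T4BirthChartTransport (GaugeInvariant BirthSlice)
open T4RelativeLadder (UnitaryLike)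
open T4RelativeComb (Cfg)
open T4BlockTransport (Fld val BlockRel)
open T4CombHolderWindow (Win winN WindowData wMove wN blockDev)

variable {B : Booking} {T : Trajectory B}
variable {R : Type*} [NormedRing R] [NormedAlgebra ℂ R] {d : ℕ}
  {F : Type*} [NormedAddCommGroup F] [NormedSpace ℂ F] [CompleteSpace F]

/-- CONSISTENCY (§14 ⇒ §D, window twin of `moduliAt_of_sliceFormat`; statement and proof after pv10-g19's
`xread2/TwinC.lean` §(C2c) 2d9a13b0a07159ad, CREDITED): §14's slice format — window birth slices of EVERY carried
function — gives the window moduli `4/r·(∏α)·gen b k′` at every scale (`respMod_of_windowSlice` at every `k`).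
[folklore] -/
theorem moduliAt_of_windowSliceFormat {Gate : ℕ → Prop} {Fn : B.Birth → ℕ → ℕ → Fld d R → F}
    {Lg : B.Birth → ℕ → ℕ} {zg : B.Birth → ℕ → T4BlockTransport.Site d} {𝒦 : B.Birth → ℕ → Set (Fld d R)}
    {β : ℝ} {κ : Win} {w r : ℝ} {α : ℕ → ℝ} (hα : ∀ i, 0 ≤ α i)
    (hinv : ∀ b k' k, GaugeInvariant (BlockRel (Lg b k') (zg b k')) (Fn b k' k))
    (hsl : ∀ (b : B.Birth) (k' k : ℕ), B.birthScale b ≤ k' → k' ≤ k → k ≤ B.K → RanBelow Gate k →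
      BirthSlice (Fn b k' k) (wMove (Lg b k') (zg b k') β) (wN (Lg b k') (zg b k') β κ) (𝒦 b k') w r
        (stepProd α k' k * T.gen b k'))
    (hκ : κ.Pos) (hr : 0 < r) :
    ∀ (b : B.Birth) (k' k : ℕ), B.birthScale b ≤ k' → k' ≤ k → k ≤ B.K → RanBelow Gate k →
      RespMod (Fn b k' k) (WindowAdm (Lg b k') (zg b k') β κ (𝒦 b k')) w (4 / r * stepProd α k' k * T.gen b k') :=
  fun b k' k hbk' hk'k hk hran =>
    (respMod_of_windowSlice (hinv b k' k) (hsl b k' k hbk' hk'k hk hran) hκ hr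
      (mul_nonneg (stepProd_nonneg hα _ _) (T.gen_nonneg b k'))).congr_const (by ring)

/-- CONSISTENCY (the window twin of §D's closing chart `example`, after pv10-g19's `window_recovered`, CREDITED): §14's
`transportsFromVar_of_window` CONCLUSION re-derived from §14's OWN hypotheses through §B
(`moduliAt_of_windowSliceFormat` ∘ `transportsFromVar_of_moduliAt`) — the same statement §14 proves by name, so no
drift between the slice and the modulus currencies in the printed window chart either. [folklore] -/
example {Gate : ℕ → Prop} {Fn : B.Birth → ℕ → ℕ → Fld d R → F}
    {Lg : B.Birth → ℕ → ℕ} {zg : B.Birth → ℕ → T4BlockTransport.Site d} {𝒦 : B.Birth → ℕ → Set (Fld d R)}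
    {β : ℝ} {κ : Win} {w r cδ ψ : ℝ} {α : ℕ → ℝ} (hα : ∀ i, 0 ≤ α i)
    (hinv : ∀ b k' k, GaugeInvariant (BlockRel (Lg b k') (zg b k')) (Fn b k' k))
    (hsl : ∀ (b : B.Birth) (k' k : ℕ), B.birthScale b ≤ k' → k' ≤ k → k ≤ B.K → RanBelow Gate k →
      BirthSlice (Fn b k' k) (wMove (Lg b k') (zg b k') β) (wN (Lg b k') (zg b k') β κ) (𝒦 b k') w r
        (stepProd α k' k * T.gen b k'))
    (hκ : κ.Pos) (hr : 0 < r) (hψ : 0 ≤ ψ) (hψ1 : ψ ≤ 1) (hcδ : 0 ≤ cδ) (hw : cδ ≤ w)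
    (hlin : ∀ (b : B.Birth) (k' k : ℕ), B.birthScale b ≤ k' → k' ≤ k → k ≤ B.K → RanBelow Gate k → ∀ ε > 0,
      ∃ U₀ U₁ : Cfg d R, ∃ g : T4BlockTransport.Site d → Rˣ, ∃ bw : Win,
        val U₀ ∈ 𝒦 b k' ∧ (∀ x, UnitaryLike (g x)) ∧
        WindowData (Lg b k') (zg b k') β (blockDev (Lg b k') (zg b k') g U₀ U₁) bw ∧
        winN κ bw ≤ cδ * ψ ^ (k - k') ∧
        T.lin b k' k ≤ ‖Fn b k' k (val U₁) - Fn b k' k (val U₀)‖ + ε) :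
    T.TransportsFromVar (4 * cδ / r) (fun i => ψ * α i) Gate := by
  have h := transportsFromVar_of_moduliAt (T := T) (C₀ := 4 / r)
    (Adm := fun b k' => WindowAdm (Lg b k') (zg b k') β κ (𝒦 b k')) (defect := fun b k' k => cδ * ψ ^ (k - k'))
    (by positivity) hα (moduliAt_of_windowSliceFormat hα hinv hsl hκ hr)
    (fun b k' k => (mul_le_of_le_one_right hcδ (pow_le_one₀ hψ hψ1)).trans hw)
    (fun b k' k _ _ _ => le_rfl)
    (fun b k' k hbk' hk'k hk hran ε hε => by
      obtain ⟨U₀, U₁, g, bw, hU₀𝒦, hg, hW, hbw, hle⟩ := hlin b k' k hbk' hk'k hk hran ε hε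
      exact ⟨val U₀, val U₁, ⟨U₀, U₁, g, bw, rfl, rfl, hU₀𝒦, hg, hW, hbw⟩, hle⟩)
  have e : 4 / r * cδ = 4 * cδ / r := by ring
  rw [e] at h
  exact h

end WindowRecovery

/-! ### §J The linear-operation supplier of `hsup` / `hEsl`: subtractive, normalised operations and their operator slice -/

section LinearSupplier

open T4BirthChartTransport (GaugeInvariant BirthSlice RelGauge slice_bound norm_base_le)

variable {B : Booking} {T : Trajectory B}
variable {𝒰 Dir F : Type*} [NormedAddCommGroup F] [NormedSpace ℂ F] [CompleteSpace F]
  {move : 𝒰 → Dir → ℂ → 𝒰} {N : Dir → ℝ} {w r : ℝ}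

/-- FORMAT — THE OPERATOR SLICE of a one-step operation `E` along the chart at the regular bases `𝒦`: EVERY integrand
`h` bounded by `m` on `D` has the slice `BirthSlice (fun U => E U h) move N 𝒦 w ϱ (a·m)` — analyticity of
`t ↦ E (move U d t) h` on the radius-`ϱ/N d` neighbourhood of `[0,1]` with sup `a·m` there (an operator-norm bound `a`
of `E U′` w.r.t. the sup-over-`D` seminorm, UNIFORM over the complex window).  [printed TYPE, cell dictionary, NOT
asserted: (1.65) p. 375 / (R-ext) analyticity of the step's densities on `Ũ^c_k`; (1.75) p. 380 ON that window.]
[folklore] -/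
def OpSlice {Z : Type*} (E : 𝒰 → (Z → F) → F) (D : Set Z) (move : 𝒰 → Dir → ℂ → 𝒰) (N : Dir → ℝ) (𝒦 : Set 𝒰)
    (w ϱ a : ℝ) : Prop :=
  ∀ (h : Z → F) (m : ℝ), (∀ z ∈ D, ‖h z‖ ≤ m) → BirthSlice (fun U => E U h) move N 𝒦 w ϱ (a * m)

omit [CompleteSpace F] in
/-- `OpSlice` is antitone in the base set and monotone in the constant (for nonnegative sups). [folklore] -/
theorem OpSlice.anti {Z : Type*} {E : 𝒰 → (Z → F) → F} {D : Set Z} {𝒦 𝒦' : Set 𝒰} {ϱ a : ℝ}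
    (h : OpSlice E D move N 𝒦 w ϱ a) (h𝒦 : 𝒦' ⊆ 𝒦) : OpSlice E D move N 𝒦' w ϱ a :=
  fun g m hm U hU d hd hdw => h g m hm U (h𝒦 hU) d hd hdw

omit [CompleteSpace F] in
/-- **THE CENTRED SLICE FROM THE OPERATOR SLICE.**  If `E U` is SUBTRACTIVE (`E U (g − g′) = E U g − E U g′`, the
shape of an integral operation) and NORMALISED (`E U (const c) = c`; «the T′_k-operations are normalized» p. 391 — cell
dictionary), then §H's binder `hEsl` holds: `‖g − c‖ ≤ m` on `D` ⇒ `BirthSlice (fun U => E U g − c) … (a·m)`, because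
`E U g − c = E U (g − const c)`. [folklore] -/
theorem opSlice_centred {Z : Type*} {𝒢 : Set (Z → F)} {E : 𝒰 → (Z → F) → F} {D : Set Z} {𝒦 : Set 𝒰} {ϱ a : ℝ}
    (hsub : ∀ (U : 𝒰) (g g' : Z → F), E U (g - g') = E U g - E U g')
    (hnorm : ∀ (U : 𝒰) (c : F), E U (fun _ => c) = c) (hop : OpSlice E D move N 𝒦 w ϱ a) :
    ∀ g ∈ 𝒢, ∀ (c : F) (m : ℝ), (∀ z ∈ D, ‖g z - c‖ ≤ m) → BirthSlice (fun U => E U g - c) move N 𝒦 w ϱ (a * m) := by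
  intro g _ c m hm
  have e : (fun U => E U g - c) = fun U => E U (g - fun _ => c) := by
    funext U
    rw [hsub, hnorm]
  rw [e]
  exact hop _ m fun z hz => by simpa using hm z hz

omit [CompleteSpace F] in
/-- **THE SUP COST FROM THE OPERATOR SLICE AT `t = 0`.**  Subtractivity + the operator slice + ONE admissible direction
(`0 < N d ≤ w`, so that the base `U₀ = move U₀ d 0` lies in a slice domain) give §H's binder `hsup` with the same `a`
(`T4BirthChartTransport.norm_base_le` BY NAME). [folklore] -/
theorem supCost_of_opSlice {Z : Type*} {𝒢 : Set (Z → F)} {E : 𝒰 → (Z → F) → F} {D : Set Z} {𝒦 : Set 𝒰} {ϱ a : ℝ}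
    (hsub : ∀ (U : 𝒰) (g g' : Z → F), E U (g - g') = E U g - E U g') (hop : OpSlice E D move N 𝒦 w ϱ a)
    (hmove : ∀ U d, move U d 0 = U) (hϱ : 0 ≤ ϱ) (hdir : ∃ d : Dir, 0 < N d ∧ N d ≤ w) :
    ∀ U₀ ∈ 𝒦, ∀ g ∈ 𝒢, ∀ g' ∈ 𝒢, ∀ (m : ℝ), (∀ z ∈ D, ‖g z - g' z‖ ≤ m) → ‖E U₀ g - E U₀ g'‖ ≤ a * m := by
  intro U₀ hU₀ g _ g' _ m hm
  obtain ⟨d, hd, hdw⟩ := hdir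
  rw [← hsub]
  exact norm_base_le (Fn := fun U => E U (g - g')) (hop _ m fun z hz => by simpa using hm z hz) hmove hϱ hU₀ hd hdw

/-- **THE STEP LAW FROM A NORMALISED LINEAR OPERATION'S OPERATOR SLICE** (§H `contStepLawOn_of_opSlice` with BOTH
analytic binders derived): subtractive + normalised `E`, its operator slice (radius `ϱ`, bound `a`), one admissible
direction, the two [cell] action binders of §C on the raw pairs, `0 ≤ ω ≤ w` ⇒
`ContStepLawOn 𝒢 E act D (RawAdm move N 𝒦) Adm′ w a (4a/ϱ) ω`. [folklore] -/
theorem contStepLawOn_of_linearOpSlice {Z : Type*} {𝒢 : Set (Z → F)} {E : 𝒰 → (Z → F) → F} {act : Z → 𝒰 → 𝒰}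
    {D : Set Z} {𝒦 : Set 𝒰} {Adm' : 𝒰 → 𝒰 → ℝ → Prop} {ϱ a ω : ℝ}
    (hD : D.Nonempty) (hϱ : 0 < ϱ) (hmove : ∀ U d, move U d 0 = U) (hdir : ∃ d : Dir, 0 < N d ∧ N d ≤ w)
    (hsub : ∀ (U : 𝒰) (g g' : Z → F), E U (g - g') = E U g - E U g')
    (hnorm : ∀ (U : 𝒰) (c : F), E U (fun _ => c) = c) (hop : OpSlice E D move N 𝒦 w ϱ a)
    (hcov : ∀ (U₀ U₁ : 𝒰) (δ : ℝ), RawAdm move N 𝒦 U₀ U₁ δ → ∀ z ∈ D, Adm' (act z U₀) (act z U₁) δ)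
    (hpair : ∀ (U₀ U₁ : 𝒰) (δ : ℝ), RawAdm move N 𝒦 U₀ U₁ δ → ∀ z ∈ D, ∀ z' ∈ D, z ≠ z' →
      Adm' (act z' U₁) (act z U₁) ω)
    (hω0 : 0 ≤ ω) (hωw : ω ≤ w) :
    ContStepLawOn 𝒢 E act D (RawAdm move N 𝒦) Adm' w a (4 * a / ϱ) ω :=
  contStepLawOn_of_opSlice hD hϱ hmove (supCost_of_opSlice (𝒢 := 𝒢) hsub hop hmove hϱ.le hdir)
    (opSlice_centred (𝒢 := 𝒢) hsub hnorm hop) hcov hpair hω0 hωw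

omit [CompleteSpace F] in
/-- The operator bound is at least `1` («v1.3» DOCFIX, XREAD C-ref5-179 INFO 1: v1.2's docstring said «nonnegative»; the
statement is unchanged) as soon as the window has a regular base, an admissible direction and a nonzero
test value (normalisation: `‖c‖ = ‖E U₀ (const c)‖ ≤ a·‖c‖`). [arith] [folklore] -/
theorem opSlice_const_nonneg {Z : Type*} {E : 𝒰 → (Z → F) → F} {D : Set Z} {𝒦 : Set 𝒰} {ϱ a : ℝ}
    (hnorm : ∀ (U : 𝒰) (c : F), E U (fun _ => c) = c) (hop : OpSlice E D move N 𝒦 w ϱ a)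
    (hmove : ∀ U d, move U d 0 = U) (hϱ : 0 ≤ ϱ) {U₀ : 𝒰} (hU₀ : U₀ ∈ 𝒦) (hdir : ∃ d : Dir, 0 < N d ∧ N d ≤ w)
    {c : F} (hc : c ≠ 0) : 1 ≤ a := by
  obtain ⟨d, hd, hdw⟩ := hdir
  have h := norm_base_le (Fn := fun U => E U fun _ => c) (hop (fun _ => c) ‖c‖ fun z _ => le_rfl) hmove hϱ hU₀ hd hdw
  simp only [hnorm] at h
  have hc' : 0 < ‖c‖ := norm_pos_iff.mpr hc
  nlinarith

/-- **THE PIPELINE FROM NORMALISED LINEAR OPERATIONS' OPERATOR SLICES** — §H `transportsFromVar_of_opSlices` with its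
two analytic binders `hsup`/`hEsl` DERIVED per met step from: `hsub`/`hnorm` (the step-`k` operation is subtractive and
normalised — [cell]; «the T′_k-operations are normalized» p. 391), `hop` (its operator slice at the scale-`(k+1)` regular
bases: radius `ϱ b k′ k`, bound `a k` — (1.65) p. 375 / (1.75) p. 380 TYPE, NOT asserted), `hdir` (one admissible
direction of the scale-`(k+1)` chart).  Everything else — birth slices `hsl`, the functional recursion `hFn`/`h𝒢`, the
chart geometry `hcov`/`hpair`, `ω`, the domination `a k·(1 + 4ω/ϱ) ≤ α k`, invariance, defects, attainment — is
VERBATIM §H's.  Conclusion `T.TransportsFromVar (4cδ/r) (fun i => ψ·α i) Gate`. [folklore] -/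
theorem transportsFromVar_of_linearOpSlices {Z : Type*} {Gate : ℕ → Prop} {Fn : B.Birth → ℕ → ℕ → 𝒰 → F}
    {rel : B.Birth → ℕ → ℕ → 𝒰 → 𝒰 → Prop} {Nk : B.Birth → ℕ → ℕ → Dir → ℝ} {𝒦 : B.Birth → ℕ → ℕ → Set 𝒰}
    {𝒢 : ℕ → Set (Z → F)} {E : ℕ → 𝒰 → (Z → F) → F} {act : ℕ → Z → 𝒰 → 𝒰} {D : ℕ → Set Z}
    {defect : B.Birth → ℕ → ℕ → ℝ} {cδ ψ : ℝ} {a α : ℕ → ℝ} {ϱ ω : B.Birth → ℕ → ℕ → ℝ}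
    (hα : ∀ i, 0 ≤ α i) (hr : 0 < r) (hmove : ∀ U d, move U d 0 = U)
    (hsl : ∀ (b : B.Birth) (k' : ℕ), B.birthScale b ≤ k' → k' ≤ B.K → RanBelow Gate k' →
      BirthSlice (Fn b k' k') move (Nk b k' k') (𝒦 b k' k') w r (T.gen b k'))
    (hFn : ∀ (b : B.Birth) (k' k : ℕ), B.birthScale b ≤ k' → k' ≤ k → k + 1 ≤ B.K → RanBelow Gate (k + 1) →
      ∀ U, Fn b k' (k + 1) U = E k U (fun z => Fn b k' k (act k z U)))
    (h𝒢 : ∀ (b : B.Birth) (k' k : ℕ), B.birthScale b ≤ k' → k' ≤ k → k + 1 ≤ B.K → RanBelow Gate (k + 1) →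
      ∀ U, (fun z => Fn b k' k (act k z U)) ∈ 𝒢 k)
    (hD : ∀ k, (D k).Nonempty) (hϱ : ∀ b k' k, 0 < ϱ b k' k)
    (hsub : ∀ (k : ℕ) (U : 𝒰) (g g' : Z → F), E k U (g - g') = E k U g - E k U g')
    (hnorm : ∀ (k : ℕ) (U : 𝒰) (c : F), E k U (fun _ => c) = c)
    (hop : ∀ (b : B.Birth) (k' k : ℕ), B.birthScale b ≤ k' → k' ≤ k → k + 1 ≤ B.K → RanBelow Gate (k + 1) →
      OpSlice (E k) (D k) move (Nk b k' (k + 1)) (𝒦 b k' (k + 1)) w (ϱ b k' k) (a k))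
    (hdir : ∀ (b : B.Birth) (k' k : ℕ), B.birthScale b ≤ k' → k' ≤ k → k + 1 ≤ B.K →
      ∃ d : Dir, 0 < Nk b k' (k + 1) d ∧ Nk b k' (k + 1) d ≤ w)
    (hcov : ∀ (b : B.Birth) (k' k : ℕ), B.birthScale b ≤ k' → k' ≤ k → k + 1 ≤ B.K → RanBelow Gate (k + 1) →
      ∀ (U₀ U₁ : 𝒰) (δ : ℝ), RawAdm move (Nk b k' (k + 1)) (𝒦 b k' (k + 1)) U₀ U₁ δ → ∀ z ∈ D k,
        RawAdm move (Nk b k' k) (𝒦 b k' k) (act k z U₀) (act k z U₁) δ)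
    (hpair : ∀ (b : B.Birth) (k' k : ℕ), B.birthScale b ≤ k' → k' ≤ k → k + 1 ≤ B.K → RanBelow Gate (k + 1) →
      ∀ (U₀ U₁ : 𝒰) (δ : ℝ), RawAdm move (Nk b k' (k + 1)) (𝒦 b k' (k + 1)) U₀ U₁ δ → ∀ z ∈ D k, ∀ z' ∈ D k,
        z ≠ z' → RawAdm move (Nk b k' k) (𝒦 b k' k) (act k z' U₁) (act k z U₁) (ω b k' k))
    (hω : ∀ b k' k, 0 ≤ ω b k' k ∧ ω b k' k ≤ w)
    (hdom : ∀ (b : B.Birth) (k' k : ℕ), B.birthScale b ≤ k' → k' ≤ k → k + 1 ≤ B.K →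
      a k * (1 + 4 * ω b k' k / ϱ b k' k) ≤ α k)
    (hinv : ∀ b k' k, GaugeInvariant (rel b k' k) (Fn b k' k))
    (hdefw : ∀ b k' k, defect b k' k ≤ w)
    (hrate : ∀ (b : B.Birth) (k' k : ℕ), B.birthScale b ≤ k' → k' ≤ k → k ≤ B.K →
      defect b k' k ≤ cδ * ψ ^ (k - k'))
    (hlin : ∀ (b : B.Birth) (k' k : ℕ), B.birthScale b ≤ k' → k' ≤ k → k ≤ B.K → RanBelow Gate k → ∀ ε > 0,
      ∃ U₀ ∈ 𝒦 b k' k, ∃ U₁ : 𝒰, RelGauge (rel b k' k) move (Nk b k' k) U₀ U₁ (defect b k' k) ∧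
        T.lin b k' k ≤ ‖Fn b k' k U₁ - Fn b k' k U₀‖ + ε) :
    T.TransportsFromVar (4 * cδ / r) (fun i => ψ * α i) Gate :=
  transportsFromVar_of_opSlices hα hr hmove hsl hFn h𝒢 hD hϱ
    (fun b k' k hbk' hk'k hk hran =>
      supCost_of_opSlice (𝒢 := 𝒢 k) (hsub k) (hop b k' k hbk' hk'k hk hran) hmove (hϱ b k' k).le
        (hdir b k' k hbk' hk'k hk))
    (fun b k' k hbk' hk'k hk hran => opSlice_centred (𝒢 := 𝒢 k) (hsub k) (hnorm k) (hop b k' k hbk' hk'k hk hran))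
    hcov hpair hω hdom hinv hdefw hrate hlin

end LinearSupplier

/-! #### §J, non-vacuity (toy): the evaluation-average operation is subtractive, normalised, and has an operator slice -/

section LinearToy

open Set Metric
open T4BirthChartTransport (BirthSlice)

variable {F : Type*} [NormedAddCommGroup F] [NormedSpace ℂ F] [CompleteSpace F]

/-- Toy: `𝒰 = ℂ`, `Z = Unit`, `E U h = h ()` (no background dependence): subtractive, normalised, and with the operator
slice `a = 1` on every window / radius (entire; the sup is the bound itself).  §H's toy is the one with genuine background
dependence; this one only shows the three §J binders jointly satisfiable. -/
example (w ϱ : ℝ) :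
    OpSlice (𝒰 := ℂ) (Dir := Unit) (E := fun (_ : ℂ) (h : Unit → F) => h ()) (Set.univ : Set Unit)
      (fun U _ t => U + t) (fun _ => w) (Set.univ : Set ℂ) w ϱ 1 := by
  intro h m hm U _ d _ _
  refine ⟨Set.univ, ?_, ?_, fun _ _ => Set.subset_univ _⟩
  · exact differentiableOn_const _
  · intro t _
    simpa using hm () (Set.mem_univ _)

end LinearToy

/-! ### §K The window guard on the action binders; the lattice geometry instance (v1.3) -/

section WindowGuard

open T4BirthChartTransport (GaugeInvariant BirthSlice RelGauge slice_bound norm_base_le)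

variable {B : Booking} {T : Trajectory B}
variable {𝒰 Dir F : Type*} [NormedAddCommGroup F] [NormedSpace ℂ F] [CompleteSpace F]
  {move : 𝒰 → Dir → ℂ → 𝒰} {N : Dir → ℝ} {w r : ℝ}

/-- The WINDOWED admissible pairs: `Adm`-pairs whose defect bound lies in the window, `δ ≤ w`.  `RespMod` only ever
tests pairs with `δ ≤ w`, so windowing the admissibility changes NO modulus (`respMod_windowed_iff`); it only restricts
the pairs over which §C/§F's two ACTION binders `covariant`/`fluctPair` are demanded — which is the point of §K.
[folklore] -/
def Windowed (Adm : 𝒰 → 𝒰 → ℝ → Prop) (w : ℝ) : 𝒰 → 𝒰 → ℝ → Prop :=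
  fun U₀ U₁ δ => Adm U₀ U₁ δ ∧ δ ≤ w

omit [NormedSpace ℂ F] [CompleteSpace F] in
/-- Windowing the admissible pairs changes no modulus. [arith] [folklore] -/
theorem respMod_windowed_iff {G : 𝒰 → F} {Adm : 𝒰 → 𝒰 → ℝ → Prop} {M : ℝ} :
    RespMod G (Windowed Adm w) w M ↔ RespMod G Adm w M :=
  ⟨fun h U₀ U₁ δ hadm hδ => h U₀ U₁ δ ⟨hadm, hδ⟩ hδ, fun h => h.of_imp fun _ _ _ hadm => hadm.1⟩

/-- Windowed defects inherit non-negativity. [arith] [folklore] -/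
theorem windowed_nonneg {Adm : 𝒰 → 𝒰 → ℝ → Prop} (hAdm : ∀ U₀ U₁ δ, Adm U₀ U₁ δ → 0 ≤ δ) :
    ∀ (U₀ U₁ : 𝒰) (δ : ℝ), Windowed Adm w U₀ U₁ δ → 0 ≤ δ :=
  fun U₀ U₁ δ h => hAdm U₀ U₁ δ h.1

/-- **WHY THE GUARD** (negative witness, abstract).  §C/§F demand `fluctPair` — and §H/§J their `hpair` — for EVERY
admissible pair `(U₀, U₁, δ)`, with NO bound on `δ`, although `respMod_continue` uses them only under `δ ≤ w`.  On the
raw chart pairs this is over-demanding: as soon as the upper base set has a point `U₀` and the fluctuation domain two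
distinct points, the unguarded binder puts `act z' U₁` into the LOWER base set `𝒦` for the endpoint `U₁ = move U₀ d 1`
of EVERY direction `d` of positive norm, however large — so `𝒦` must contain the `act z'`-image of everything the chart
reaches from `U₀`.  (Landed §H/§J theorems are correct but, fed with Bałaban-type data, only vacuously applicable below
the top scale: see `lattice_base_of_hpair_unguarded`.)  [folklore] -/
theorem base_of_hpair_unguarded {Z : Type*} {act : Z → 𝒰 → 𝒰} {D : Set Z} {𝒦' 𝒦 : Set 𝒰} {N' : Dir → ℝ}
    {ω : ℝ}
    (hpair : ∀ (U₀ U₁ : 𝒰) (δ : ℝ), RawAdm move N' 𝒦' U₀ U₁ δ → ∀ z ∈ D, ∀ z' ∈ D, z ≠ z' →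
      RawAdm move N 𝒦 (act z' U₁) (act z U₁) ω)
    {U₀ : 𝒰} (hU₀ : U₀ ∈ 𝒦') {z z' : Z} (hz : z ∈ D) (hz' : z' ∈ D) (hzz : z ≠ z') (d : Dir) (hd : 0 < N' d) :
    act z' (move U₀ d 1) ∈ 𝒦 :=
  (hpair U₀ (move U₀ d 1) (N' d) ⟨hU₀, d, hd, le_rfl, rfl⟩ z hz z' hz' hzz).1

/-- **THE STEP LAW FROM THE OPERATION'S SLICES, WINDOW-GUARDED** (§H `contStepLawOn_of_opSlice` re-cut; nothing landed
is modified): the two [cell] action binders are asked ONLY for raw pairs of defect `δ ≤ w` — `hcov`: composing both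
members with one fluctuation of `D` gives an `Adm′`-pair of the same defect; `hpair`: two distinct fluctuations over the
endpoint give an `Adm′`-pair of defect `ω` — and the law is concluded on the WINDOWED raw pairs
`Windowed (RawAdm move N 𝒦) w`.  `hsup`/`hEsl` exactly as in §H. [folklore] -/
theorem contStepLawOn_of_opSlice_windowed {Z : Type*} {𝒢 : Set (Z → F)} {E : 𝒰 → (Z → F) → F}
    {act : Z → 𝒰 → 𝒰} {D : Set Z} {𝒦 : Set 𝒰} {Adm' : 𝒰 → 𝒰 → ℝ → Prop} {ϱ a ω : ℝ}
    (hD : D.Nonempty) (hϱ : 0 < ϱ) (hmove : ∀ U d, move U d 0 = U)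
    (hsup : ∀ U₀ ∈ 𝒦, ∀ g ∈ 𝒢, ∀ g' ∈ 𝒢, ∀ (m : ℝ), (∀ z ∈ D, ‖g z - g' z‖ ≤ m) → ‖E U₀ g - E U₀ g'‖ ≤ a * m)
    (hEsl : ∀ g ∈ 𝒢, ∀ (c : F) (m : ℝ), (∀ z ∈ D, ‖g z - c‖ ≤ m) →
      BirthSlice (fun U => E U g - c) move N 𝒦 w ϱ (a * m))
    (hcov : ∀ (U₀ U₁ : 𝒰) (δ : ℝ), RawAdm move N 𝒦 U₀ U₁ δ → δ ≤ w → ∀ z ∈ D, Adm' (act z U₀) (act z U₁) δ)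
    (hpair : ∀ (U₀ U₁ : 𝒰) (δ : ℝ), RawAdm move N 𝒦 U₀ U₁ δ → δ ≤ w → ∀ z ∈ D, ∀ z' ∈ D, z ≠ z' →
      Adm' (act z' U₁) (act z U₁) ω)
    (hω0 : 0 ≤ ω) (hωw : ω ≤ w) :
    ContStepLawOn 𝒢 E act D (Windowed (RawAdm move N 𝒦) w) Adm' w a (4 * a / ϱ) ω where
  supCost := fun U₀ _ _ hadm _ g hg g' hg' m hm => hsup U₀ hadm.1.1 g hg g' hg' m hm
  bgLip := fun U₀ U₁ δ hadm hδ => bgLip_of_opSlice hD hϱ hmove hEsl U₀ U₁ δ hadm.1 hδ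
  covariant := fun U₀ U₁ δ hadm => hcov U₀ U₁ δ hadm.1 hadm.2
  fluctPair := fun U₀ U₁ δ hadm => hpair U₀ U₁ δ hadm.1 hadm.2
  ω_nonneg := hω0
  ω_le := hωw

/-- **THE STEP LAW FROM A NORMALISED LINEAR OPERATION'S OPERATOR SLICE, WINDOW-GUARDED** (§J
`contStepLawOn_of_linearOpSlice` re-cut with the guarded action binders). [folklore] -/
theorem contStepLawOn_of_linearOpSlice_windowed {Z : Type*} {𝒢 : Set (Z → F)} {E : 𝒰 → (Z → F) → F}
    {act : Z → 𝒰 → 𝒰} {D : Set Z} {𝒦 : Set 𝒰} {Adm' : 𝒰 → 𝒰 → ℝ → Prop} {ϱ a ω : ℝ}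
    (hD : D.Nonempty) (hϱ : 0 < ϱ) (hmove : ∀ U d, move U d 0 = U) (hdir : ∃ d : Dir, 0 < N d ∧ N d ≤ w)
    (hsub : ∀ (U : 𝒰) (g g' : Z → F), E U (g - g') = E U g - E U g')
    (hnorm : ∀ (U : 𝒰) (c : F), E U (fun _ => c) = c) (hop : OpSlice E D move N 𝒦 w ϱ a)
    (hcov : ∀ (U₀ U₁ : 𝒰) (δ : ℝ), RawAdm move N 𝒦 U₀ U₁ δ → δ ≤ w → ∀ z ∈ D, Adm' (act z U₀) (act z U₁) δ)
    (hpair : ∀ (U₀ U₁ : 𝒰) (δ : ℝ), RawAdm move N 𝒦 U₀ U₁ δ → δ ≤ w → ∀ z ∈ D, ∀ z' ∈ D, z ≠ z' →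
      Adm' (act z' U₁) (act z U₁) ω)
    (hω0 : 0 ≤ ω) (hωw : ω ≤ w) :
    ContStepLawOn 𝒢 E act D (Windowed (RawAdm move N 𝒦) w) Adm' w a (4 * a / ϱ) ω :=
  contStepLawOn_of_opSlice_windowed hD hϱ hmove (supCost_of_opSlice (𝒢 := 𝒢) hsub hop hmove hϱ.le hdir)
    (opSlice_centred (𝒢 := 𝒢) hsub hnorm hop) hcov hpair hω0 hωw

/-- **THE CAUCHY CURRENCY, END TO END, WINDOW-GUARDED ⇒ `TransportsFromVar`** — §H `transportsFromVar_of_opSlices`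
VERBATIM except that the two [cell] action binders carry the guard `δ ≤ w`: `hcov`/`hpair` are asked only for
scale-`(k+1)` raw pairs INSIDE THE WINDOW.  Inside: raw WINDOWED moduli `Windowed (RawAdm …) w` propagate by
`moduliAt_of_birth_cont_dep` from `respMod_raw_of_birthSlice` (restricted, `RespMod.of_imp`) through
`cont_of_contStepLawOn_dep ∘ contStepLawOn_of_opSlice_windowed`; the attaining pair has defect `defect b k′ k ≤ w`
(`hdefw`), so it is windowed.  Same constants: `TransportsFromVar (4c_δ/r) (fun i => ψ·α i) Gate`. [folklore] -/
theorem transportsFromVar_of_opSlices_windowed {Z : Type*} {Gate : ℕ → Prop} {Fn : B.Birth → ℕ → ℕ → 𝒰 → F}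
    {rel : B.Birth → ℕ → ℕ → 𝒰 → 𝒰 → Prop} {Nk : B.Birth → ℕ → ℕ → Dir → ℝ} {𝒦 : B.Birth → ℕ → ℕ → Set 𝒰}
    {𝒢 : ℕ → Set (Z → F)} {E : ℕ → 𝒰 → (Z → F) → F} {act : ℕ → Z → 𝒰 → 𝒰} {D : ℕ → Set Z}
    {defect : B.Birth → ℕ → ℕ → ℝ} {cδ ψ : ℝ} {a α : ℕ → ℝ} {ϱ ω : B.Birth → ℕ → ℕ → ℝ}
    (hα : ∀ i, 0 ≤ α i) (hr : 0 < r) (hmove : ∀ U d, move U d 0 = U)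
    (hsl : ∀ (b : B.Birth) (k' : ℕ), B.birthScale b ≤ k' → k' ≤ B.K → RanBelow Gate k' →
      BirthSlice (Fn b k' k') move (Nk b k' k') (𝒦 b k' k') w r (T.gen b k'))
    (hFn : ∀ (b : B.Birth) (k' k : ℕ), B.birthScale b ≤ k' → k' ≤ k → k + 1 ≤ B.K → RanBelow Gate (k + 1) →
      ∀ U, Fn b k' (k + 1) U = E k U (fun z => Fn b k' k (act k z U)))
    (h𝒢 : ∀ (b : B.Birth) (k' k : ℕ), B.birthScale b ≤ k' → k' ≤ k → k + 1 ≤ B.K → RanBelow Gate (k + 1) →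
      ∀ U, (fun z => Fn b k' k (act k z U)) ∈ 𝒢 k)
    (hD : ∀ k, (D k).Nonempty) (hϱ : ∀ b k' k, 0 < ϱ b k' k)
    (hsup : ∀ (b : B.Birth) (k' k : ℕ), B.birthScale b ≤ k' → k' ≤ k → k + 1 ≤ B.K → RanBelow Gate (k + 1) →
      ∀ U₀ ∈ 𝒦 b k' (k + 1), ∀ g ∈ 𝒢 k, ∀ g' ∈ 𝒢 k, ∀ (m : ℝ), (∀ z ∈ D k, ‖g z - g' z‖ ≤ m) →
        ‖E k U₀ g - E k U₀ g'‖ ≤ a k * m)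
    (hEsl : ∀ (b : B.Birth) (k' k : ℕ), B.birthScale b ≤ k' → k' ≤ k → k + 1 ≤ B.K → RanBelow Gate (k + 1) →
      ∀ g ∈ 𝒢 k, ∀ (c : F) (m : ℝ), (∀ z ∈ D k, ‖g z - c‖ ≤ m) →
        BirthSlice (fun U => E k U g - c) move (Nk b k' (k + 1)) (𝒦 b k' (k + 1)) w (ϱ b k' k) (a k * m))
    (hcov : ∀ (b : B.Birth) (k' k : ℕ), B.birthScale b ≤ k' → k' ≤ k → k + 1 ≤ B.K → RanBelow Gate (k + 1) →
      ∀ (U₀ U₁ : 𝒰) (δ : ℝ), RawAdm move (Nk b k' (k + 1)) (𝒦 b k' (k + 1)) U₀ U₁ δ → δ ≤ w → ∀ z ∈ D k,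
        RawAdm move (Nk b k' k) (𝒦 b k' k) (act k z U₀) (act k z U₁) δ)
    (hpair : ∀ (b : B.Birth) (k' k : ℕ), B.birthScale b ≤ k' → k' ≤ k → k + 1 ≤ B.K → RanBelow Gate (k + 1) →
      ∀ (U₀ U₁ : 𝒰) (δ : ℝ), RawAdm move (Nk b k' (k + 1)) (𝒦 b k' (k + 1)) U₀ U₁ δ → δ ≤ w →
        ∀ z ∈ D k, ∀ z' ∈ D k, z ≠ z' → RawAdm move (Nk b k' k) (𝒦 b k' k) (act k z' U₁) (act k z U₁) (ω b k' k))
    (hω : ∀ b k' k, 0 ≤ ω b k' k ∧ ω b k' k ≤ w)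
    (hdom : ∀ (b : B.Birth) (k' k : ℕ), B.birthScale b ≤ k' → k' ≤ k → k + 1 ≤ B.K →
      a k * (1 + 4 * ω b k' k / ϱ b k' k) ≤ α k)
    (hinv : ∀ b k' k, GaugeInvariant (rel b k' k) (Fn b k' k))
    (hdefw : ∀ b k' k, defect b k' k ≤ w)
    (hrate : ∀ (b : B.Birth) (k' k : ℕ), B.birthScale b ≤ k' → k' ≤ k → k ≤ B.K →
      defect b k' k ≤ cδ * ψ ^ (k - k'))
    (hlin : ∀ (b : B.Birth) (k' k : ℕ), B.birthScale b ≤ k' → k' ≤ k → k ≤ B.K → RanBelow Gate k → ∀ ε > 0,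
      ∃ U₀ ∈ 𝒦 b k' k, ∃ U₁ : 𝒰, RelGauge (rel b k' k) move (Nk b k' k) U₀ U₁ (defect b k' k) ∧
        T.lin b k' k ≤ ‖Fn b k' k U₁ - Fn b k' k U₀‖ + ε) :
    T.TransportsFromVar (4 * cδ / r) (fun i => ψ * α i) Gate := by
  have h := transportsFromVar_of_moduli_dep (T := T) (C₀ := 4 / r)
    (Adm := fun b k' k => Windowed (RawAdm move (Nk b k' k) (𝒦 b k' k)) w) (by positivity) hα
    (fun b k' hbk' hk hran =>
      ((respMod_raw_of_birthSlice (hsl b k' hbk' hk hran) hmove hr (T.gen_nonneg b k')).congr_const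
        (by ring)).of_imp fun _ _ _ hadm => hadm.1)
    (cont_of_contStepLawOn_dep (Adm := fun b k' k => Windowed (RawAdm move (Nk b k' k) (𝒦 b k' k)) w) (𝒢 := 𝒢)
      (D := D) (ℓ := fun b k' k => 4 * a k / ϱ b k' k) (ω := ω)
      (fun b k' k U₀ U₁ δ hadm => rawAdm_nonneg hadm.1) hFn h𝒢
      (fun b k' k hbk' hk'k hk hran => contStepLawOn_of_opSlice_windowed (hD k) (hϱ b k' k) hmove
        (hsup b k' k hbk' hk'k hk hran) (hEsl b k' k hbk' hk'k hk hran)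
        (fun U₀ U₁ δ hadm hδ z hz => ⟨hcov b k' k hbk' hk'k hk hran U₀ U₁ δ hadm hδ z hz, hδ⟩)
        (fun U₀ U₁ δ hadm hδ z hz z' hz' hzz =>
          ⟨hpair b k' k hbk' hk'k hk hran U₀ U₁ δ hadm hδ z hz z' hz' hzz, (hω b k' k).2⟩)
        (hω b k' k).1 (hω b k' k).2)
      (fun b k' k hbk' hk'k hk => by
        show a k + 4 * a k / ϱ b k' k * ω b k' k ≤ α k
        rw [stepFactor_eq]
        exact hdom b k' k hbk' hk'k hk))
    hdefw hrate
    (fun b k' k hbk' hk'k hk hran ε hε => by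
      obtain ⟨U₀, hU₀, U₁, ⟨dd, hd, hdδ, hrel⟩, hle⟩ := hlin b k' k hbk' hk'k hk hran ε hε
      refine ⟨U₀, move U₀ dd 1, ⟨⟨hU₀, dd, hd, hdδ, rfl⟩, hdefw b k' k⟩, ?_⟩
      rwa [hinv b k' k _ _ hrel] at hle)
  have e : 4 / r * cδ = 4 * cδ / r := by ring
  rw [e] at h
  exact h

/-- **THE PIPELINE FROM NORMALISED LINEAR OPERATIONS' OPERATOR SLICES, WINDOW-GUARDED** — §J
`transportsFromVar_of_linearOpSlices` VERBATIM except for the guard `δ ≤ w` on `hcov`/`hpair`. [folklore] -/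
theorem transportsFromVar_of_linearOpSlices_windowed {Z : Type*} {Gate : ℕ → Prop}
    {Fn : B.Birth → ℕ → ℕ → 𝒰 → F}
    {rel : B.Birth → ℕ → ℕ → 𝒰 → 𝒰 → Prop} {Nk : B.Birth → ℕ → ℕ → Dir → ℝ} {𝒦 : B.Birth → ℕ → ℕ → Set 𝒰}
    {𝒢 : ℕ → Set (Z → F)} {E : ℕ → 𝒰 → (Z → F) → F} {act : ℕ → Z → 𝒰 → 𝒰} {D : ℕ → Set Z}
    {defect : B.Birth → ℕ → ℕ → ℝ} {cδ ψ : ℝ} {a α : ℕ → ℝ} {ϱ ω : B.Birth → ℕ → ℕ → ℝ}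
    (hα : ∀ i, 0 ≤ α i) (hr : 0 < r) (hmove : ∀ U d, move U d 0 = U)
    (hsl : ∀ (b : B.Birth) (k' : ℕ), B.birthScale b ≤ k' → k' ≤ B.K → RanBelow Gate k' →
      BirthSlice (Fn b k' k') move (Nk b k' k') (𝒦 b k' k') w r (T.gen b k'))
    (hFn : ∀ (b : B.Birth) (k' k : ℕ), B.birthScale b ≤ k' → k' ≤ k → k + 1 ≤ B.K → RanBelow Gate (k + 1) →
      ∀ U, Fn b k' (k + 1) U = E k U (fun z => Fn b k' k (act k z U)))
    (h𝒢 : ∀ (b : B.Birth) (k' k : ℕ), B.birthScale b ≤ k' → k' ≤ k → k + 1 ≤ B.K → RanBelow Gate (k + 1) →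
      ∀ U, (fun z => Fn b k' k (act k z U)) ∈ 𝒢 k)
    (hD : ∀ k, (D k).Nonempty) (hϱ : ∀ b k' k, 0 < ϱ b k' k)
    (hsub : ∀ (k : ℕ) (U : 𝒰) (g g' : Z → F), E k U (g - g') = E k U g - E k U g')
    (hnorm : ∀ (k : ℕ) (U : 𝒰) (c : F), E k U (fun _ => c) = c)
    (hop : ∀ (b : B.Birth) (k' k : ℕ), B.birthScale b ≤ k' → k' ≤ k → k + 1 ≤ B.K → RanBelow Gate (k + 1) →
      OpSlice (E k) (D k) move (Nk b k' (k + 1)) (𝒦 b k' (k + 1)) w (ϱ b k' k) (a k))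
    (hdir : ∀ (b : B.Birth) (k' k : ℕ), B.birthScale b ≤ k' → k' ≤ k → k + 1 ≤ B.K →
      ∃ d : Dir, 0 < Nk b k' (k + 1) d ∧ Nk b k' (k + 1) d ≤ w)
    (hcov : ∀ (b : B.Birth) (k' k : ℕ), B.birthScale b ≤ k' → k' ≤ k → k + 1 ≤ B.K → RanBelow Gate (k + 1) →
      ∀ (U₀ U₁ : 𝒰) (δ : ℝ), RawAdm move (Nk b k' (k + 1)) (𝒦 b k' (k + 1)) U₀ U₁ δ → δ ≤ w → ∀ z ∈ D k,
        RawAdm move (Nk b k' k) (𝒦 b k' k) (act k z U₀) (act k z U₁) δ)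
    (hpair : ∀ (b : B.Birth) (k' k : ℕ), B.birthScale b ≤ k' → k' ≤ k → k + 1 ≤ B.K → RanBelow Gate (k + 1) →
      ∀ (U₀ U₁ : 𝒰) (δ : ℝ), RawAdm move (Nk b k' (k + 1)) (𝒦 b k' (k + 1)) U₀ U₁ δ → δ ≤ w →
        ∀ z ∈ D k, ∀ z' ∈ D k, z ≠ z' → RawAdm move (Nk b k' k) (𝒦 b k' k) (act k z' U₁) (act k z U₁) (ω b k' k))
    (hω : ∀ b k' k, 0 ≤ ω b k' k ∧ ω b k' k ≤ w)
    (hdom : ∀ (b : B.Birth) (k' k : ℕ), B.birthScale b ≤ k' → k' ≤ k → k + 1 ≤ B.K →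
      a k * (1 + 4 * ω b k' k / ϱ b k' k) ≤ α k)
    (hinv : ∀ b k' k, GaugeInvariant (rel b k' k) (Fn b k' k))
    (hdefw : ∀ b k' k, defect b k' k ≤ w)
    (hrate : ∀ (b : B.Birth) (k' k : ℕ), B.birthScale b ≤ k' → k' ≤ k → k ≤ B.K →
      defect b k' k ≤ cδ * ψ ^ (k - k'))
    (hlin : ∀ (b : B.Birth) (k' k : ℕ), B.birthScale b ≤ k' → k' ≤ k → k ≤ B.K → RanBelow Gate k → ∀ ε > 0,
      ∃ U₀ ∈ 𝒦 b k' k, ∃ U₁ : 𝒰, RelGauge (rel b k' k) move (Nk b k' k) U₀ U₁ (defect b k' k) ∧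
        T.lin b k' k ≤ ‖Fn b k' k U₁ - Fn b k' k U₀‖ + ε) :
    T.TransportsFromVar (4 * cδ / r) (fun i => ψ * α i) Gate :=
  transportsFromVar_of_opSlices_windowed hα hr hmove hsl hFn h𝒢 hD hϱ
    (fun b k' k hbk' hk'k hk hran =>
      supCost_of_opSlice (𝒢 := 𝒢 k) (hsub k) (hop b k' k hbk' hk'k hk hran) hmove (hϱ b k' k).le
        (hdir b k' k hbk' hk'k hk))
    (fun b k' k hbk' hk'k hk hran => opSlice_centred (𝒢 := 𝒢 k) (hsub k) (hnorm k) (hop b k' k hbk' hk'k hk hran))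
    hcov hpair hω hdom hinv hdefw hrate hlin

/-- CONSISTENCY — §H's `transportsFromVar_of_opSlices` IS the special case of the guarded pipeline in which the cell
happens to supply the two action binders unguarded (drop the guard). [folklore] -/
example {Z : Type*} {Gate : ℕ → Prop} {Fn : B.Birth → ℕ → ℕ → 𝒰 → F}
    {rel : B.Birth → ℕ → ℕ → 𝒰 → 𝒰 → Prop} {Nk : B.Birth → ℕ → ℕ → Dir → ℝ} {𝒦 : B.Birth → ℕ → ℕ → Set 𝒰}
    {𝒢 : ℕ → Set (Z → F)} {E : ℕ → 𝒰 → (Z → F) → F} {act : ℕ → Z → 𝒰 → 𝒰} {D : ℕ → Set Z}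
    {defect : B.Birth → ℕ → ℕ → ℝ} {cδ ψ : ℝ} {a α : ℕ → ℝ} {ϱ ω : B.Birth → ℕ → ℕ → ℝ}
    (hα : ∀ i, 0 ≤ α i) (hr : 0 < r) (hmove : ∀ U d, move U d 0 = U)
    (hsl : ∀ (b : B.Birth) (k' : ℕ), B.birthScale b ≤ k' → k' ≤ B.K → RanBelow Gate k' →
      BirthSlice (Fn b k' k') move (Nk b k' k') (𝒦 b k' k') w r (T.gen b k'))
    (hFn : ∀ (b : B.Birth) (k' k : ℕ), B.birthScale b ≤ k' → k' ≤ k → k + 1 ≤ B.K → RanBelow Gate (k + 1) →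
      ∀ U, Fn b k' (k + 1) U = E k U (fun z => Fn b k' k (act k z U)))
    (h𝒢 : ∀ (b : B.Birth) (k' k : ℕ), B.birthScale b ≤ k' → k' ≤ k → k + 1 ≤ B.K → RanBelow Gate (k + 1) →
      ∀ U, (fun z => Fn b k' k (act k z U)) ∈ 𝒢 k)
    (hD : ∀ k, (D k).Nonempty) (hϱ : ∀ b k' k, 0 < ϱ b k' k)
    (hsup : ∀ (b : B.Birth) (k' k : ℕ), B.birthScale b ≤ k' → k' ≤ k → k + 1 ≤ B.K → RanBelow Gate (k + 1) →
      ∀ U₀ ∈ 𝒦 b k' (k + 1), ∀ g ∈ 𝒢 k, ∀ g' ∈ 𝒢 k, ∀ (m : ℝ), (∀ z ∈ D k, ‖g z - g' z‖ ≤ m) →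
        ‖E k U₀ g - E k U₀ g'‖ ≤ a k * m)
    (hEsl : ∀ (b : B.Birth) (k' k : ℕ), B.birthScale b ≤ k' → k' ≤ k → k + 1 ≤ B.K → RanBelow Gate (k + 1) →
      ∀ g ∈ 𝒢 k, ∀ (c : F) (m : ℝ), (∀ z ∈ D k, ‖g z - c‖ ≤ m) →
        BirthSlice (fun U => E k U g - c) move (Nk b k' (k + 1)) (𝒦 b k' (k + 1)) w (ϱ b k' k) (a k * m))
    (hcov : ∀ (b : B.Birth) (k' k : ℕ), B.birthScale b ≤ k' → k' ≤ k → k + 1 ≤ B.K → RanBelow Gate (k + 1) →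
      ∀ (U₀ U₁ : 𝒰) (δ : ℝ), RawAdm move (Nk b k' (k + 1)) (𝒦 b k' (k + 1)) U₀ U₁ δ → ∀ z ∈ D k,
        RawAdm move (Nk b k' k) (𝒦 b k' k) (act k z U₀) (act k z U₁) δ)
    (hpair : ∀ (b : B.Birth) (k' k : ℕ), B.birthScale b ≤ k' → k' ≤ k → k + 1 ≤ B.K → RanBelow Gate (k + 1) →
      ∀ (U₀ U₁ : 𝒰) (δ : ℝ), RawAdm move (Nk b k' (k + 1)) (𝒦 b k' (k + 1)) U₀ U₁ δ → ∀ z ∈ D k, ∀ z' ∈ D k,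
        z ≠ z' → RawAdm move (Nk b k' k) (𝒦 b k' k) (act k z' U₁) (act k z U₁) (ω b k' k))
    (hω : ∀ b k' k, 0 ≤ ω b k' k ∧ ω b k' k ≤ w)
    (hdom : ∀ (b : B.Birth) (k' k : ℕ), B.birthScale b ≤ k' → k' ≤ k → k + 1 ≤ B.K →
      a k * (1 + 4 * ω b k' k / ϱ b k' k) ≤ α k)
    (hinv : ∀ b k' k, GaugeInvariant (rel b k' k) (Fn b k' k))
    (hdefw : ∀ b k' k, defect b k' k ≤ w)
    (hrate : ∀ (b : B.Birth) (k' k : ℕ), B.birthScale b ≤ k' → k' ≤ k → k ≤ B.K →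
      defect b k' k ≤ cδ * ψ ^ (k - k'))
    (hlin : ∀ (b : B.Birth) (k' k : ℕ), B.birthScale b ≤ k' → k' ≤ k → k ≤ B.K → RanBelow Gate k → ∀ ε > 0,
      ∃ U₀ ∈ 𝒦 b k' k, ∃ U₁ : 𝒰, RelGauge (rel b k' k) move (Nk b k' k) U₀ U₁ (defect b k' k) ∧
        T.lin b k' k ≤ ‖Fn b k' k U₁ - Fn b k' k U₀‖ + ε) :
    T.TransportsFromVar (4 * cδ / r) (fun i => ψ * α i) Gate :=
  transportsFromVar_of_opSlices_windowed hα hr hmove hsl hFn h𝒢 hD hϱ hsup hEsl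
    (fun b k' k hbk' hk'k hk hran U₀ U₁ δ hadm _ => hcov b k' k hbk' hk'k hk hran U₀ U₁ δ hadm)
    (fun b k' k hbk' hk'k hk hran U₀ U₁ δ hadm _ => hpair b k' k hbk' hk'k hk hran U₀ U₁ δ hadm)
    hω hdom hinv hdefw hrate hlin

end WindowGuard

/-! #### §K, the lattice geometry: additive composition on `ℤ^d` along the affine chart -/

section LatticeGeometry

open T4BirthChartTransport (GaugeInvariant BirthSlice RelGauge)
open T4BlockTransport (Fld NDir latMove latN latMove_zero latMove_one_apply)

variable {B : Booking} {T : Trajectory B}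
variable {R : Type*} [NormedRing R] {d : ℕ}
  {F : Type*} [NormedAddCommGroup F] [NormedSpace ℂ F] [CompleteSpace F]

/-- [folklore] The bond-wise sup-norm BALL of radius `ρ` in the `R`-valued bond fields (a model of a regular-base /
small-fluctuation window in ONE frame; the cell's windows are (1.65)-type conditions on curvatures and axial-gauge
potentials — here only the NESTING arithmetic is modelled). -/
def bondBall (d : ℕ) (ρ : ℝ) : Set (Fld d R) := {U | ∀ x ν, ‖U x ν‖ ≤ ρ}

/-- [folklore] Membership in a bond ball, unfolded. -/
theorem mem_bondBall {ρ : ℝ} {U : Fld d R} : U ∈ (bondBall d ρ : Set (Fld d R)) ↔ ∀ x ν, ‖U x ν‖ ≤ ρ := Iff.rfl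

/-- [folklore] A DIRECTION FROM A DIFFERENCE with a declared bound: the bond field `z − z′` with declared sup bound
`ω ≥ ‖z − z′‖` bond-wise (the declared bound, not the actual sup, is the window norm `latN`). -/
def diffDir (z z' : Fld d R) (ω : ℝ) (h : ∀ x ν, ‖z x ν - z' x ν‖ ≤ ω) : NDir d R :=
  ⟨(z - z', ω), fun x ν => by simpa using h x ν⟩

/-- [folklore] Its declared norm is `ω`. -/
@[simp] theorem latN_diffDir (z z' : Fld d R) (ω : ℝ) (h : ∀ x ν, ‖z x ν - z' x ν‖ ≤ ω) :
    latN (diffDir z z' ω h) = ω := rfl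

/-- [folklore] ONE ADMISSIBLE DIRECTION in any window `w > 0`: the zero bond field with declared bound `w`
(§J's `hdir` on the lattice chart — declared bounds make this trivial). -/
theorem hdir_lattice {w : ℝ} (hw : 0 < w) : ∃ p : NDir d R, 0 < latN p ∧ latN p ≤ w :=
  ⟨⟨(fun _ _ => 0, w), fun x ν => by simpa using hw.le⟩, hw, le_rfl⟩

variable [NormedAlgebra ℂ R]

/-- [folklore] The ADDITIVE background–fluctuation composition `U + z` commutes with the affine chart (same direction,
same declared bound): `(U + t·p) + z = (U + z) + t·p`. -/
theorem add_latMove (z U : Fld d R) (p : NDir d R) (t : ℂ) : latMove U p t + z = latMove (U + z) p t := by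
  funext x ν
  simp only [latMove, Pi.add_apply]
  exact add_right_comm _ _ _

/-- **`hcov` ON THE LATTICE** (additive composition): if the lower base set absorbs the upper one translated by every
fluctuation of `D` — NESTING (N1) `𝒦′ + D ⊆ 𝒦` — then composing both members of a raw chart pair over `𝒦′` with one
fluctuation gives a raw chart pair over `𝒦` of the SAME direction, hence the same defect (no guard even needed here).
[folklore] -/
theorem hcov_add {𝒦' 𝒦 D : Set (Fld d R)} (hN1 : ∀ z ∈ D, ∀ U ∈ 𝒦', U + z ∈ 𝒦) :
    ∀ (U₀ U₁ : Fld d R) (δ : ℝ), RawAdm latMove latN 𝒦' U₀ U₁ δ → ∀ z ∈ D,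
      RawAdm latMove latN 𝒦 (U₀ + z) (U₁ + z) δ := by
  rintro U₀ U₁ δ ⟨hU₀, p, hp, hpδ, rfl⟩ z hz
  exact ⟨hN1 z hz U₀ hU₀, p, hp, hpδ, add_latMove z U₀ p 1⟩

/-- **`hpair` ON THE LATTICE, WINDOW-GUARDED** (additive composition): if the fluctuation domain has bond-wise DIAMETER
`≤ ω` with `0 < ω` and the lower base set absorbs the `w`-FATTENED upper one translated by `D` — NESTING (N2)
`(𝒦′ + {p : latN p ≤ w}) + D ⊆ 𝒦` — then over the endpoint `U₁` of a raw pair of defect `δ ≤ w` two distinct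
fluctuations `z ≠ z′` give the raw chart pair `(U₁ + z′, U₁ + z)` over `𝒦` along the direction `z − z′` with declared
bound `ω`: defect `ω`.  (The guard `δ ≤ w` is what makes (N2) a WINDOW condition — `base_of_hpair_unguarded`.)
[folklore] -/
theorem hpair_add {𝒦' 𝒦 D : Set (Fld d R)} {w ω : ℝ} (hω : 0 < ω)
    (hdiam : ∀ z ∈ D, ∀ z' ∈ D, ∀ x ν, ‖z x ν - z' x ν‖ ≤ ω)
    (hN2 : ∀ U₀ ∈ 𝒦', ∀ p : NDir d R, latN p ≤ w → ∀ z' ∈ D, latMove U₀ p 1 + z' ∈ 𝒦) :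
    ∀ (U₀ U₁ : Fld d R) (δ : ℝ), RawAdm latMove latN 𝒦' U₀ U₁ δ → δ ≤ w → ∀ z ∈ D, ∀ z' ∈ D, z ≠ z' →
      RawAdm latMove latN 𝒦 (U₁ + z') (U₁ + z) ω := by
  rintro U₀ U₁ δ ⟨hU₀, p, hp, hpδ, rfl⟩ hδ z hz z' hz' _
  refine ⟨hN2 U₀ hU₀ p (hpδ.trans hδ) z' hz', diffDir z z' ω (hdiam z hz z' hz'), hω, le_rfl, ?_⟩
  funext x ν
  simp only [latMove, diffDir, Pi.add_apply, Pi.sub_apply, one_smul]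
  abel

/-- **WHY THE GUARD, ON THE LATTICE**: with the additive composition, ONE upper base `U₀ ∈ 𝒦′` and TWO distinct
fluctuations in `D`, the UNGUARDED `hpair` of §H/§J forces EVERY bond field at bounded distance from `U₀ + z′` — i.e.
every bounded perturbation, however large — into the lower base set `𝒦`; then the next-lower step's operator slice `hop`
would be demanded at all such complex backgrounds with ONE operator bound `a`, which is not the printed format ((1.65)
p. 375 / (R-ext): analyticity on the window `Ũ^c_k` only — header, PRINTED CONTEXT).  Hence §K's guard. [folklore] -/
theorem lattice_base_of_hpair_unguarded {𝒦' 𝒦 D : Set (Fld d R)} {ω : ℝ}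
    (hpair : ∀ (U₀ U₁ : Fld d R) (δ : ℝ), RawAdm latMove latN 𝒦' U₀ U₁ δ → ∀ z ∈ D, ∀ z' ∈ D, z ≠ z' →
      RawAdm latMove latN 𝒦 (U₁ + z') (U₁ + z) ω)
    {U₀ : Fld d R} (hU₀ : U₀ ∈ 𝒦') {z z' : Fld d R} (hz : z ∈ D) (hz' : z' ∈ D) (hzz : z ≠ z')
    (V : Fld d R) {s : ℝ} (hs : ∀ x ν, ‖V x ν - U₀ x ν - z' x ν‖ ≤ s) : V ∈ 𝒦 := by
  let G : NDir d R := ⟨(V - U₀ - z', max s 1), fun x ν => by simpa using (hs x ν).trans (le_max_left s 1)⟩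
  have hG : 0 < latN G := lt_of_lt_of_le one_pos (le_max_right s 1)
  have hmem := base_of_hpair_unguarded (act := fun z U => U + z) hpair hU₀ hz hz' hzz G hG
  have e : latMove U₀ G 1 + z' = V := by
    funext x ν
    simp only [latMove, G, Pi.add_apply, Pi.sub_apply, one_smul]
    abel
  rwa [e] at hmem

/-- **ON `ℤ^d`, THE §J PIPELINE WITH THE CHART GEOMETRY DISCHARGED** (v1.3): backgrounds = `R`-valued bond fields,
the affine chart `latMove`/`latN` in ONE frame, the ADDITIVE composition `act z U = U + z` of background and
fluctuation (both bond fields).  The three geometric [cell] binders of §J are now THEOREMS of three located WINDOW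
conditions per met step: (N1) `𝒦 b k′ (k+1) + D k ⊆ 𝒦 b k′ k`, (N2) `(𝒦 b k′ (k+1) + {latN ≤ w}) + D k ⊆ 𝒦 b k′ k`
(NESTING of the regular-base windows of consecutive scales with margin `w` + fluctuation size — printed TYPE, NOT
asserted: [Balaban1989LargeFieldI] p. 190 «the old action A_k has effectively a larger analyticity domain with respect to
the new field» … «we have to enlarge the analyticity domain by proper inductive assumptions, in agreement with the
restrictions introduced by the characteristic function»; the NUMBERS are the cell's), (DIAM) the fluctuation domain `D k`
has bond-wise diameter `≤ ω k`, `0 < ω k ≤ w` (the small-fluctuation restriction of the step — printed TYPE, NOT asserted: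
[Balaban1989LargeFieldI] p. 187 «the only characteristic functions are the functions (1.9), (1.27) restricting the
fluctuation field on the domains» …, «This field is small» (1.54); number = cell's).  What remains a binder is ANALYTIC or NUMERIC only: births `hsl`, the recursion `hFn`/`h𝒢`, `hsub`/`hnorm`,
the operator slices `hop` (radius `ϱ`, bound `a`), the domination `a k·(1 + 4ω k/ϱ) ≤ α k`, invariance, defects,
attainment.  Conclusion `TransportsFromVar (4c_δ/r) (fun i => ψ·α i) Gate`.  Nothing of B12/B13/B16 asserted; the
additive composition is the CRUDE model of «background composed with fluctuation» (dictionary, not a claim about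
`U_k(V)·exp(iηA′)`). [folklore] -/
theorem transportsFromVar_of_linearOpSlices_lattice {Gate : ℕ → Prop} {Fn : B.Birth → ℕ → ℕ → Fld d R → F}
    {rel : B.Birth → ℕ → ℕ → Fld d R → Fld d R → Prop} {𝒦 : B.Birth → ℕ → ℕ → Set (Fld d R)}
    {𝒢 : ℕ → Set (Fld d R → F)} {E : ℕ → Fld d R → (Fld d R → F) → F} {D : ℕ → Set (Fld d R)}
    {defect : B.Birth → ℕ → ℕ → ℝ} {cδ ψ w r : ℝ} {a α ω : ℕ → ℝ} {ϱ : B.Birth → ℕ → ℕ → ℝ}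
    (hα : ∀ i, 0 ≤ α i) (hr : 0 < r) (hw : 0 < w)
    (hsl : ∀ (b : B.Birth) (k' : ℕ), B.birthScale b ≤ k' → k' ≤ B.K → RanBelow Gate k' →
      BirthSlice (Fn b k' k') latMove latN (𝒦 b k' k') w r (T.gen b k'))
    (hFn : ∀ (b : B.Birth) (k' k : ℕ), B.birthScale b ≤ k' → k' ≤ k → k + 1 ≤ B.K → RanBelow Gate (k + 1) →
      ∀ U, Fn b k' (k + 1) U = E k U (fun z => Fn b k' k (U + z)))
    (h𝒢 : ∀ (b : B.Birth) (k' k : ℕ), B.birthScale b ≤ k' → k' ≤ k → k + 1 ≤ B.K → RanBelow Gate (k + 1) →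
      ∀ U, (fun z => Fn b k' k (U + z)) ∈ 𝒢 k)
    (hD : ∀ k, (D k).Nonempty) (hϱ : ∀ b k' k, 0 < ϱ b k' k)
    (hsub : ∀ (k : ℕ) (U : Fld d R) (g g' : Fld d R → F), E k U (g - g') = E k U g - E k U g')
    (hnorm : ∀ (k : ℕ) (U : Fld d R) (c : F), E k U (fun _ => c) = c)
    (hop : ∀ (b : B.Birth) (k' k : ℕ), B.birthScale b ≤ k' → k' ≤ k → k + 1 ≤ B.K → RanBelow Gate (k + 1) →
      OpSlice (E k) (D k) latMove latN (𝒦 b k' (k + 1)) w (ϱ b k' k) (a k))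
    (hN1 : ∀ (b : B.Birth) (k' k : ℕ), B.birthScale b ≤ k' → k' ≤ k → k + 1 ≤ B.K →
      ∀ z ∈ D k, ∀ U ∈ 𝒦 b k' (k + 1), U + z ∈ 𝒦 b k' k)
    (hN2 : ∀ (b : B.Birth) (k' k : ℕ), B.birthScale b ≤ k' → k' ≤ k → k + 1 ≤ B.K →
      ∀ U₀ ∈ 𝒦 b k' (k + 1), ∀ p : NDir d R, latN p ≤ w → ∀ z' ∈ D k, latMove U₀ p 1 + z' ∈ 𝒦 b k' k)
    (hdiam : ∀ k, ∀ z ∈ D k, ∀ z' ∈ D k, ∀ x ν, ‖z x ν - z' x ν‖ ≤ ω k)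
    (hω : ∀ k, 0 < ω k ∧ ω k ≤ w)
    (hdom : ∀ (b : B.Birth) (k' k : ℕ), B.birthScale b ≤ k' → k' ≤ k → k + 1 ≤ B.K →
      a k * (1 + 4 * ω k / ϱ b k' k) ≤ α k)
    (hinv : ∀ b k' k, GaugeInvariant (rel b k' k) (Fn b k' k))
    (hdefw : ∀ b k' k, defect b k' k ≤ w)
    (hrate : ∀ (b : B.Birth) (k' k : ℕ), B.birthScale b ≤ k' → k' ≤ k → k ≤ B.K →
      defect b k' k ≤ cδ * ψ ^ (k - k'))
    (hlin : ∀ (b : B.Birth) (k' k : ℕ), B.birthScale b ≤ k' → k' ≤ k → k ≤ B.K → RanBelow Gate k → ∀ ε > 0,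
      ∃ U₀ ∈ 𝒦 b k' k, ∃ U₁ : Fld d R, RelGauge (rel b k' k) latMove latN U₀ U₁ (defect b k' k) ∧
        T.lin b k' k ≤ ‖Fn b k' k U₁ - Fn b k' k U₀‖ + ε) :
    T.TransportsFromVar (4 * cδ / r) (fun i => ψ * α i) Gate :=
  transportsFromVar_of_linearOpSlices_windowed (act := fun _ z U => U + z) (Nk := fun _ _ _ => latN)
    (ϱ := ϱ) (ω := fun _ _ k => ω k) hα hr latMove_zero hsl hFn h𝒢 hD hϱ hsub hnorm hop
    (fun _ _ _ _ _ _ => hdir_lattice hw)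
    (fun b k' k hbk' hk'k hk _ U₀ U₁ δ hadm _ z hz => hcov_add (hN1 b k' k hbk' hk'k hk) U₀ U₁ δ hadm z hz)
    (fun b k' k hbk' hk'k hk _ => hpair_add (hω k).1 (hdiam k) (hN2 b k' k hbk' hk'k hk))
    (fun _ _ k => ⟨(hω k).1.le, (hω k).2⟩) hdom hinv hdefw hrate hlin

omit [NormedAlgebra ℂ R] in
/-- [arith] [folklore] Nesting (N1) for bond balls: radii `ρ′ + s ≤ ρ`. -/
theorem bondBall_add_mem {ρ' s ρ : ℝ} (h : ρ' + s ≤ ρ) :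
    ∀ z ∈ (bondBall d s : Set (Fld d R)), ∀ U ∈ (bondBall d ρ' : Set (Fld d R)),
      U + z ∈ (bondBall d ρ : Set (Fld d R)) := by
  intro z hz U hU x ν
  calc ‖(U + z) x ν‖ = ‖U x ν + z x ν‖ := rfl
    _ ≤ ‖U x ν‖ + ‖z x ν‖ := norm_add_le _ _
    _ ≤ ρ' + s := add_le_add (hU x ν) (hz x ν)
    _ ≤ ρ := h

/-- [arith] [folklore] Nesting (N2) for bond balls: radii `ρ′ + w + s ≤ ρ`. -/
theorem bondBall_latMove_add_mem {ρ' w s ρ : ℝ} (h : ρ' + w + s ≤ ρ) :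
    ∀ U₀ ∈ (bondBall d ρ' : Set (Fld d R)), ∀ p : NDir d R, latN p ≤ w → ∀ z' ∈ (bondBall d s : Set (Fld d R)),
      latMove U₀ p 1 + z' ∈ (bondBall d ρ : Set (Fld d R)) := by
  intro U₀ hU₀ p hp z' hz' x ν
  have hpx : ‖p.1.1 x ν‖ ≤ w := (T4BlockTransport.norm_dir_le p x ν).trans hp
  calc ‖(latMove U₀ p 1 + z') x ν‖ = ‖U₀ x ν + p.1.1 x ν + z' x ν‖ := by
        simp only [Pi.add_apply, latMove_one_apply]
    _ ≤ ‖U₀ x ν‖ + ‖p.1.1 x ν‖ + ‖z' x ν‖ := norm_add₃_le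
    _ ≤ ρ' + w + s := by linarith [hU₀ x ν, hz' x ν]
    _ ≤ ρ := h

omit [NormedAlgebra ℂ R] in
/-- [arith] [folklore] Diameter (DIAM) of a bond ball: `≤ 2s`. -/
theorem bondBall_diam {s : ℝ} :
    ∀ z ∈ (bondBall d s : Set (Fld d R)), ∀ z' ∈ (bondBall d s : Set (Fld d R)), ∀ x ν,
      ‖z x ν - z' x ν‖ ≤ 2 * s := by
  intro z hz z' hz' x ν
  calc ‖z x ν - z' x ν‖ ≤ ‖z x ν‖ + ‖z' x ν‖ := norm_sub_le _ _
    _ ≤ 2 * s := by linarith [hz x ν, hz' x ν]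

end LatticeGeometry

/-! #### §K, non-vacuity: the three window conditions hold NON-degenerately (proper windows, two fluctuations) -/

section LatticeGeometryToy

open T4BlockTransport (Fld NDir latMove latN)

/-- CONSISTENCY — on `ℤ⁴` with `R = ℂ`: upper window = bond ball of radius `1`, lower window = radius `3`, fluctuations
= bond ball of radius `½`, `w = 1`, `ω = 1`: (N1), (N2), (DIAM) hold, the lower window is a PROPER subset (the constant
field `4` is outside), the upper window and the fluctuation domain are inhabited, the latter by two distinct fields —
so §K's guarded binders are jointly inhabited WITHOUT the degeneration `𝒦 = univ` that the unguarded ones force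
(`lattice_base_of_hpair_unguarded`).  Arithmetic only; nothing of Bałaban's windows is modelled. -/
example :
    (∀ z ∈ (bondBall 4 (1 / 2) : Set (Fld 4 ℂ)), ∀ U ∈ (bondBall 4 1 : Set (Fld 4 ℂ)),
        U + z ∈ (bondBall 4 3 : Set (Fld 4 ℂ))) ∧
      (∀ U₀ ∈ (bondBall 4 1 : Set (Fld 4 ℂ)), ∀ p : NDir 4 ℂ, latN p ≤ 1 →
        ∀ z' ∈ (bondBall 4 (1 / 2) : Set (Fld 4 ℂ)), latMove U₀ p 1 + z' ∈ (bondBall 4 3 : Set (Fld 4 ℂ))) ∧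
      (∀ z ∈ (bondBall 4 (1 / 2) : Set (Fld 4 ℂ)), ∀ z' ∈ (bondBall 4 (1 / 2) : Set (Fld 4 ℂ)), ∀ x ν,
        ‖z x ν - z' x ν‖ ≤ 1) ∧
      (fun _ _ => (4 : ℂ)) ∉ (bondBall 4 3 : Set (Fld 4 ℂ)) ∧
      (fun _ _ => (0 : ℂ)) ∈ (bondBall 4 1 : Set (Fld 4 ℂ)) ∧
      (fun _ _ => (0 : ℂ)) ∈ (bondBall 4 (1 / 2) : Set (Fld 4 ℂ)) ∧
      (fun _ _ => (1 / 2 : ℂ)) ∈ (bondBall 4 (1 / 2) : Set (Fld 4 ℂ)) ∧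
      (fun _ _ => (0 : ℂ)) ≠ (fun (_ : T4BlockTransport.Site 4) (_ : Fin 4) => (1 / 2 : ℂ)) := by
  refine ⟨bondBall_add_mem (by norm_num), bondBall_latMove_add_mem (by norm_num), ?_, ?_, ?_, ?_, ?_, ?_⟩
  · intro z hz z' hz' x ν
    have h := bondBall_diam z hz z' hz' x ν
    linarith
  · intro h
    have h4 := h (fun _ => 0) 0
    norm_num at h4
  · intro x ν; simp
  · intro x ν; simp
  · intro x ν; norm_num
  · intro h
    have h0 := congrFun (congrFun h (fun _ => 0)) 0
    norm_num at h0

end LatticeGeometryToy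

/-! ### §L The class guard on the linear supplier (v1.4) -/

section ClassGuard

open T4BirthChartTransport (GaugeInvariant BirthSlice RelGauge slice_bound norm_base_le)

variable {B : Booking} {T : Trajectory B}
variable {𝒰 Dir F : Type*} [NormedAddCommGroup F] [NormedSpace ℂ F] [CompleteSpace F]
  {move : 𝒰 → Dir → ℂ → 𝒰} {N : Dir → ℝ} {w r : ℝ}

/-- FORMAT — THE OPERATOR SLICE ON AN INTEGRAND CLASS `𝒢` (§J's `OpSlice` with §F's class guard T1 carried into the
supplier): every integrand `h ∈ 𝒢` bounded by `m` on `D` has the slice `BirthSlice (fun U => E U h) move N 𝒦 w ϱ (a·m)`.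
§J asks this for EVERY `h : Z → F`; for an operation `E U` that is LITERALLY a normalised integral over the fluctuation
variables the class-free companions `hsub` (and, with it, `hop`) are obstructed by the junk value `∫ = 0` on
non-integrable integrands (cell typing-checklist (ii); `setIntegral_not_subtractive` below) — the very obstruction §F's
`ContStepLawOn 𝒢` was introduced to avoid.  [printed TYPE as for `OpSlice`: (1.65) p. 375 / (R-ext), (1.75) p. 380 ON
the window; NOT asserted.] [folklore] -/
def OpSliceOn {Z : Type*} (𝒢 : Set (Z → F)) (E : 𝒰 → (Z → F) → F) (D : Set Z) (move : 𝒰 → Dir → ℂ → 𝒰)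
    (N : Dir → ℝ) (𝒦 : Set 𝒰) (w ϱ a : ℝ) : Prop :=
  ∀ h ∈ 𝒢, ∀ m : ℝ, (∀ z ∈ D, ‖h z‖ ≤ m) → BirthSlice (fun U => E U h) move N 𝒦 w ϱ (a * m)

omit [CompleteSpace F] in
/-- §J's class-free operator slice gives the guarded one on EVERY class. [folklore] -/
theorem OpSlice.on {Z : Type*} {E : 𝒰 → (Z → F) → F} {D : Set Z} {𝒦 : Set 𝒰} {ϱ a : ℝ}
    (h : OpSlice E D move N 𝒦 w ϱ a) (𝒢 : Set (Z → F)) : OpSliceOn 𝒢 E D move N 𝒦 w ϱ a :=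
  fun g _ m hm => h g m hm

omit [CompleteSpace F] in
/-- CONSISTENCY — at `𝒢 = univ` the guarded operator slice IS §J's. [folklore] -/
theorem opSliceOn_univ_iff {Z : Type*} {E : 𝒰 → (Z → F) → F} {D : Set Z} {𝒦 : Set 𝒰} {ϱ a : ℝ} :
    OpSliceOn (Set.univ : Set (Z → F)) E D move N 𝒦 w ϱ a ↔ OpSlice E D move N 𝒦 w ϱ a :=
  ⟨fun h g m hm => h g (Set.mem_univ _) m hm, fun h => h.on _⟩

omit [CompleteSpace F] in
/-- `OpSliceOn` is antitone in the class and in the base set. [folklore] -/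
theorem OpSliceOn.anti {Z : Type*} {𝒢 𝒢' : Set (Z → F)} {E : 𝒰 → (Z → F) → F} {D : Set Z} {𝒦 𝒦' : Set 𝒰}
    {ϱ a : ℝ} (h : OpSliceOn 𝒢 E D move N 𝒦 w ϱ a) (h𝒢 : 𝒢' ⊆ 𝒢) (h𝒦 : 𝒦' ⊆ 𝒦) :
    OpSliceOn 𝒢' E D move N 𝒦' w ϱ a :=
  fun g hg m hm U hU d hd hdw => h g (h𝒢 hg) m hm U (h𝒦 hU) d hd hdw

omit [CompleteSpace F] in
/-- **THE CENTRED SLICE FROM THE OPERATOR SLICE ON THE CLASS** (§J `opSlice_centred`, class-guarded): the class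
contains the constants and is closed under differences, `E U` is SUBTRACTIVE ON THE CLASS and NORMALISED ⇒ §H's binder
`hEsl` for `g ∈ 𝒢` (`E U g − c = E U (g − const c)`, both arguments in `𝒢`). [folklore] -/
theorem opSliceOn_centred {Z : Type*} {𝒢 : Set (Z → F)} {E : 𝒰 → (Z → F) → F} {D : Set Z} {𝒦 : Set 𝒰} {ϱ a : ℝ}
    (h𝒢c : ∀ c : F, (fun _ : Z => c) ∈ 𝒢) (h𝒢s : ∀ g ∈ 𝒢, ∀ g' ∈ 𝒢, g - g' ∈ 𝒢)
    (hsub : ∀ (U : 𝒰), ∀ g ∈ 𝒢, ∀ g' ∈ 𝒢, E U (g - g') = E U g - E U g')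
    (hnorm : ∀ (U : 𝒰) (c : F), E U (fun _ => c) = c) (hop : OpSliceOn 𝒢 E D move N 𝒦 w ϱ a) :
    ∀ g ∈ 𝒢, ∀ (c : F) (m : ℝ), (∀ z ∈ D, ‖g z - c‖ ≤ m) → BirthSlice (fun U => E U g - c) move N 𝒦 w ϱ (a * m) := by
  intro g hg c m hm
  have e : (fun U => E U g - c) = fun U => E U (g - fun _ => c) := by
    funext U
    rw [hsub U g hg _ (h𝒢c c), hnorm]
  rw [e]
  exact hop _ (h𝒢s g hg _ (h𝒢c c)) m fun z hz => by simpa using hm z hz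

omit [CompleteSpace F] in
/-- **THE SUP COST FROM THE OPERATOR SLICE ON THE CLASS AT `t = 0`** (§J `supCost_of_opSlice`, class-guarded):
differences of class members in the class, subtractivity ON THE CLASS, the guarded slice and ONE admissible direction ⇒
§H's binder `hsup` with the same `a` (`T4BirthChartTransport.norm_base_le` BY NAME). [folklore] -/
theorem supCost_of_opSliceOn {Z : Type*} {𝒢 : Set (Z → F)} {E : 𝒰 → (Z → F) → F} {D : Set Z} {𝒦 : Set 𝒰}
    {ϱ a : ℝ} (h𝒢s : ∀ g ∈ 𝒢, ∀ g' ∈ 𝒢, g - g' ∈ 𝒢)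
    (hsub : ∀ (U : 𝒰), ∀ g ∈ 𝒢, ∀ g' ∈ 𝒢, E U (g - g') = E U g - E U g') (hop : OpSliceOn 𝒢 E D move N 𝒦 w ϱ a)
    (hmove : ∀ U d, move U d 0 = U) (hϱ : 0 ≤ ϱ) (hdir : ∃ d : Dir, 0 < N d ∧ N d ≤ w) :
    ∀ U₀ ∈ 𝒦, ∀ g ∈ 𝒢, ∀ g' ∈ 𝒢, ∀ (m : ℝ), (∀ z ∈ D, ‖g z - g' z‖ ≤ m) → ‖E U₀ g - E U₀ g'‖ ≤ a * m := by
  intro U₀ hU₀ g hg g' hg' m hm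
  obtain ⟨d, hd, hdw⟩ := hdir
  rw [← hsub U₀ g hg g' hg']
  exact norm_base_le (Fn := fun U => E U (g - g'))
    (hop _ (h𝒢s g hg g' hg') m fun z hz => by simpa using hm z hz) hmove hϱ hU₀ hd hdw

omit [CompleteSpace F] in
/-- The operator bound of a guarded slice is at least `1` as soon as the class contains the constants and the window has
a regular base, an admissible direction and `F` a nonzero vector (normalisation). [arith] [folklore] -/
theorem one_le_of_opSliceOn {Z : Type*} {𝒢 : Set (Z → F)} {E : 𝒰 → (Z → F) → F} {D : Set Z} {𝒦 : Set 𝒰}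
    {ϱ a : ℝ} (h𝒢c : ∀ c : F, (fun _ : Z => c) ∈ 𝒢) (hnorm : ∀ (U : 𝒰) (c : F), E U (fun _ => c) = c)
    (hop : OpSliceOn 𝒢 E D move N 𝒦 w ϱ a) (hmove : ∀ U d, move U d 0 = U) (hϱ : 0 ≤ ϱ) {U₀ : 𝒰} (hU₀ : U₀ ∈ 𝒦)
    (hdir : ∃ d : Dir, 0 < N d ∧ N d ≤ w) {c : F} (hc : c ≠ 0) : 1 ≤ a := by
  obtain ⟨d, hd, hdw⟩ := hdir
  have h := norm_base_le (Fn := fun U => E U fun _ => c) (hop (fun _ => c) (h𝒢c c) ‖c‖ fun z _ => le_rfl) hmove hϱ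
    hU₀ hd hdw
  simp only [hnorm] at h
  have hc' : 0 < ‖c‖ := norm_pos_iff.mpr hc
  nlinarith

/-- **THE STEP LAW FROM A NORMALISED OPERATION LINEAR ON THE CLASS, CLASS- AND WINDOW-GUARDED** (§K
`contStepLawOn_of_linearOpSlice_windowed` with `hsub`/`hop` asked ON THE CLASS `𝒢` only, the class containing the
constants and closed under differences): `ContStepLawOn 𝒢 E act D (Windowed (RawAdm move N 𝒦) w) Adm′ w a (4a/ϱ) ω`.
[folklore] -/
theorem contStepLawOn_of_linearOpSliceOn_windowed {Z : Type*} {𝒢 : Set (Z → F)} {E : 𝒰 → (Z → F) → F}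
    {act : Z → 𝒰 → 𝒰} {D : Set Z} {𝒦 : Set 𝒰} {Adm' : 𝒰 → 𝒰 → ℝ → Prop} {ϱ a ω : ℝ}
    (hD : D.Nonempty) (hϱ : 0 < ϱ) (hmove : ∀ U d, move U d 0 = U) (hdir : ∃ d : Dir, 0 < N d ∧ N d ≤ w)
    (h𝒢c : ∀ c : F, (fun _ : Z => c) ∈ 𝒢) (h𝒢s : ∀ g ∈ 𝒢, ∀ g' ∈ 𝒢, g - g' ∈ 𝒢)
    (hsub : ∀ (U : 𝒰), ∀ g ∈ 𝒢, ∀ g' ∈ 𝒢, E U (g - g') = E U g - E U g')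
    (hnorm : ∀ (U : 𝒰) (c : F), E U (fun _ => c) = c) (hop : OpSliceOn 𝒢 E D move N 𝒦 w ϱ a)
    (hcov : ∀ (U₀ U₁ : 𝒰) (δ : ℝ), RawAdm move N 𝒦 U₀ U₁ δ → δ ≤ w → ∀ z ∈ D, Adm' (act z U₀) (act z U₁) δ)
    (hpair : ∀ (U₀ U₁ : 𝒰) (δ : ℝ), RawAdm move N 𝒦 U₀ U₁ δ → δ ≤ w → ∀ z ∈ D, ∀ z' ∈ D, z ≠ z' →
      Adm' (act z' U₁) (act z U₁) ω)
    (hω0 : 0 ≤ ω) (hωw : ω ≤ w) :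
    ContStepLawOn 𝒢 E act D (Windowed (RawAdm move N 𝒦) w) Adm' w a (4 * a / ϱ) ω :=
  contStepLawOn_of_opSlice_windowed hD hϱ hmove (supCost_of_opSliceOn h𝒢s hsub hop hmove hϱ.le hdir)
    (opSliceOn_centred h𝒢c h𝒢s hsub hnorm hop) hcov hpair hω0 hωw

/-- CONSISTENCY — §K's class-free `contStepLawOn_of_linearOpSlice_windowed` IS the guarded law at `𝒢 = univ`,
restricted to the class by `ContStepLawOn.anti`. [folklore] -/
example {Z : Type*} {𝒢 : Set (Z → F)} {E : 𝒰 → (Z → F) → F}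
    {act : Z → 𝒰 → 𝒰} {D : Set Z} {𝒦 : Set 𝒰} {Adm' : 𝒰 → 𝒰 → ℝ → Prop} {ϱ a ω : ℝ}
    (hD : D.Nonempty) (hϱ : 0 < ϱ) (hmove : ∀ U d, move U d 0 = U) (hdir : ∃ d : Dir, 0 < N d ∧ N d ≤ w)
    (hsub : ∀ (U : 𝒰) (g g' : Z → F), E U (g - g') = E U g - E U g')
    (hnorm : ∀ (U : 𝒰) (c : F), E U (fun _ => c) = c) (hop : OpSlice E D move N 𝒦 w ϱ a)
    (hcov : ∀ (U₀ U₁ : 𝒰) (δ : ℝ), RawAdm move N 𝒦 U₀ U₁ δ → δ ≤ w → ∀ z ∈ D, Adm' (act z U₀) (act z U₁) δ)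
    (hpair : ∀ (U₀ U₁ : 𝒰) (δ : ℝ), RawAdm move N 𝒦 U₀ U₁ δ → δ ≤ w → ∀ z ∈ D, ∀ z' ∈ D, z ≠ z' →
      Adm' (act z' U₁) (act z U₁) ω)
    (hω0 : 0 ≤ ω) (hωw : ω ≤ w) :
    ContStepLawOn 𝒢 E act D (Windowed (RawAdm move N 𝒦) w) Adm' w a (4 * a / ϱ) ω :=
  (contStepLawOn_of_linearOpSliceOn_windowed (𝒢 := Set.univ) hD hϱ hmove hdir (fun _ => Set.mem_univ _)
    (fun _ _ _ _ => Set.mem_univ _) (fun U g _ g' _ => hsub U g g') hnorm (hop.on _) hcov hpair hω0 hωw).anti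
    (Set.subset_univ 𝒢)

/-- **THE PIPELINE FROM NORMALISED OPERATIONS LINEAR ON THE CLASS, CLASS- AND WINDOW-GUARDED** — §K
`transportsFromVar_of_linearOpSlices_windowed` VERBATIM except that, per met step `k`, `hsub` is asked for `g, g′ ∈ 𝒢 k`
only, `hop` is the guarded `OpSliceOn (𝒢 k)`, and the class `𝒢 k` contains the constants (`h𝒢c`) and is closed under
differences (`h𝒢s`).  Same conclusion `T.TransportsFromVar (4c_δ/r) (fun i => ψ·α i) Gate`. [folklore] -/
theorem transportsFromVar_of_linearOpSlicesOn_windowed {Z : Type*} {Gate : ℕ → Prop}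
    {Fn : B.Birth → ℕ → ℕ → 𝒰 → F}
    {rel : B.Birth → ℕ → ℕ → 𝒰 → 𝒰 → Prop} {Nk : B.Birth → ℕ → ℕ → Dir → ℝ} {𝒦 : B.Birth → ℕ → ℕ → Set 𝒰}
    {𝒢 : ℕ → Set (Z → F)} {E : ℕ → 𝒰 → (Z → F) → F} {act : ℕ → Z → 𝒰 → 𝒰} {D : ℕ → Set Z}
    {defect : B.Birth → ℕ → ℕ → ℝ} {cδ ψ : ℝ} {a α : ℕ → ℝ} {ϱ ω : B.Birth → ℕ → ℕ → ℝ}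
    (hα : ∀ i, 0 ≤ α i) (hr : 0 < r) (hmove : ∀ U d, move U d 0 = U)
    (hsl : ∀ (b : B.Birth) (k' : ℕ), B.birthScale b ≤ k' → k' ≤ B.K → RanBelow Gate k' →
      BirthSlice (Fn b k' k') move (Nk b k' k') (𝒦 b k' k') w r (T.gen b k'))
    (hFn : ∀ (b : B.Birth) (k' k : ℕ), B.birthScale b ≤ k' → k' ≤ k → k + 1 ≤ B.K → RanBelow Gate (k + 1) →
      ∀ U, Fn b k' (k + 1) U = E k U (fun z => Fn b k' k (act k z U)))
    (h𝒢 : ∀ (b : B.Birth) (k' k : ℕ), B.birthScale b ≤ k' → k' ≤ k → k + 1 ≤ B.K → RanBelow Gate (k + 1) →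
      ∀ U, (fun z => Fn b k' k (act k z U)) ∈ 𝒢 k)
    (hD : ∀ k, (D k).Nonempty) (hϱ : ∀ b k' k, 0 < ϱ b k' k)
    (h𝒢c : ∀ (k : ℕ) (c : F), (fun _ : Z => c) ∈ 𝒢 k) (h𝒢s : ∀ (k : ℕ), ∀ g ∈ 𝒢 k, ∀ g' ∈ 𝒢 k, g - g' ∈ 𝒢 k)
    (hsub : ∀ (k : ℕ) (U : 𝒰), ∀ g ∈ 𝒢 k, ∀ g' ∈ 𝒢 k, E k U (g - g') = E k U g - E k U g')
    (hnorm : ∀ (k : ℕ) (U : 𝒰) (c : F), E k U (fun _ => c) = c)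
    (hop : ∀ (b : B.Birth) (k' k : ℕ), B.birthScale b ≤ k' → k' ≤ k → k + 1 ≤ B.K → RanBelow Gate (k + 1) →
      OpSliceOn (𝒢 k) (E k) (D k) move (Nk b k' (k + 1)) (𝒦 b k' (k + 1)) w (ϱ b k' k) (a k))
    (hdir : ∀ (b : B.Birth) (k' k : ℕ), B.birthScale b ≤ k' → k' ≤ k → k + 1 ≤ B.K →
      ∃ d : Dir, 0 < Nk b k' (k + 1) d ∧ Nk b k' (k + 1) d ≤ w)
    (hcov : ∀ (b : B.Birth) (k' k : ℕ), B.birthScale b ≤ k' → k' ≤ k → k + 1 ≤ B.K → RanBelow Gate (k + 1) →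
      ∀ (U₀ U₁ : 𝒰) (δ : ℝ), RawAdm move (Nk b k' (k + 1)) (𝒦 b k' (k + 1)) U₀ U₁ δ → δ ≤ w → ∀ z ∈ D k,
        RawAdm move (Nk b k' k) (𝒦 b k' k) (act k z U₀) (act k z U₁) δ)
    (hpair : ∀ (b : B.Birth) (k' k : ℕ), B.birthScale b ≤ k' → k' ≤ k → k + 1 ≤ B.K → RanBelow Gate (k + 1) →
      ∀ (U₀ U₁ : 𝒰) (δ : ℝ), RawAdm move (Nk b k' (k + 1)) (𝒦 b k' (k + 1)) U₀ U₁ δ → δ ≤ w →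
        ∀ z ∈ D k, ∀ z' ∈ D k, z ≠ z' → RawAdm move (Nk b k' k) (𝒦 b k' k) (act k z' U₁) (act k z U₁) (ω b k' k))
    (hω : ∀ b k' k, 0 ≤ ω b k' k ∧ ω b k' k ≤ w)
    (hdom : ∀ (b : B.Birth) (k' k : ℕ), B.birthScale b ≤ k' → k' ≤ k → k + 1 ≤ B.K →
      a k * (1 + 4 * ω b k' k / ϱ b k' k) ≤ α k)
    (hinv : ∀ b k' k, GaugeInvariant (rel b k' k) (Fn b k' k))
    (hdefw : ∀ b k' k, defect b k' k ≤ w)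
    (hrate : ∀ (b : B.Birth) (k' k : ℕ), B.birthScale b ≤ k' → k' ≤ k → k ≤ B.K →
      defect b k' k ≤ cδ * ψ ^ (k - k'))
    (hlin : ∀ (b : B.Birth) (k' k : ℕ), B.birthScale b ≤ k' → k' ≤ k → k ≤ B.K → RanBelow Gate k → ∀ ε > 0,
      ∃ U₀ ∈ 𝒦 b k' k, ∃ U₁ : 𝒰, RelGauge (rel b k' k) move (Nk b k' k) U₀ U₁ (defect b k' k) ∧
        T.lin b k' k ≤ ‖Fn b k' k U₁ - Fn b k' k U₀‖ + ε) :
    T.TransportsFromVar (4 * cδ / r) (fun i => ψ * α i) Gate :=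
  transportsFromVar_of_opSlices_windowed hα hr hmove hsl hFn h𝒢 hD hϱ
    (fun b k' k hbk' hk'k hk hran =>
      supCost_of_opSliceOn (h𝒢s k) (hsub k) (hop b k' k hbk' hk'k hk hran) hmove (hϱ b k' k).le
        (hdir b k' k hbk' hk'k hk))
    (fun b k' k hbk' hk'k hk hran =>
      opSliceOn_centred (h𝒢c k) (h𝒢s k) (hsub k) (hnorm k) (hop b k' k hbk' hk'k hk hran))
    hcov hpair hω hdom hinv hdefw hrate hlin

end ClassGuard

section ClassGuardLattice

open T4BirthChartTransport (GaugeInvariant BirthSlice RelGauge)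
open T4BlockTransport (Fld NDir latMove latN latMove_zero latMove_one_apply)

variable {B : Booking} {T : Trajectory B}
variable {R : Type*} [NormedRing R] [NormedAlgebra ℂ R] {d : ℕ}
  {F : Type*} [NormedAddCommGroup F] [NormedSpace ℂ F] [CompleteSpace F]

/-- **ON `ℤ^d`, THE CLASS-GUARDED PIPELINE WITH THE CHART GEOMETRY DISCHARGED** — §K
`transportsFromVar_of_linearOpSlices_lattice` VERBATIM except that, per met step `k`, the subtractivity `hsub` and the
operator slice `hop` of the step operation `E k` are asked ON THE INTEGRAND CLASS `𝒢 k` only (a class containing the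
constants and closed under differences: `h𝒢c`, `h𝒢s`) — the format in which `E k U` may LITERALLY be a normalised
integral over the fluctuation bond fields with `𝒢 k` = the integrands integrable (resp. bounded measurable) on `D k`
(§F's typing T1; `setIntegral_not_subtractive`).  Nestings (N1)/(N2), diameter (DIAM), births, recursion/class,
domination, invariance, defects, attainment: unchanged.  Same conclusion. [folklore] -/
theorem transportsFromVar_of_linearOpSlicesOn_lattice {Gate : ℕ → Prop} {Fn : B.Birth → ℕ → ℕ → Fld d R → F}
    {rel : B.Birth → ℕ → ℕ → Fld d R → Fld d R → Prop} {𝒦 : B.Birth → ℕ → ℕ → Set (Fld d R)}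
    {𝒢 : ℕ → Set (Fld d R → F)} {E : ℕ → Fld d R → (Fld d R → F) → F} {D : ℕ → Set (Fld d R)}
    {defect : B.Birth → ℕ → ℕ → ℝ} {cδ ψ w r : ℝ} {a α ω : ℕ → ℝ} {ϱ : B.Birth → ℕ → ℕ → ℝ}
    (hα : ∀ i, 0 ≤ α i) (hr : 0 < r) (hw : 0 < w)
    (hsl : ∀ (b : B.Birth) (k' : ℕ), B.birthScale b ≤ k' → k' ≤ B.K → RanBelow Gate k' →
      BirthSlice (Fn b k' k') latMove latN (𝒦 b k' k') w r (T.gen b k'))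
    (hFn : ∀ (b : B.Birth) (k' k : ℕ), B.birthScale b ≤ k' → k' ≤ k → k + 1 ≤ B.K → RanBelow Gate (k + 1) →
      ∀ U, Fn b k' (k + 1) U = E k U (fun z => Fn b k' k (U + z)))
    (h𝒢 : ∀ (b : B.Birth) (k' k : ℕ), B.birthScale b ≤ k' → k' ≤ k → k + 1 ≤ B.K → RanBelow Gate (k + 1) →
      ∀ U, (fun z => Fn b k' k (U + z)) ∈ 𝒢 k)
    (hD : ∀ k, (D k).Nonempty) (hϱ : ∀ b k' k, 0 < ϱ b k' k)
    (h𝒢c : ∀ (k : ℕ) (c : F), (fun _ : Fld d R => c) ∈ 𝒢 k)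
    (h𝒢s : ∀ (k : ℕ), ∀ g ∈ 𝒢 k, ∀ g' ∈ 𝒢 k, g - g' ∈ 𝒢 k)
    (hsub : ∀ (k : ℕ) (U : Fld d R), ∀ g ∈ 𝒢 k, ∀ g' ∈ 𝒢 k, E k U (g - g') = E k U g - E k U g')
    (hnorm : ∀ (k : ℕ) (U : Fld d R) (c : F), E k U (fun _ => c) = c)
    (hop : ∀ (b : B.Birth) (k' k : ℕ), B.birthScale b ≤ k' → k' ≤ k → k + 1 ≤ B.K → RanBelow Gate (k + 1) →
      OpSliceOn (𝒢 k) (E k) (D k) latMove latN (𝒦 b k' (k + 1)) w (ϱ b k' k) (a k))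
    (hN1 : ∀ (b : B.Birth) (k' k : ℕ), B.birthScale b ≤ k' → k' ≤ k → k + 1 ≤ B.K →
      ∀ z ∈ D k, ∀ U ∈ 𝒦 b k' (k + 1), U + z ∈ 𝒦 b k' k)
    (hN2 : ∀ (b : B.Birth) (k' k : ℕ), B.birthScale b ≤ k' → k' ≤ k → k + 1 ≤ B.K →
      ∀ U₀ ∈ 𝒦 b k' (k + 1), ∀ p : NDir d R, latN p ≤ w → ∀ z' ∈ D k, latMove U₀ p 1 + z' ∈ 𝒦 b k' k)
    (hdiam : ∀ k, ∀ z ∈ D k, ∀ z' ∈ D k, ∀ x ν, ‖z x ν - z' x ν‖ ≤ ω k)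
    (hω : ∀ k, 0 < ω k ∧ ω k ≤ w)
    (hdom : ∀ (b : B.Birth) (k' k : ℕ), B.birthScale b ≤ k' → k' ≤ k → k + 1 ≤ B.K →
      a k * (1 + 4 * ω k / ϱ b k' k) ≤ α k)
    (hinv : ∀ b k' k, GaugeInvariant (rel b k' k) (Fn b k' k))
    (hdefw : ∀ b k' k, defect b k' k ≤ w)
    (hrate : ∀ (b : B.Birth) (k' k : ℕ), B.birthScale b ≤ k' → k' ≤ k → k ≤ B.K →
      defect b k' k ≤ cδ * ψ ^ (k - k'))
    (hlin : ∀ (b : B.Birth) (k' k : ℕ), B.birthScale b ≤ k' → k' ≤ k → k ≤ B.K → RanBelow Gate k → ∀ ε > 0,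
      ∃ U₀ ∈ 𝒦 b k' k, ∃ U₁ : Fld d R, RelGauge (rel b k' k) latMove latN U₀ U₁ (defect b k' k) ∧
        T.lin b k' k ≤ ‖Fn b k' k U₁ - Fn b k' k U₀‖ + ε) :
    T.TransportsFromVar (4 * cδ / r) (fun i => ψ * α i) Gate :=
  transportsFromVar_of_linearOpSlicesOn_windowed (act := fun _ z U => U + z) (Nk := fun _ _ _ => latN)
    (ϱ := ϱ) (ω := fun _ _ k => ω k) hα hr latMove_zero hsl hFn h𝒢 hD hϱ h𝒢c h𝒢s hsub hnorm hop
    (fun _ _ _ _ _ _ => hdir_lattice hw)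
    (fun b k' k hbk' hk'k hk _ U₀ U₁ δ hadm _ z hz => hcov_add (hN1 b k' k hbk' hk'k hk) U₀ U₁ δ hadm z hz)
    (fun b k' k hbk' hk'k hk _ => hpair_add (hω k).1 (hdiam k) (hN2 b k' k hbk' hk'k hk))
    (fun _ _ k => ⟨(hω k).1.le, (hω k).2⟩) hdom hinv hdefw hrate hlin

end ClassGuardLattice

/-! #### §L, why the guard, and non-vacuity: the normalised Lebesgue operation on `[0,1]` -/

section ClassGuardWitness

open MeasureTheory Set Metric
open T4BirthChartTransport (BirthSlice)

/-- [folklore] `x ↦ x⁻¹` (complex-valued) is not integrable on `[0,1]`. -/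
theorem not_integrableOn_ofReal_inv_Icc : ¬ IntegrableOn (fun x : ℝ => ((x⁻¹ : ℝ) : ℂ)) (Icc (0 : ℝ) 1) := by
  intro h
  have h1 : IntegrableOn (fun x : ℝ => x⁻¹) (Icc (0 : ℝ) 1) := by
    rw [IntegrableOn]
    simpa using h.re
  have hnot : ¬ IntervalIntegrable (fun x : ℝ => x⁻¹) volume 0 1 := by
    rw [intervalIntegrable_inv_iff]
    push Not
    exact ⟨zero_ne_one, by simp⟩
  exact hnot ((intervalIntegrable_iff_integrableOn_Ioc_of_le zero_le_one).2 (h1.mono_set Ioc_subset_Icc_self))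

/-- **WHY THE CLASS GUARD** (negative witness).  §J's / §K's supplier binder `hsub` — `E U (g − g′) = E U g − E U g′`
for ALL `g, g′ : Z → F` — FAILS for an operation that is literally a normalised integral: on `([0,1], Lebesgue)` (a
probability space, constants integrable, the operation normalised) take `g = 1` and `g′ = x⁻¹`; `g′` and `g − g′` are
not integrable, so by the junk value `∫ = 0` the left side is `0` and the right side is `1`.  Hence a consumer modelling
the step operation `E k U` by an integral over the fluctuation variables cannot discharge the class-free `hsub`; §L asks
it on the class. [folklore] -/
theorem setIntegral_not_subtractive :
    ¬ ∀ g g' : ℝ → ℂ, (∫ x in Icc (0 : ℝ) 1, (g - g') x) = (∫ x in Icc (0 : ℝ) 1, g x) - ∫ x in Icc (0 : ℝ) 1, g' x := by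
  intro h
  have hg' : ¬ IntegrableOn (fun x : ℝ => ((x⁻¹ : ℝ) : ℂ)) (Icc (0 : ℝ) 1) := not_integrableOn_ofReal_inv_Icc
  have hg : IntegrableOn (fun _ : ℝ => (1 : ℂ)) (Icc (0 : ℝ) 1) := integrableOn_const (hs := measure_Icc_lt_top.ne)
  have hd : ¬ IntegrableOn ((fun _ : ℝ => (1 : ℂ)) - fun x : ℝ => ((x⁻¹ : ℝ) : ℂ)) (Icc (0 : ℝ) 1) := by
    intro hd
    apply hg'
    have h2 := hg.sub hd
    simpa using h2
  have e := h (fun _ => (1 : ℂ)) (fun x : ℝ => ((x⁻¹ : ℝ) : ℂ))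
  rw [integral_undef hd, integral_undef hg', sub_zero, setIntegral_const, Real.volume_real_Icc_of_le zero_le_one] at e
  norm_num at e

/-- CONSISTENCY / NON-VACUITY — the SAME operation satisfies §L's GUARDED binders with the class `𝒢` = the functions
integrable on `[0,1]`: constants in the class, differences in the class, subtractive ON THE CLASS, normalised, and the
guarded operator slice with `a = 1` on every window / radius (no background dependence: `𝒰 = ℂ`, `move U _ t = U + t`
as in §J's toy; the sup cost is `‖∫_{[0,1]} h‖ ≤ m`), while the CLASS-FREE `hsub` of §J fails for it
(`setIntegral_not_subtractive`).  A toy: nothing of Bałaban's operations is modelled. [folklore] -/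
example (w ϱ : ℝ) :
    (∀ c : ℂ, (fun _ : ℝ => c) ∈ {h : ℝ → ℂ | IntegrableOn h (Icc (0 : ℝ) 1)}) ∧
    (∀ g ∈ {h : ℝ → ℂ | IntegrableOn h (Icc (0 : ℝ) 1)}, ∀ g' ∈ {h : ℝ → ℂ | IntegrableOn h (Icc (0 : ℝ) 1)},
      g - g' ∈ {h : ℝ → ℂ | IntegrableOn h (Icc (0 : ℝ) 1)}) ∧
    (∀ U : ℂ, ∀ g ∈ {h : ℝ → ℂ | IntegrableOn h (Icc (0 : ℝ) 1)}, ∀ g' ∈ {h : ℝ → ℂ | IntegrableOn h (Icc (0 : ℝ) 1)},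
      (fun (_ : ℂ) (h : ℝ → ℂ) => ∫ x in Icc (0 : ℝ) 1, h x) U (g - g') =
        (fun (_ : ℂ) (h : ℝ → ℂ) => ∫ x in Icc (0 : ℝ) 1, h x) U g -
          (fun (_ : ℂ) (h : ℝ → ℂ) => ∫ x in Icc (0 : ℝ) 1, h x) U g') ∧
    (∀ (U : ℂ) (c : ℂ), (fun (_ : ℂ) (h : ℝ → ℂ) => ∫ x in Icc (0 : ℝ) 1, h x) U (fun _ => c) = c) ∧
    OpSliceOn (𝒰 := ℂ) (Dir := Unit) {h : ℝ → ℂ | IntegrableOn h (Icc (0 : ℝ) 1)}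
      (fun (_ : ℂ) (h : ℝ → ℂ) => ∫ x in Icc (0 : ℝ) 1, h x) (Icc (0 : ℝ) 1) (fun U _ t => U + t) (fun _ => w)
      (Set.univ : Set ℂ) w ϱ 1 ∧
    ¬ (∀ (U : ℂ) (g g' : ℝ → ℂ), (fun (_ : ℂ) (h : ℝ → ℂ) => ∫ x in Icc (0 : ℝ) 1, h x) U (g - g') =
        (fun (_ : ℂ) (h : ℝ → ℂ) => ∫ x in Icc (0 : ℝ) 1, h x) U g -
          (fun (_ : ℂ) (h : ℝ → ℂ) => ∫ x in Icc (0 : ℝ) 1, h x) U g') := by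
  refine ⟨fun c => integrableOn_const (hs := measure_Icc_lt_top.ne), fun g hg g' hg' => hg.sub hg', ?_, ?_, ?_, ?_⟩
  · intro U g hg g' hg'
    show (∫ x in Icc (0 : ℝ) 1, (g - g') x) = (∫ x in Icc (0 : ℝ) 1, g x) - ∫ x in Icc (0 : ℝ) 1, g' x
    simp only [Pi.sub_apply]
    exact integral_sub hg hg'
  · intro U c
    show (∫ _ in Icc (0 : ℝ) 1, c) = c
    rw [setIntegral_const, Real.volume_real_Icc_of_le zero_le_one]
    simp
  · intro h hh m hm U _ d _ _
    refine ⟨Set.univ, differentiableOn_const _, ?_, fun _ _ => Set.subset_univ _⟩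
    intro t _
    show ‖∫ x in Icc (0 : ℝ) 1, h x‖ ≤ 1 * m
    calc ‖∫ x in Icc (0 : ℝ) 1, h x‖ ≤ m * volume.real (Icc (0 : ℝ) 1) :=
          norm_setIntegral_le_of_norm_le_const measure_Icc_lt_top hm
      _ = 1 * m := by rw [Real.volume_real_Icc_of_le zero_le_one]; ring
  · intro h6
    exact setIntegral_not_subtractive fun g g' => h6 0 g g'

end ClassGuardWitness

end Literature.MathematicalPhysics.QuantumFieldTheory.Balaban1983to89.T4TrajectoryModulus
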